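import Mathlib
import Literature.Combinatorics.Kakeya.KakeyaSharpDensityBound
import HarnessLib

/-!
# The Kakeya maximal conjecture over finite fields (Ellenberg–Oberlin–Tao 2010: Theorem 1.3,
# Propositions 2.3–2.5 and Corollary 1.10, for lines)

Topic `Literature/Combinatorics/Kakeya`.  Everything in this file is PROVED (no named fact, no
`sorry`).  Sixth file of the finite-field Kakeya line of this directory, after
`FiniteFieldKakeya.lean` (Dvir), `SmallKakeyaSets.lean` and `KakeyaMultiplicityBound.lean`
(Saraf–Sudan), `KakeyaMethodOfMultiplicities.lean` (Dvir–Kopparty–Saraf–Sudan) and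
`KakeyaSharpDensityBound.lean` (Bukh–Chao): the **finite-field Kakeya maximal function conjecture**
`‖f*‖_{ℓᴺ} ≤ C_N q^{(N−1)/N} ‖f‖_{ℓᴺ(𝔽_qᴺ)}` (Theorem 1.3, eq. (1.1); here with an explicit `C_N`),
its distributional form (Propositions 2.3–2.5: the polynomial method with multiplicities combined
with the Nikishin–Maurey–Pisier–Stein random-superposition trick) and the set-theoretic consequence,
the **Kakeya set conjecture with multiplicity** (Corollary 1.10): if lines in `J` different
directions each meet `E ⊆ 𝔽_qᴺ` in at least `λ` points then `|E| ≳ J λᴺ / q^{N−1}`, *linear* in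
the number `J` of directions.

J. S. Ellenberg, R. Oberlin, T. Tao, *The Kakeya set and maximal conjectures for algebraic
varieties over finite fields*, Mathematika **56** (2010), no. 1, 1–25
(doi:10.1112/S0025579309000400 = arXiv:0903.1879v2, same numbering), verbatim:

> **Theorem 1.1** (Kakeya set conjecture for `Fⁿ`). Let `n ≥ 1`, let `F` be a finite field, and
> let `E ⊂ Fⁿ` be a subset of `Fⁿ` that contains a line in every direction. Then `|E| ≥ c_n |F|ⁿ`,
> where `c_n > 0` depends only on `n`.
>
> **Theorem 1.3** (Kakeya maximal conjecture for `Fⁿ`). Let `n ≥ 1`, let `F` be a finite field,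
> and let `f : Fⁿ → ℝ` be a function. Then
> `‖ sup_{γ // ω} ∑_{x ∈ γ} |f(x)| ‖_{ℓⁿ(P^{n−1}(F))} ≤ C_n |F|^{(n−1)/n} ‖f‖_{ℓⁿ(Fⁿ)}`, (1.1)
> […] a point `ω` of `P^{n−1}(F)` is interpreted as a direction in `Fⁿ` […] The supremum on the
> left-hand side of (1.1) is over all lines `γ` with direction `ω`, and `C_n` is a constant
> depending only on `n`. […] Theorem 1.1 follows immediately from Theorem 1.3 by specializing `f`
> to equal the indicator function `f = 1_E` of the set `E` in Theorem 1.1. […] Theorem 1.3 follows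
> immediately from Theorem 1.6 by taking `V = Pⁿ` and `W` the hyperplane at infinity, and setting
> `d = 1`; then the set of projective lines through a given point of `W(F)` is naturally identified
> with the set of lines in `Fⁿ` parallel to some fixed line.
>
> (§2) **Remark 2.2.** It is easy to see that the `d = 1` case of Theorem 2.1 implies Theorem 1.3,
> by applying a projective transformation to move `F^{n−1}` to the plane at infinity […].
> (Strictly speaking, this transformation will leave out a codimension one set of directions, and
> also a codimension one set of points, but one can easily erase this omission by rotating the
> estimate a bounded number of times and using the triangle inequality; we omit the details. […])
>
> **Corollary 1.10** (Kakeya set conjecture for algebraic varieties over `F`). Let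
> `N, d, n, F, V, W` be as in Theorem 1.6. Let `w_1, …, w_J ∈ W(F)` be distinct `F`-points in `W`,
> and for each `1 ≤ j ≤ J` let `γ_j` be an irreducible algebraic curve of degree at most `d` in `V`
> that passes through `w_j` but does not lie in `W`. Let `λ ≥ 1`, and let `E ⊂ V(F)` be a set of
> `F`-points in `V` such that `|E ∩ γ_j(F)| ≥ λ` for all `1 ≤ j ≤ J`. Then
> `|E| ≥ C_{N,d,n}^{−n} J λⁿ / |F|^{n−1}`, where `C_{N,d,n}` is the constant in Theorem 1.6.
>
> (§2, "The flat case") **Proposition 2.4** (Distributional estimate, again). Let `d, n ≥ 1`, and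
> let `w_1, …, w_J` be distinct points in `F^{n−1}`. For each `1 ≤ j ≤ J`, let `γ_j` be an
> irreducible algebraic curve in `Aⁿ` of degree at most `d` that passes through `w_j` but does not
> lie in `A^{n−1}`. Let `f : Fⁿ → {0} ∪ [1, +∞)` and `K ‖f‖_{ℓⁿ(Fⁿ)} ≤ λ ≤ |F|` for some
> sufficiently large `K` depending only on `d, n`, and suppose that
> `∑_{v ∈ γ_j(F) ∖ F^{n−1}} f(v) ≥ λ` (2.4) for all `1 ≤ j ≤ J`. Then
> `J ≪ (|F|^{n−2} / λ^{n−1}) ∑_{v ∈ Fⁿ} f(v)ⁿ`. (2.5)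
> The hypothesis and conclusion of this proposition are invariant under translations of `Fⁿ` by
> vectors in `F^{n−1}`. We take advantage of this translation invariance to make a standard
> reduction […] to the case of small `λ` (or equivalently, for large `J`):
> **Proposition 2.5** (Nikishin–Maurey–Pisier–Stein factorization reduction). To prove
> Proposition 2.4, it suffices to do so in the special case `λ = K_0 ‖f‖_{ℓⁿ(Fⁿ)} ≤ |F|` for some
> sufficiently large `K_0` depending on `n` and `d`.
> *Proof.* […] Let `M` be the greatest integer less than or equal to `λⁿ / (K_0ⁿ ‖f‖ⁿ_{ℓⁿ(Fⁿ)})`;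
> thus `M ≥ 1` if `K` is large enough. We use a probabilistic method. Let `u_1, …, u_M ∈ F^{n−1}`
> be selected independently and uniformly at random, and let
> `Ω := {w_j + u_m : 1 ≤ j ≤ J, 1 ≤ m ≤ M}` […] every `w ∈ F^{n−1}` lies in `Ω` with probability
> `1 − (1 − J/|F|^{n−1})^M ≍ min(MJ/|F|^{n−1}, 1)` […] and so we may select `u_1, …, u_M` such that
> `|Ω| ≫ min(MJ, |F|^{n−1})`. (2.6) Fix these `u_1, …, u_M`, and define
> `f_M(v) := (∑_{m=1}^M f(v − u_m)ⁿ)^{1/n}`. Then […] `‖f_M‖ⁿ_{ℓⁿ(Fⁿ)} = M ‖f‖ⁿ_{ℓⁿ(Fⁿ)}` (2.7)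
> […] since `f_M(v) ≥ f(v − u_m)` for every `1 ≤ m ≤ M`, we also have
> `∑_{v ∈ γ_j(F) + u_m ∖ F^{n−1}} f_M(v) ≥ λ` […] If `MJ ≤ |F|^{n−1}` then we obtain (2.5) as
> required. If instead `MJ > |F|^{n−1}` […] we conclude that `λ ≫ K_0ⁿ |F|`. But this contradicts
> the hypothesis `λ ≤ |F|`, if `K_0` is large enough. □
> It remains to prove Proposition 2.4 in the case `λ = K_0 ‖f‖_{ℓⁿ(Fⁿ)}` […] we may now assume
> that `f` is integer-valued. […] Our task is to show that `J ≪ |F|^{n−2} ‖f‖_{ℓⁿ(Fⁿ)}`. (2.8)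
> To establish this, we use the polynomial method of Dvir (or more precisely the weighted
> refinement of this method as used in [Saraf–Sudan], [DKSS]). […] let `V_f` be the subspace of
> polynomials `P` in `𝒫_D` such that for every `v ∈ Fⁿ`, `P` vanishes to order at least `f(v)` at
> `v` […] The condition at each `v` imposes `O(f(v)ⁿ)` linear conditions on `𝒫_D`; thus, summing
> over `v`, we find that `dim 𝒫_D − dim V_f ≪ ∑_{v ∈ Fⁿ} f(v)ⁿ = ‖f‖ⁿ_{ℓⁿ(Fⁿ)}`. In particular,
> if we choose `D` equal to a suitably large multiple of `‖f‖_{ℓⁿ(Fⁿ)}`, the dimension of `V_f` is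
> positive, so we can choose a nonzero `P` in `V_f`. […] Suppose on the contrary that `γ_j` is not
> contained in the vanishing locus of `Q`. Then the algebraic set `{v ∈ γ_j : Q(v) = 0}` […] would
> have degree `O(D)` […] On the other hand, by construction this set contains `v` with multiplicity
> at least `f(v)` for each `v ∈ γ_j(F) ∖ F^{n−1}` […] But this contradicts (2.4) […] Thus
> `|{w ∈ F^{n−1} : Q(w) = 0}| ≥ J`. On the other hand, by construction `Q` restricts to a
> non-trivial polynomial on `F^{n−1}` of degree at most `D`. By Lemma A.3 we have
> `J ≪ |F|^{n−2} D` and (2.8) follows by our choice of `D`.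
>
> (§2, the strong-type step) **Theorem 2.1** (Kakeya maximal conjecture for curves in `Fⁿ`). Let
> `d, n ≥ 1`. For any `f : Fⁿ → ℝ`, let `f* : F^{n−1} → ℝ` be the maximal function
> `f*(w) := sup_{γ ∋ w} ∑_{v ∈ γ(F) ∖ F^{n−1}} |f(v)|` (2.1) […] Then we have
> `‖f*‖_{ℓⁿ(F^{n−1})} ≪ |F|^{(n−1)/n} ‖f‖_{ℓⁿ(Fⁿ)}` […]
> **Proposition 2.3** (Kakeya distributional estimate for curves in `Fⁿ`). Let `d, n ≥ 1`. Then
> there exists `K = K_{d,n}` such that for any `A > 0`, any `f : Fⁿ → {0} ∪ [A, +∞)`, and every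
> `K ‖f‖_{ℓⁿ(Fⁿ)} ≤ λ ≤ A|F|`, we have
> `|{w ∈ F^{n−1} : f*(w) ≥ λ}| ≪ (|F|^{n−2} / (A λ^{n−1})) ‖f‖ⁿ_{ℓⁿ(Fⁿ)}` […]
> *Proof of Theorem 2.1 assuming Proposition 2.3.* We will use a variant of the real interpolation
> method. […] Using the identity
> `‖f*‖ⁿ_{ℓⁿ(F^{n−1})} = n ∫₀^∞ |{w ∈ F^{n−1} : f*(w) ≥ α}| α^{n−1} dα` (2.2) […] The crude
> bound `|{w ∈ F^{n−1} : f*(w) ≥ α}| ≤ |F|^{n−1}` allows one to dispose of the region `α ≤ C₀`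
> […] Then `f` decomposes as `f = f_α + f_{0,α} + ∑_{j=1}^{j_α−1} f_{j,α}`. […]
> `f*(w) ≤ f*_α(w) + ∑_{j=1}^{j_α−1} f*_{j,α}(w) + α/2` and hence
> `|{w : f*(w) ≥ α}| ≤ |{w : f*_α(w) ≥ K}| + ∑_{j=1}^{j_α−1} |{w : f*_{j,α}(w) ≥ α/2^{j+1}}|.`
> […] Now interchange the `α` integration and `v` summation; for each fixed `v`, the function of
> `α` to be integrated against `dα/α` is the product of `f(v)ⁿ` with the characteristic function of
> an interval of the form `[A, 100ⁿ A]`.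
>
> (§4.3) [...] we have the following analogue of Theorem 1.1, first observed in [Li]:
> **Theorem 4.5** (Nikodym set conjecture for `Fⁿ`). Let `n ≥ 1`, let `F` be a finite field, and
> let `E ⊂ Fⁿ` be a subset of `Fⁿ` such that for every `x ∈ Fⁿ ∖ E`, there exists a line `γ`
> passing through `x` such that `γ ∖ {x} ⊂ E`. Then `|E| ≫ |F|ⁿ`. [EOT then note: "after applying
> a projective transformation to a set `E` of the form in Theorem 4.5, one gets something very
> close to a set `E` of the form in Theorem 1.1"; [Li] = L. Li, *On the size of Nikodym sets in
> finite fields*, preprint.]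

## What is proved (ambient space `𝔽_qⁿ⁺¹ = Fin (n + 1) → K`, `N = n + 1`; all constants explicit)

Directions are parametrized, as in `KakeyaSharpDensityBound.lean`, by slopes `b' ∈ 𝔽_qⁿ`
(direction vector `(1, b')`, special coordinate `x₀`); `lineSum f a b' = ∑_t f(a + t(1, b'))` is
the inner sum `∑_{x ∈ γ} f(x)` of (1.1) along the line through `a` with slope `b'`; functions are
`ℕ`-valued (the printed `{0} ∪ [1, ∞)`-valued `f`, after the printed rounding step).  ALL
directions `ω ∈ ℙ(𝔽_qⁿ⁺¹)` (Mathlib's `Projectivization`) are reached at the end (section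
`AllDirections`) by the `N` coordinate charts `{vᵢ ≠ 0}` — the "bounded number of rotations" of
Remark 2.2.
* Interpolation with a prescribed order of vanishing at every point
  (`exists_mem_vanishesToOrder_fun`, `exists_vanishesToOrder_fun_totalDegree_le` — the space
  `V_f`; `choose_add_sub_one_le_pow`: "`O(f(v)ⁿ)` linear conditions", here `≤ f(v)ᴺ` exactly).
* **`card_mul_card_le_of_lineSum_gt` / `card_mul_card_le_of_le_lineSum` — the polynomial method
  step (2.8), the case `λ = K_0‖f‖` of Proposition 2.4:** if
  `∑_v C(f(v) + n, n + 1) < C(D + n + 1, n + 1)` (resp. `(n+1)! ∑_v f(v)ᴺ < μᴺ`) and every slope of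
  `B` has a line with `f`-sum `> D` (resp. `≥ μ`), then `|B| q ≤ D qⁿ` (resp. `≤ (μ − 1) qⁿ`).
* Shears `shear u : (x₀, x') ↦ (x₀, x' + x₀ u)` (`shear_add_smul`: lines of slope `b'` go to lines
  of slope `b' + u`), the superposition `shearSup u f = max_m f ∘ S_{u_m}⁻¹` (`le_shearSup`,
  `lineSum_le_lineSum_shearSup`, `sum_shearSup_pow_le` — (2.7) as an inequality), the slope set
  `shearSlopes u B = B + {u_1, …, u_M}` (the set `Ω`), the Bernoulli-type bound
  `sub_pow_mul_add_mul_le` (`(P − J)^M (P + MJ) ≤ P^{M+1}`) and **`exists_shearSlopes_card_ge` —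
  the averaging step (2.6): some `M`-tuple of shears has `2|Ω| ≥ min(M|B|, qⁿ)`.**
* **`card_pow_mul_pow_le` — Proposition 2.4 (via Proposition 2.5), explicit:** for `n ≥ 1`,
  `f : 𝔽_qⁿ⁺¹ → ℕ`, a slope set `B` each of whose slopes has a line of `f`-sum `≥ λ`, under
  `(4N)ᴺ ∑ fᴺ ≤ λᴺ` (the printed `K‖f‖ ≤ λ`, `K = 4N`) and `λ ≤ q`:
  `|B|ᴺ λ^{N(N−1)} ≤ C_n q^{(N−2)N} (∑_v f(v)ᴺ)ᴺ` with `C_n = eotConst n = 2^{2n+1} N! (4N)^{Nn}`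
  (`eotConst_le_pow`: `C_n ≤ (4N)^{N²}`), i.e. (2.5) with `J ≤ (4N)ᴺ q^{N−2} λ^{−(N−1)} ∑ fᴺ`.
* **`card_mul_pow_le_of_rich_lines` — Corollary 1.10 for lines (`V = Pᴺ`, `W` = hyperplane at
  infinity, `d = 1`):** if every slope `b' ∈ B` has a line meeting `E ⊆ 𝔽_qⁿ⁺¹` in `≥ λ` points,
  then `|B| λᴺ ≤ (4N)ᴺ qⁿ |E|` (no size restriction on `λ`: below `(4N)ᴺ|E| ≤ λᴺ` the bound is the
  trivial `|B| ≤ qⁿ`).  Consequences: `pow_le_mul_card_of_isAlmostKakeya` (Theorem 1.1 recovered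
  through the maximal route: `qᴺ ≤ (4N)ᴺ |E|` for almost Kakeya sets — the sharp constants are the
  business of the four earlier files), `delta_gamma_le_card` (real density form: `≥ δqⁿ` slopes with
  `γq`-rich lines force `δ γᴺ qᴺ ≤ (4N)ᴺ |E|`, linear in `δ`, where Dvir's Theorem 1.4,
  `choose_floor_le_card_of_isDeltaGammaKakeya`, has `min(δ, γ)ᴺ`).
* The maximal function `maxLineSum f b' = max_a lineSum f a b'` (integer-valued `f`) and
  `maxLineSumR f b' = max_a ∑_t |f(a + t(1,b'))|` (real-valued `f`): the left-hand side of (1.1) at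
  the direction `(1 : b')`; **`card_filter_mul_pow_le` — Proposition 2.4 in distributional form**
  (`#{f* ≥ λ} λⁿ ≤ (4N)ᴺ q^{n−1} ‖f‖ᴺ_N` for `(4N)ᴺ‖f‖ᴺ ≤ λᴺ`, `λ ≤ q`) and
  **`card_filter_mul_mul_pow_le` — Proposition 2.3** (values in `{0} ∪ [a, ∞)`, `λ ≤ aq`:
  `#{f* ≥ λ} · a λⁿ ≤ 4ⁿ(4N)ᴺ q^{n−1} ‖f‖ᴺ_N`).
* The real-interpolation machinery of the proof of Theorem 2.1: `pow_le_two_pow_mul_sum_filter`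
  (dyadic layer cake, for (2.2)), the pieces `lowPart` / `bandPart` / `topPart` (`f_{0,α}`,
  `f_{j,α}`, `f_α`; `le_lowPart_add_sum_bandPart_add_topPart`), the admissible-band index
  `bandIndex` (the printed `j_α − 1`; `bandIndex_add_le`: injective in the level), the covering
  step `card_level_le`, the per-piece bounds `band_level_bound` / `top_level_bound`, the bounded
  overlap `sum_levels_bandPart_le` and the level sums `sum_low_levels_le` / `sum_high_levels_le`.
* **`sum_pow_maxLineSum_le` — THEOREM 1.3 for `f : 𝔽_qⁿ⁺¹ → ℕ`:**
  `∑_{b'} f*(b')ᴺ ≤ C q ⁿ ∑_v f(v)ᴺ` with `C = maxConst n = 2^{5n+7} N (4N)ᴺ`; and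
  **`kakeya_maximal_inequality` — THEOREM 1.3 / (1.1) for `f : 𝔽_qⁿ⁺¹ → ℝ`:**
  `∑_{b'} (sup_{ℓ ∥ (1,b')} ∑_{x ∈ ℓ} |f(x)|)ᴺ ≤ C qⁿ ∑_x |f(x)|ᴺ`, i.e.
  `‖f*‖_{ℓᴺ} ≤ C^{1/N} q^{(N−1)/N} ‖f‖_{ℓᴺ}` (by discretization `⌊|f|/ε⌋`, `ε → 0`).
* `coordSwap i` / `chartVec i b'` (the chart of directions with `vᵢ ≠ 0`), `dirLineSum` /
  `dirMaxLineSum` / `projMaxLineSum` (line sums and the maximal function at an arbitrary direction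
  VECTOR `v`, resp. at `ω ∈ ℙ(𝔽_qⁿ⁺¹)`, for values in any linearly ordered additive monoid: `ℕ`,
  or `ℝ` applied to `|f|`), `dirMaxLineSum_smul` (only the direction `[v]` matters), the chart
  identities `dirMaxLineSum_coordSwap` / `dirMaxLineSum_chartVec` / `dirMaxLineSum_cons`, the
  covering lemmas `exists_eq_smul_chartVec`, `sum_ne_zero_le_sum_charts`, `sum_proj_le_sum_charts`,
  and **`kakeya_maximal_inequality_proj` — THEOREM 1.3 exactly as printed, the `ℓᴺ(P^{N−1}(F))`
  norm over ALL directions:**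
  `∑_{ω ∈ ℙ(𝔽_qⁿ⁺¹)} (sup_{ℓ ∥ ω} ∑_{x ∈ ℓ} |f(x)|)ᴺ ≤ N C qⁿ ∑_x |f(x)|ᴺ` (a `finsum` over the
  `Finite` type `ℙ`); `finsum_pow_projMaxLineSum_le` (the same for
  `f : 𝔽_qⁿ⁺¹ → ℕ`) and `sum_ne_zero_pow_dirMaxLineSum_le` (over nonzero direction vectors, factor
  `N(q − 1)`).
* `IsNikodym` (the hypothesis of Theorem 4.5, in `𝔽_qⁿ = Fin n → K`) and
  **`choose_le_card_of_isNikodym` — THEOREM 4.5 in the explicit form `C(q − 2 + n, n) ≤ |E|`**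
  (`pow_le_factorial_mul_card_of_isNikodym`: `(q − 1)ⁿ ≤ n! |E|`; `choose_le_ncard_of_isNikodym`
  for `Set`s). DEVIATION: proved by the direct polynomial-method argument (a nonzero `g` of
  degree `≤ q − 2` vanishing on `E` vanishes identically on every line `γ` with `γ ∖ {x} ⊆ E`,
  hence at `x`, hence everywhere — contradiction), not by EOT's projective reduction to
  Theorem 1.1; the explicit constant is this file's, EOT only assert `|E| ≫ |F|ⁿ`.

## Proof architecture (and where it departs from the printed text)

The printed §2 works in the "flat" chart: base points `w_j` on the hyperplane `F^{n−1} ⊂ Fⁿ`,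
curves through `w_j` not contained in it, translations of `F^{n−1}` as the symmetry group, and
Theorem 1.3 is recovered by the projective change of variables of Remark 2.2 ("we omit the
details").  This file runs the same argument directly in the chart of directions: conjugating by
that change of variables (`(x₀, x') ↦ (1/x₀, x'/x₀)`), the base points `w_j` become the slopes
`b'`, the curves become the lines of slope `b'`, and the translations `w ↦ w + u` become the shears
`S_u`.  Step by step: (i) the space `V_f` and the count of conditions as printed (`C(m + n, n + 1)
≤ mᴺ` conditions of order `m`); (ii) the restriction of `P` to a rich line vanishes identically
because `∑_t mult(P, a + tb) ≥ ∑_t f > deg P` (DKSS Corollary 2.6, `mult_le_rootMultiplicity`, in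
place of the Bezout count on the curve `γ_j`); hence the top homogeneous part `P_d` vanishes at
`(1, b')` (the flat text instead factors `P = x_nʲ Q` and restricts `Q` to `F^{n−1}`; in the
direction chart the hyperplane at infinity is reached through `P_d`, as in Dvir's proof and in
`KakeyaSharpDensityBound.lean`); `P_d(1, x') ≠ 0` (`dehom_ne_zero_of_isHomogeneous`) has
`≥ |B|` zeros and degree `≤ D`: Schwartz–Zippel (`card_zeros_mul_card_le`, the printed Lemma A.3);
(iii) Proposition 2.5 with `M = ⌊λᴺ/((4N)ᴺ ∑fᴺ)⌋` random shears; the superposition is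
`max_m f(S_{u_m}⁻¹ v)` instead of the printed `ℓⁿ`-sum `f_M` — it has the two properties the proof
uses (`≥` each copy; `∑ (max)ᴺ ≤ M ∑ fᴺ`, the inequality form of (2.7)) and stays integer-valued,
so the printed rounding step disappears; the expectation computation (2.6) is the exact double
count `∑_u |Ω_u| ≥ qⁿ(q^{nM} − (qⁿ − J)^M) ≥ ½ q^{nM} min(MJ, qⁿ)`; the critical threshold is the
least `μ` with `N! M ∑fᴺ < μᴺ` (so `μ ≤ λ`), and the two cases `MJ ≶ qⁿ` end as printed
(`MJ ≥ qⁿ` contradicts `λ ≤ q` because `2ᴺ N! < (4N)ᴺ`).  (iv) Proposition 2.3 from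
Proposition 2.4 by "dividing `f` and `λ` by `A`": here `g ↦ ⌊g/a⌋`, `λ ↦ ⌊λ/2a⌋`.  (v) Theorem 2.1 /
1.3 from Proposition 2.3 exactly along the printed real-interpolation argument, discretized: the
levels `α = 2ᵏ` (a dyadic layer cake replaces (2.2)), the "crude bound" below `αᴺ < 2ᴺ D` with
`D = 4ᴺ(4N)ᴺ‖f‖ᴺ_N` (the printed region `α ≤ C₀`), the decomposition
`f = f_{0,α} + ∑_j f_{j,α} + f_α` by the size of `2q f(v)/α` with band ratio `2ᴺ` (printed:
`100ⁿ`; any ratio `> 2^{N−1}` gives the geometric decay in `j`), thresholds `α/2^{j+1}` as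
printed, the largest admissible band `bandIndex` (the printed `j_α − 1`), Proposition 2.3 for
each piece, the bounded overlap "each `v` meets the
`j`-th band for at most `N` levels" (the printed interchange of the `dα/α` integration and the `v`
summation), and `∑_{α} 2^{−j_α} ≤ 2` for the top parts (injectivity of `α ↦ j_α`); the real-valued
statement follows from the integer-valued one by `f ↦ ⌊|f|/ε⌋` and `ε → 0`.  All `≪` are unpacked
into the explicit constants above; no attempt is made to optimize them.

## Not in this file

* The interpolated estimates of Remark 1.4 (`ℓᵖ → ℓ^q` bounds) and any optimization of the
  constants.
* Curves of degree `d > 1`, general varieties `W` (Theorem 1.6, §3: random projections, Bezout,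
  Lang–Weil-free point counts of Appendix A), and the variants of §4 other than Theorem 4.5
  (restricted maximal functions 4.3, Nikodym maximal functions 4.6–4.8, varieties and blow-ups
  4.10, `k`-planes 4.15).

## References
* [EllenbergOberlinTao2010KakeyaMaximal] J. S. Ellenberg, R. Oberlin, T. Tao, Mathematika 56
  (2010), 1–25 — Theorems 1.1, 1.3, eq. (1.1), Remark 1.4, Theorem 1.6, Corollary 1.10 (§1);
  Theorem 2.1 (eq. (2.1)), Remark 2.2, Proposition 2.3, the proof of Theorem 2.1 from
  Proposition 2.3 (eqs. (2.2), (2.3)), Propositions 2.4 (eqs. (2.4), (2.5)), 2.5 (eqs. (2.6),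
  (2.7)), eq. (2.8) and the polynomial-method proof (§2); Theorem 4.5 (§4.3); Lemma A.3
  (Schwartz–Zippel).
* [DvirEtAl2013] — Hasse derivatives, `mult`, Corollary 2.6, Proposition 3.1 (files
  `KakeyaMethodOfMultiplicities.lean`, `KakeyaMultiplicityBound.lean`).
* [BukhChao2021SharpDensityKakeya] — the slope chart `(1, b')`, `dehom`, `lowExps`
  (file `KakeyaSharpDensityBound.lean`).
* [Dvir2009FiniteFieldKakeya] — `coeff_aeval_line`, `card_zeros_mul_card_le` (file
  `FiniteFieldKakeya.lean`).
-/

open MvPolynomial Finset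

namespace Literature.Combinatorics.Kakeya

namespace FiniteFieldKakeya

open Literature.AlgebraicGeometry.Resolution (hasseDeriv)

variable {K : Type*} [Field K]

/-! ### Interpolation with a prescribed order of vanishing at every point -/

section Interpolation

variable {N : ℕ}

/-- `#{i ∈ ℕᴺ : |i| < k} ≤ C(k + N − 1, N)` (equality for `k ≥ 1`). [folklore] -/
theorem card_lowExps_le_choose (N k : ℕ) : (lowExps N k).card ≤ (k + N - 1).choose N := by
  rcases Nat.eq_zero_or_pos k with rfl | hk
  · have h : lowExps N 0 = ∅ := by
      ext i
      simp [mem_lowExps]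
    rw [h, card_empty]
    exact Nat.zero_le _
  · rw [card_lowExps_eq_choose N hk]

/-- Interpolation with a prescribed multiplicity `m(a)` at each point `a ∈ S`, inside a
finite-dimensional space `V` of polynomials: if `∑_{a ∈ S} C(m(a) + N − 1, N) < dim V` then some
nonzero `g ∈ V` vanishes to order `m(a)` at every `a ∈ S` ("the condition at each `v` imposes
`O(f(v)ⁿ)` linear conditions", EOT §2). [folklore] -/
theorem exists_mem_vanishesToOrder_fun (m : (Fin N → K) → ℕ) (S : Finset (Fin N → K))
    (V : Submodule K (MvPolynomial (Fin N) K)) [Module.Finite K V]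
    (hS : ∑ a ∈ S, (m a + N - 1).choose N < Module.finrank K V) :
    ∃ g ∈ V, g ≠ 0 ∧ ∀ a ∈ S, VanishesToOrder g a (m a) := by
  classical
  set I : Finset (Σ _ : Fin N → K, Fin N →₀ ℕ) := S.sigma fun a => lowExps N (m a) with hI
  let Φ : V →ₗ[K] (↥I → K) :=
    LinearMap.pi fun p : ↥I =>
      (lcoeff K p.1.2).comp
        ((aeval (R := K) fun i => X i + C (p.1.1 i)).toLinearMap.comp V.subtype)
  have hIcard : I.card ≤ ∑ a ∈ S, (m a + N - 1).choose N := by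
    rw [hI, card_sigma]
    exact sum_le_sum fun a _ => card_lowExps_le_choose N (m a)
  have hlt : Module.finrank K (↥I → K) < Module.finrank K V := by
    rw [Module.finrank_fintype_fun_eq_card, Fintype.card_coe]
    exact lt_of_le_of_lt hIcard hS
  obtain ⟨g, hgker, hg0⟩ :=
    (Submodule.ne_bot_iff _).1 (LinearMap.ker_ne_bot_of_finrank_lt (f := Φ) hlt)
  refine ⟨g.1, g.2, fun h => hg0 (Subtype.ext h), fun a ha s hs => ?_⟩
  by_contra hlt'
  have hsI : (⟨a, s⟩ : Σ _ : Fin N → K, Fin N →₀ ℕ) ∈ I := by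
    rw [hI, mem_sigma]
    exact ⟨ha, mem_lowExps.2 (not_le.1 hlt')⟩
  have hΦ : Φ g = 0 := LinearMap.mem_ker.1 hgker
  have hc := congr_fun hΦ ⟨⟨a, s⟩, hsI⟩
  simp only [Φ, LinearMap.pi_apply, LinearMap.comp_apply, Submodule.subtype_apply,
    AlgHom.toLinearMap_apply, lcoeff_apply, Pi.zero_apply] at hc
  exact (mem_support_iff.1 hs) hc

/-- In bounded total degree: if `∑_{a ∈ S} C(m(a) + N − 1, N) < C(D + N, N)` then some nonzero
polynomial of total degree `≤ D` vanishes to order `m(a)` at every `a ∈ S`. [folklore] -/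
theorem exists_vanishesToOrder_fun_totalDegree_le (m : (Fin N → K) → ℕ) (S : Finset (Fin N → K))
    (D : ℕ) (hS : ∑ a ∈ S, (m a + N - 1).choose N < (D + N).choose N) :
    ∃ g : MvPolynomial (Fin N) K, g ≠ 0 ∧ g.totalDegree ≤ D ∧
      ∀ a ∈ S, VanishesToOrder g a (m a) := by
  obtain ⟨g, hgV, hg0, hmult⟩ := exists_mem_vanishesToOrder_fun m S
    (restrictTotalDegree (Fin N) K D) (hS.trans_le (choose_le_finrank_restrictTotalDegree N D))
  exact ⟨g, hg0, (mem_restrictTotalDegree _ _ _).1 hgV, hmult⟩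

/-- `C(m + N − 1, N) ≤ mᴺ`: the number of vanishing conditions of order `m` at a point is at most
`mᴺ` ("`O(f(v)ⁿ)` linear conditions", EOT §2). [folklore] -/
theorem choose_add_sub_one_le_pow (m N : ℕ) : (m + N - 1).choose N ≤ m ^ N := by
  rcases Nat.eq_zero_or_pos m with rfl | hm
  · rcases Nat.eq_zero_or_pos N with rfl | hN
    · simp
    · rw [zero_add, Nat.choose_eq_zero_of_lt (Nat.sub_lt hN Nat.one_pos), zero_pow hN.ne']
  induction N with
  | zero => simp
  | succ N ih =>
    have key := Nat.add_one_mul_choose_eq (m + N - 1) N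
    rw [show m + N - 1 + 1 = m + N by omega] at key
    rw [show m + (N + 1) - 1 = m + N by omega]
    refine Nat.le_of_mul_le_mul_right (?_ : (m + N).choose (N + 1) * (N + 1) ≤
      m ^ (N + 1) * (N + 1)) (Nat.succ_pos N)
    rw [← key, pow_succ]
    calc (m + N) * (m + N - 1).choose N ≤ (m * (N + 1)) * m ^ N :=
        Nat.mul_le_mul (by nlinarith) ih
      _ = m ^ N * m * (N + 1) := by ring

end Interpolation

/-! ### The sum of a function along a line; the critical case of the distributional estimate -/

section Critical

variable {n : ℕ}

/-- The sum of `f` along the line through `a` in the (non-horizontal) direction `(1, b')`: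
`∑_{t ∈ 𝔽} f(a + t (1, b'))`. [cite: EllenbergOberlinTao2010KakeyaMaximal, Theorem 1.3,
eq. (1.1) (the inner sum `∑_{x ∈ γ} |f(x)|`)] -/
def lineSum [Fintype K] (f : (Fin (n + 1) → K) → ℕ) (a : Fin (n + 1) → K) (b' : Fin n → K) : ℕ :=
  ∑ t : K, f (a + t • Fin.cons 1 b')

/-- Unfolding lemma for `lineSum`. [folklore] -/
theorem lineSum_eq [Fintype K] (f : (Fin (n + 1) → K) → ℕ) (a : Fin (n + 1) → K)
    (b' : Fin n → K) : lineSum f a b' = ∑ t : K, f (a + t • Fin.cons 1 b') :=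
  rfl

/-- Along a line, `∑_t f(a + tb) ≤ ∑_t mult(P, a + tb)` when `P` vanishes to order `f` everywhere,
and the latter is at most `deg P` unless the restriction `P(a + tb)` vanishes identically
(DKSS Corollary 2.6 + "a nonzero univariate polynomial has at most `deg` roots with
multiplicity"). [cite: EllenbergOberlinTao2010KakeyaMaximal, §2 (proof of Proposition 2.4:
"this set contains `v` with multiplicity at least `f(v)`")] -/
theorem lineRestrict_eq_zero_of_totalDegree_lt_lineSum [Fintype K]
    {f : (Fin (n + 1) → K) → ℕ} {P : MvPolynomial (Fin (n + 1)) K}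
    (hP : ∀ v, VanishesToOrder P v (f v)) {a : Fin (n + 1) → K} {b' : Fin n → K}
    (hsum : P.totalDegree < lineSum f a b') :
    lineRestrict a (Fin.cons 1 b') P = 0 := by
  classical
  by_contra hR
  set R := lineRestrict a (Fin.cons 1 b') P with hRdef
  have hP0 : P ≠ 0 := by
    rintro rfl
    rw [hRdef, map_zero] at hR
    exact hR rfl
  have h1 : lineSum f a b' ≤ ∑ t : K, R.rootMultiplicity t := by
    rw [lineSum_eq]
    refine sum_le_sum fun t _ => ?_
    have hm : f (a + t • Fin.cons 1 b') ≤ mult P (a + t • Fin.cons 1 b') :=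
      (le_mult_iff hP0).2 (hP _)
    refine hm.trans ?_
    rw [hRdef, lineRestrict_apply] at hR ⊢
    exact mult_le_rootMultiplicity a (Fin.cons 1 b') t P hR
  have h2 : ∑ t : K, R.rootMultiplicity t ≤ R.natDegree := sum_rootMultiplicity_le R
  have h3 : R.natDegree ≤ P.totalDegree := by
    rw [hRdef, lineRestrict_apply]
    exact Extremal.natDegree_aeval_line_le a (Fin.cons 1 b') P
  omega

/-- The total degree of the dehomogenization `H(1, x')` is at most that of `H`. [folklore] -/
theorem totalDegree_dehom_le (H : MvPolynomial (Fin (n + 1)) K) :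
    (dehom H).totalDegree ≤ H.totalDegree := by
  classical
  rw [totalDegree, Finset.sup_le_iff]
  intro t ht
  obtain ⟨β, hβ, hβt⟩ := exists_tail_eq_of_mem_support_dehom ht
  have h1 : (Finsupp.tail β).degree ≤ β.degree := by
    rw [degree_eq_zero_add_degree_tail β]
    exact Nat.le_add_left _ _
  have h2 : β.degree ≤ H.totalDegree := by
    rw [Finsupp.degree_apply]
    exact le_totalDegree hβ
  have h3 := h1.trans h2
  rw [Finsupp.degree_apply] at h3
  rw [← hβt]
  exact h3

/-- **The polynomial method with multiplicities (EOT §2, proof of Proposition 2.4 at the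
critical value; here in the chart of directions `(1, b')`).**  Let `f : 𝔽_qⁿ⁺¹ → ℕ` and `D` be such
that `∑_v C(f(v) + n, n + 1) < C(D + n + 1, n + 1)` (more unknowns than vanishing conditions), and
let `B ⊆ 𝔽_qⁿ` be a set of slopes such that for every `b' ∈ B` some line in direction `(1, b')`
has `∑_{v ∈ ℓ} f(v) > D`.  Then `|B| ≤ D q^{n−1}` (stated as `|B| · q ≤ D · qⁿ`).  Proof: a
nonzero `P` of degree `d ≤ D` vanishes to order `f(v)` at each `v`; its restriction to each rich
line vanishes identically, so the top part `P_d` vanishes at `(1, b')`; `P_d(1, x') ≠ 0` has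
degree `≤ d` and at least `|B|` zeros; Schwartz–Zippel. [cite: EllenbergOberlinTao2010KakeyaMaximal,
Proposition 2.4 (proof, §2: "J ≪ |F|^{n−2} D")] -/
theorem card_mul_card_le_of_lineSum_gt [Fintype K] (f : (Fin (n + 1) → K) → ℕ) {D : ℕ}
    (hD : ∑ v : Fin (n + 1) → K, (f v + n).choose (n + 1) < (D + (n + 1)).choose (n + 1))
    (B : Finset (Fin n → K)) (hB : ∀ b' ∈ B, ∃ a : Fin (n + 1) → K, D < lineSum f a b') :
    B.card * Fintype.card K ≤ D * Fintype.card K ^ n := by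
  classical
  -- Step 0: interpolation
  have hD' : ∑ v ∈ (univ : Finset (Fin (n + 1) → K)), (f v + (n + 1) - 1).choose (n + 1) <
      (D + (n + 1)).choose (n + 1) := by
    simpa [show ∀ v, f v + (n + 1) - 1 = f v + n from fun v => by omega] using hD
  obtain ⟨P, hP0, hPdeg, hPmult⟩ := exists_vanishesToOrder_fun_totalDegree_le f univ D hD'
  set d := P.totalDegree with hd
  set H := homogeneousComponent d P with hH
  have hH0 : H ≠ 0 := homogeneousComponent_totalDegree_ne_zero hP0
  have hHhom : H.IsHomogeneous d := homogeneousComponent_isHomogeneous d P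
  -- Step 1: `P_d(1, b') = 0` for `b' ∈ B`
  have hvan : ∀ b' ∈ B, eval (Fin.cons 1 b') H = 0 := by
    intro b' hb'
    obtain ⟨a, ha⟩ := hB b' hb'
    have hR0 : lineRestrict a (Fin.cons 1 b') P = 0 :=
      lineRestrict_eq_zero_of_totalDegree_lt_lineSum (fun v => hPmult v (mem_univ v))
        (lt_of_le_of_lt hPdeg ha)
    have hc := coeff_aeval_line a (Fin.cons 1 b') P le_rfl
    rw [← lineRestrict_apply, hR0, Polynomial.coeff_zero] at hc
    exact hc.symm
  -- Step 2: the dehomogenization `Q = P_d(1, x')` is nonzero of degree `≤ d` and vanishes on `B`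
  set Q := dehom H with hQ
  have hQ0 : Q ≠ 0 := dehom_ne_zero_of_isHomogeneous hHhom hH0
  have hQdeg : Q.totalDegree ≤ D := by
    refine (totalDegree_dehom_le H).trans ?_
    rw [hH]
    exact (hHhom.totalDegree_le).trans hPdeg
  have hQvan : ∀ b' ∈ B, eval b' Q = 0 := fun b' hb' => by
    rw [hQ, eval_dehom]
    exact hvan b' hb'
  -- Step 3: Schwartz–Zippel
  have hSZ := card_zeros_mul_card_le (n := n) hQ0
  have hsub : B ⊆ univ.filter fun x : Fin n → K => eval x Q = 0 := fun b' hb' =>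
    mem_filter.2 ⟨mem_univ _, hQvan b' hb'⟩
  calc B.card * Fintype.card K
      ≤ (univ.filter fun x : Fin n → K => eval x Q = 0).card * Fintype.card K :=
        Nat.mul_le_mul_right _ (card_le_card hsub)
    _ ≤ Q.totalDegree * Fintype.card K ^ n := hSZ
    _ ≤ D * Fintype.card K ^ n := Nat.mul_le_mul_right _ hQdeg

/-- **Proposition 2.4 at the critical value `λⁿ⁺¹ > (n+1)! ‖f‖ⁿ⁺¹_{n+1}`** (the case to which
Proposition 2.5 reduces): if `(n + 1)! · ∑_v f(v)ⁿ⁺¹ < μⁿ⁺¹` and for every slope `b' ∈ B` some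
line in direction `(1, b')` carries `∑_{v ∈ ℓ} f(v) ≥ μ`, then `|B| · q ≤ (μ − 1) · qⁿ`.
[cite: EllenbergOberlinTao2010KakeyaMaximal, Proposition 2.4 at λ = K₀‖f‖ / eq. (2.8) (§2)] -/
theorem card_mul_card_le_of_le_lineSum [Fintype K] (f : (Fin (n + 1) → K) → ℕ) {μ : ℕ}
    (hμ : (n + 1).factorial * ∑ v : Fin (n + 1) → K, f v ^ (n + 1) < μ ^ (n + 1))
    (B : Finset (Fin n → K)) (hB : ∀ b' ∈ B, ∃ a : Fin (n + 1) → K, μ ≤ lineSum f a b') :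
    B.card * Fintype.card K ≤ (μ - 1) * Fintype.card K ^ n := by
  have hμ1 : 1 ≤ μ := by
    rcases Nat.eq_zero_or_pos μ with rfl | h
    · rw [zero_pow (Nat.succ_ne_zero n)] at hμ
      exact absurd hμ (Nat.not_lt_zero _)
    · exact h
  refine card_mul_card_le_of_lineSum_gt f ?_ B fun b' hb' => (hB b' hb').imp fun a ha => by omega
  -- `∑ C(f(v)+n, n+1) ≤ ∑ f(v)^{n+1}`, `(n+1)! ∑ f^{n+1} < μ^{n+1} ≤ (n+1)! C(μ-1+n+1, n+1)`
  have h1 : ∑ v : Fin (n + 1) → K, (f v + n).choose (n + 1) ≤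
      ∑ v : Fin (n + 1) → K, f v ^ (n + 1) :=
    sum_le_sum fun v _ => by
      have := choose_add_sub_one_le_pow (f v) (n + 1)
      rwa [show f v + (n + 1) - 1 = f v + n by omega] at this
  -- `(D + 1)ᴺ ≤ N! C(D + N, N) = (D + 1)(D + 2)⋯(D + N)` with `D = μ − 1`
  have h2 : μ ^ (n + 1) ≤ (n + 1).factorial * (μ - 1 + (n + 1)).choose (n + 1) := by
    rw [← Nat.descFactorial_eq_factorial_mul_choose]
    have h := Nat.pow_sub_le_descFactorial (μ - 1 + (n + 1)) (n + 1)
    rwa [show μ - 1 + (n + 1) + 1 - (n + 1) = μ by omega] at h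
  have h3 : (n + 1).factorial * ∑ v : Fin (n + 1) → K, (f v + n).choose (n + 1) <
      (n + 1).factorial * (μ - 1 + (n + 1)).choose (n + 1) :=
    lt_of_le_of_lt (Nat.mul_le_mul_left _ h1) (lt_of_lt_of_le hμ h2)
  exact Nat.lt_of_mul_lt_mul_left h3

end Critical

/-! ### Shears, and the Nikishin–Maurey–Pisier–Stein reduction (EOT Proposition 2.5) -/

section Shear

variable {n : ℕ}

/-- The **shear** `S_u : (x₀, x') ↦ (x₀, x' + x₀ u)` of `𝔽ⁿ⁺¹` (`u ∈ 𝔽ⁿ`): a linear bijection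
fixing the horizontal hyperplane `{x₀ = 0}` pointwise and moving the direction `(1, b')` to
`(1, b' + u)`.  In the chart `(x₀, x') ↦ (x'/x₀, 1/x₀)` of EOT Remark 2.2 these are the translations
`w ↦ w + u` of `F^{n−1}` used in the proof of Proposition 2.5. [folklore] -/
def shear (u : Fin n → K) (x : Fin (n + 1) → K) : Fin (n + 1) → K :=
  x + x 0 • Fin.cons 0 u

/-- Unfolding lemma for `shear`. [folklore] -/
theorem shear_eq (u : Fin n → K) (x : Fin (n + 1) → K) : shear u x = x + x 0 • Fin.cons 0 u :=
  rfl

/-- A shear does not change the `x₀`-coordinate. [folklore] -/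
@[simp] theorem shear_apply_zero (u : Fin n → K) (x : Fin (n + 1) → K) : shear u x 0 = x 0 := by
  simp [shear_eq]

/-- The other coordinates: `(S_u x)_{k+1} = x_{k+1} + x₀ u_k`. [folklore] -/
@[simp] theorem shear_apply_succ (u : Fin n → K) (x : Fin (n + 1) → K) (k : Fin n) :
    shear u x k.succ = x k.succ + x 0 * u k := by
  simp [shear_eq]

/-- `S_{−u} ∘ S_u = id`. [folklore] -/
@[simp] theorem shear_neg_shear (u : Fin n → K) (x : Fin (n + 1) → K) :
    shear (-u) (shear u x) = x := by
  ext k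
  refine Fin.cases ?_ (fun l => ?_) k
  · simp
  · simp only [shear_apply_succ, shear_apply_zero, Pi.neg_apply]
    ring

/-- `S_u ∘ S_{−u} = id`. [folklore] -/
@[simp] theorem shear_shear_neg (u : Fin n → K) (x : Fin (n + 1) → K) :
    shear u (shear (-u) x) = x := by
  simpa using shear_neg_shear (-u) x

/-- The shear as a permutation of `𝔽ⁿ⁺¹`. [folklore] -/
def shearEquiv (u : Fin n → K) : (Fin (n + 1) → K) ≃ (Fin (n + 1) → K) where
  toFun := shear u
  invFun := shear (-u)
  left_inv := shear_neg_shear u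
  right_inv := shear_shear_neg u

/-- `shearEquiv u x = shear u x`. [folklore] -/
@[simp] theorem shearEquiv_apply (u : Fin n → K) (x : Fin (n + 1) → K) :
    shearEquiv u x = shear u x :=
  rfl

/-- **A shear maps the line `a + t(1, b')` onto the line `S_u a + t(1, b' + u)`.** [folklore] -/
theorem shear_add_smul (u : Fin n → K) (a : Fin (n + 1) → K) (b' : Fin n → K) (t : K) :
    shear u (a + t • Fin.cons 1 b') = shear u a + t • Fin.cons 1 (b' + u) := by
  ext k
  refine Fin.cases ?_ (fun l => ?_) k
  · simp
  · simp only [shear_apply_succ, Pi.add_apply, Pi.smul_apply, Fin.cons_succ, Fin.cons_zero,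
      smul_eq_mul]
    ring

/-- The **superposition** of `M` sheared copies of `f`: `f_u(v) = max_m f(S_{u_m}⁻¹ v)` (EOT use the
`ℓⁿ`-sum `(∑_m f(v − u_m)ⁿ)^{1/n}`; the maximum has the two properties used — it dominates each
copy and its `n`-th power is dominated by the sum of the `n`-th powers — and stays integer-valued).
[cite: EllenbergOberlinTao2010KakeyaMaximal, Proposition 2.5 (proof: the function f_M)] -/
def shearSup {M : ℕ} (u : Fin M → Fin n → K) (f : (Fin (n + 1) → K) → ℕ)
    (v : Fin (n + 1) → K) : ℕ :=
  (univ : Finset (Fin M)).sup fun m => f (shear (-(u m)) v)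

/-- `f_u` dominates each sheared copy: `f(w) ≤ f_u(S_{u_m} w)`. [cite:
EllenbergOberlinTao2010KakeyaMaximal, Proposition 2.5 (proof: "f_M(v) ≥ f(v − u_m)")] -/
theorem le_shearSup {M : ℕ} (u : Fin M → Fin n → K) (f : (Fin (n + 1) → K) → ℕ) (m : Fin M)
    (w : Fin (n + 1) → K) : f w ≤ shearSup u f (shear (u m) w) := by
  have h := Finset.le_sup (f := fun m' => f (shear (-(u m')) (shear (u m) w))) (mem_univ m)
  simpa [shearSup] using h

/-- `max_m a_m ^ N ≤ ∑_m a_m ^ N`. [folklore] -/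
theorem sup_pow_le_sum_pow {M : ℕ} (a : Fin M → ℕ) (N : ℕ) (hN : N ≠ 0) :
    ((univ : Finset (Fin M)).sup a) ^ N ≤ ∑ m, a m ^ N := by
  rcases (univ : Finset (Fin M)).eq_empty_or_nonempty with h | h
  · rw [h, Finset.sup_empty, bot_eq_zero, zero_pow hN]
    exact Nat.zero_le _
  · obtain ⟨m, -, hm⟩ := Finset.exists_mem_eq_sup _ h a
    rw [hm]
    exact Finset.single_le_sum (f := fun m => a m ^ N) (fun _ _ => Nat.zero_le _) (mem_univ m)

variable [Fintype K]

/-- Line sums only grow: the line `S_{u_m} a + t(1, b' + u_m)` carries at least the `f`-mass of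
the line `a + t(1, b')`. [cite: EllenbergOberlinTao2010KakeyaMaximal, Proposition 2.5 (proof:
"∑_{v ∈ γ_j + u_m} f_M(v) ≥ λ")] -/
theorem lineSum_le_lineSum_shearSup {M : ℕ} (u : Fin M → Fin n → K)
    (f : (Fin (n + 1) → K) → ℕ) (m : Fin M) (a : Fin (n + 1) → K) (b' : Fin n → K) :
    lineSum f a b' ≤ lineSum (shearSup u f) (shear (u m) a) (b' + u m) := by
  rw [lineSum_eq, lineSum_eq]
  refine sum_le_sum fun t _ => ?_
  rw [← shear_add_smul]
  exact le_shearSup u f m _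

/-- The `ℓᴺ` mass of the superposition: `∑_v f_u(v)ᴺ ≤ M ∑_v f(v)ᴺ`. [cite:
EllenbergOberlinTao2010KakeyaMaximal, Proposition 2.5 (proof, eq. (2.7))] -/
theorem sum_shearSup_pow_le {M : ℕ} (u : Fin M → Fin n → K) (f : (Fin (n + 1) → K) → ℕ)
    {N : ℕ} (hN : N ≠ 0) :
    ∑ v : Fin (n + 1) → K, shearSup u f v ^ N ≤ M * ∑ v : Fin (n + 1) → K, f v ^ N := by
  calc ∑ v : Fin (n + 1) → K, shearSup u f v ^ N
      ≤ ∑ v : Fin (n + 1) → K, ∑ m : Fin M, f (shear (-(u m)) v) ^ N :=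
        sum_le_sum fun v _ => sup_pow_le_sum_pow _ N hN
    _ = ∑ m : Fin M, ∑ v : Fin (n + 1) → K, f (shear (-(u m)) v) ^ N := Finset.sum_comm
    _ = ∑ m : Fin M, ∑ v : Fin (n + 1) → K, f v ^ N := by
        refine sum_congr rfl fun m _ => ?_
        exact Fintype.sum_equiv (shearEquiv (-(u m))) _ _ fun v => rfl
    _ = M * ∑ v : Fin (n + 1) → K, f v ^ N := by
        rw [sum_const, card_univ, Fintype.card_fin, smul_eq_mul]

variable [DecidableEq K]

/-- The set of slopes `Ω_u = {b' + u_m : b' ∈ B, m ≤ M}` reached from `B` by the `M` shears.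
[cite: EllenbergOberlinTao2010KakeyaMaximal, Proposition 2.5 (proof: the random set Ω)] -/
def shearSlopes {M : ℕ} (u : Fin M → Fin n → K) (B : Finset (Fin n → K)) : Finset (Fin n → K) :=
  (B ×ˢ (univ : Finset (Fin M))).image fun p => p.1 + u p.2

omit [Fintype K] in
/-- Membership in `Ω_u`. [folklore] -/
theorem mem_shearSlopes {M : ℕ} {u : Fin M → Fin n → K} {B : Finset (Fin n → K)}
    {c : Fin n → K} : c ∈ shearSlopes u B ↔ ∃ b' ∈ B, ∃ m : Fin M, b' + u m = c := by
  rw [shearSlopes, mem_image]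
  constructor
  · rintro ⟨⟨b', m⟩, hp, h⟩
    exact ⟨b', (mem_product.1 hp).1, m, h⟩
  · rintro ⟨b', hb', m, h⟩
    exact ⟨⟨b', m⟩, mem_product.2 ⟨hb', mem_univ _⟩, h⟩

/-- **Bernoulli-type inequality** `(P − J)^M (P + MJ) ≤ P^{M+1}` (i.e. `(1 − x)^M ≤ 1/(1 + Mx)`),
the estimate behind "`1 − (1 − J/|F|^{n−1})^M ≍ min(MJ/|F|^{n−1}, 1)`". [folklore] -/
theorem sub_pow_mul_add_mul_le (P J : ℕ) : ∀ M : ℕ, (P - J) ^ M * (P + M * J) ≤ P ^ (M + 1)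
  | 0 => by simp
  | M + 1 => by
    have ih := sub_pow_mul_add_mul_le P J M
    rcases le_or_gt J P with hJP | hJP
    · have h1 : (P - J) ^ (M + 1) ≤ P ^ (M + 1) := Nat.pow_le_pow_left (Nat.sub_le P J) _
      calc (P - J) ^ (M + 1) * (P + (M + 1) * J)
          = (P - J) * ((P - J) ^ M * (P + M * J)) + (P - J) ^ (M + 1) * J := by ring
        _ ≤ (P - J) * P ^ (M + 1) + P ^ (M + 1) * J :=
            Nat.add_le_add (Nat.mul_le_mul_left _ ih) (Nat.mul_le_mul_right _ h1)
        _ = P ^ (M + 1) * (P - J + J) := by ring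
        _ = P ^ (M + 1 + 1) := by rw [Nat.sub_add_cancel hJP]; ring
    · rw [Nat.sub_eq_zero_of_le hJP.le, zero_pow (Nat.succ_ne_zero M), zero_mul]
      exact Nat.zero_le _

/-- The averaged form: `P^M · min(MJ, P) ≤ 2P (P^M − (P − J)^M)` ("`E|Ω| ≍ min(MJ, |F|^{n−1})`").
[cite: EllenbergOberlinTao2010KakeyaMaximal, Proposition 2.5 (proof, eq. (2.6))] -/
theorem pow_mul_min_le (P J M : ℕ) :
    P ^ M * min (M * J) P ≤ 2 * P * (P ^ M - (P - J) ^ M) := by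
  set y := (P - J) ^ M with hy
  have hyP : y ≤ P ^ M := Nat.pow_le_pow_left (Nat.sub_le P J) _
  have hb := sub_pow_mul_add_mul_le P J M
  rw [← hy, pow_succ] at hb
  -- `(P^M − y)(P + MJ) ≥ P^M · MJ`
  have key : P ^ M * (M * J) ≤ (P ^ M - y) * (P + M * J) := by
    have h1 : (P ^ M - y) * (P + M * J) + y * (P + M * J) = P ^ M * (P + M * J) := by
      rw [← Nat.add_mul, Nat.sub_add_cancel hyP]
    have h2 : P ^ M * (P + M * J) = P ^ M * P + P ^ M * (M * J) := by ring
    omega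
  rcases le_or_gt (M * J) P with h | h
  · rw [min_eq_left h]
    calc P ^ M * (M * J) ≤ (P ^ M - y) * (P + M * J) := key
      _ ≤ (P ^ M - y) * (2 * P) := Nat.mul_le_mul_left _ (by omega)
      _ = 2 * P * (P ^ M - y) := by ring
  · rw [min_eq_right h.le]
    have hMJ : 0 < M * J := lt_of_le_of_lt (Nat.zero_le P) h
    have h3 : P ^ M * (M * J) ≤ (P ^ M - y) * (2 * (M * J)) :=
      key.trans (Nat.mul_le_mul_left _ (by omega))
    have h4 : P ^ M ≤ (P ^ M - y) * 2 := by
      have h3' : P ^ M * (M * J) ≤ (P ^ M - y) * 2 * (M * J) := by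
        calc P ^ M * (M * J) ≤ (P ^ M - y) * (2 * (M * J)) := h3
          _ = (P ^ M - y) * 2 * (M * J) := by ring
      exact Nat.le_of_mul_le_mul_right h3' hMJ
    calc P ^ M * P ≤ (P ^ M - y) * 2 * P := Nat.mul_le_mul_right _ h4
      _ = 2 * P * (P ^ M - y) := by ring

/-- **The averaging step of Proposition 2.5** ("we may select `u_1, …, u_M` such that
`|Ω| ≫ min(MJ, |F|^{n−1})`"): for some `M`-tuple of shears, `2 |Ω_u| ≥ min(M |B|, qⁿ)`.  Proof:
`∑_u |Ω_u| = ∑_c #{u : c ∈ Ω_u} ≥ qⁿ (q^{nM} − (qⁿ − |B|)^M) ≥ ½ q^{nM} min(M|B|, qⁿ)`.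
[cite: EllenbergOberlinTao2010KakeyaMaximal, Proposition 2.5 (proof, eq. (2.6))] -/
theorem exists_shearSlopes_card_ge (B : Finset (Fin n → K)) (M : ℕ) :
    ∃ u : Fin M → Fin n → K,
      min (M * B.card) (Fintype.card K ^ n) ≤ 2 * (shearSlopes u B).card := by
  classical
  set P := Fintype.card K ^ n with hP
  have hT : Fintype.card (Fin n → K) = P := by rw [Fintype.card_fun, Fintype.card_fin]
  have hU : Fintype.card (Fin M → Fin n → K) = P ^ M := by
    rw [Fintype.card_fun, Fintype.card_fin, hT]
  -- for each slope `c`, at most `(P − |B|)^M` tuples `u` miss it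
  have hmiss : ∀ c : Fin n → K,
      (univ.filter fun u : Fin M → Fin n → K => c ∉ shearSlopes u B).card ≤ (P - B.card) ^ M := by
    intro c
    set T : Finset (Fin n → K) := univ \ B.image fun b' => c - b' with hTdef
    have hTcard : T.card = P - B.card := by
      rw [hTdef, card_univ_sdiff, hT, card_image_of_injective _ (sub_right_injective (b := c))]
    have hsub : (univ.filter fun u : Fin M → Fin n → K => c ∉ shearSlopes u B) ⊆
        Fintype.piFinset fun _ : Fin M => T := by
      intro u hu
      rw [mem_filter] at hu
      rw [Fintype.mem_piFinset]
      intro m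
      rw [hTdef, mem_sdiff, mem_image]
      refine ⟨mem_univ _, ?_⟩
      rintro ⟨b', hb', hbc⟩
      exact hu.2 (mem_shearSlopes.2 ⟨b', hb', m, by rw [← hbc]; abel⟩)
    refine (card_le_card hsub).trans ?_
    rw [Fintype.card_piFinset_const, hTcard]
  -- double counting
  have hsum : P * (P ^ M - (P - B.card) ^ M) ≤
      ∑ u : Fin M → Fin n → K, (shearSlopes u B).card := by
    have h1 : ∑ u : Fin M → Fin n → K, (shearSlopes u B).card =
        ∑ c : Fin n → K, (univ.filter fun u : Fin M → Fin n → K => c ∈ shearSlopes u B).card := by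
      simp_rw [card_eq_sum_ones, sum_filter]
      rw [Finset.sum_comm]
      refine sum_congr rfl fun u _ => ?_
      rw [← sum_filter, filter_mem_eq_inter, univ_inter]
    have h2 : ∀ c : Fin n → K, P ^ M - (P - B.card) ^ M ≤
        (univ.filter fun u : Fin M → Fin n → K => c ∈ shearSlopes u B).card := by
      intro c
      have h3 := Finset.card_filter_add_card_filter_not
        (s := (univ : Finset (Fin M → Fin n → K))) (fun u => c ∈ shearSlopes u B)
      rw [card_univ, hU] at h3
      have h4 := hmiss c
      omega
    rw [h1]
    have := sum_le_sum fun c (_ : c ∈ (univ : Finset (Fin n → K))) => h2 c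
    rw [sum_const, card_univ, hT, smul_eq_mul] at this
    exact this
  -- pigeonhole
  by_contra hcon
  push Not at hcon
  have hlt : ∑ u : Fin M → Fin n → K, 2 * (shearSlopes u B).card <
      ∑ _u : Fin M → Fin n → K, min (M * B.card) P :=
    sum_lt_sum_of_nonempty univ_nonempty fun u _ => hcon u
  rw [sum_const, card_univ, hU, smul_eq_mul, ← mul_sum] at hlt
  have h5 := pow_mul_min_le P B.card M
  have h6 : 2 * (P * (P ^ M - (P - B.card) ^ M)) ≤
      2 * ∑ u : Fin M → Fin n → K, (shearSlopes u B).card := Nat.mul_le_mul_left _ hsum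
  have h7 : 2 * P * (P ^ M - (P - B.card) ^ M) = 2 * (P * (P ^ M - (P - B.card) ^ M)) := by ring
  omega

end Shear

/-! ### Proposition 2.4: the distributional estimate, with explicit constants -/

section Distributional

variable {n : ℕ}

/-- `2ᴺ N! < (4N)ᴺ` (`N ≥ 1`): the numerology making `K = 4N` an admissible constant. [folklore] -/
theorem two_pow_mul_factorial_lt {N : ℕ} (hN : 1 ≤ N) : 2 ^ N * N.factorial < (4 * N) ^ N := by
  calc 2 ^ N * N.factorial ≤ 2 ^ N * N ^ N := Nat.mul_le_mul_left _ (Nat.factorial_le_pow N)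
    _ = (2 * N) ^ N := by rw [mul_pow]
    _ < (4 * N) ^ N := Nat.pow_lt_pow_left (by omega) (by omega)

/-- The explicit constant `C_n = 2^{2n+1} · (n+1)! · (4(n+1))^{(n+1)n}` in Proposition 2.4 (ambient
dimension `n + 1`). [folklore] -/
def eotConst (n : ℕ) : ℕ :=
  2 ^ (2 * n + 1) * (n + 1).factorial * (4 * (n + 1)) ^ ((n + 1) * n)

/-- Unfolding lemma for `eotConst`. [folklore] -/
theorem eotConst_eq (n : ℕ) :
    eotConst n = 2 ^ (2 * n + 1) * (n + 1).factorial * (4 * (n + 1)) ^ ((n + 1) * n) :=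
  rfl

/-- `C_n ≤ ((4(n+1))^{n+1})^{n+1}`. [folklore] -/
theorem eotConst_le_pow (n : ℕ) : eotConst n ≤ ((4 * (n + 1)) ^ (n + 1)) ^ (n + 1) := by
  rw [eotConst_eq, ← pow_mul]
  have h1 : 2 ^ (2 * n + 1) * (n + 1).factorial ≤ (4 * (n + 1)) ^ (n + 1) := by
    rw [mul_pow]
    refine Nat.mul_le_mul ?_ (Nat.factorial_le_pow (n + 1))
    calc 2 ^ (2 * n + 1) ≤ 2 ^ (2 * n + 2) := Nat.pow_le_pow_right (by norm_num) (by omega)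
      _ = 4 ^ (n + 1) := by rw [show 2 * n + 2 = 2 * (n + 1) by ring, pow_mul]; norm_num
  calc 2 ^ (2 * n + 1) * (n + 1).factorial * (4 * (n + 1)) ^ ((n + 1) * n)
      ≤ (4 * (n + 1)) ^ (n + 1) * (4 * (n + 1)) ^ ((n + 1) * n) := Nat.mul_le_mul_right _ h1
    _ = (4 * (n + 1)) ^ ((n + 1) * (n + 1)) := by
        rw [← pow_add]
        congr 1
        ring

variable [Fintype K] [DecidableEq K]

/-- **EOT Proposition 2.4 (the Kakeya distributional estimate), for lines, in the chart of
directions `(1, b')`, with explicit constants.**  Let `n ≥ 1`, `f : 𝔽_qⁿ⁺¹ → ℕ`, and let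
`B ⊆ 𝔽_qⁿ` be a set of slopes such that for every `b' ∈ B` some line in direction `(1, b')` has
`∑_{v ∈ ℓ} f(v) ≥ λ`, where `(4(n+1))ⁿ⁺¹ ‖f‖ⁿ⁺¹_{n+1} ≤ λⁿ⁺¹` and `λ ≤ q` (the printed hypotheses
`K ‖f‖_{ℓⁿ} ≤ λ ≤ |F|`, `f` with values in `{0} ∪ [1, ∞)`).  Then
`|B|ⁿ⁺¹ λ^{(n+1)n} ≤ C_n q^{(n−1)(n+1)} ‖f‖_{n+1}^{(n+1)²}`, i.e. the printed conclusion
`J ≪ |F|^{N−2} λ^{−(N−1)} ∑ f(v)ᴺ` (`N = n + 1`) raised to the power `N`.  Proof as printed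
(Proposition 2.5 + the polynomial method): superimpose `M = ⌊λᴺ/((4N)ᴺ ‖f‖ᴺ)⌋` sheared copies of
`f`, apply the critical estimate `card_mul_card_le_of_le_lineSum` to the superposition and the
`≥ ½ min(M|B|, qⁿ)` slopes it makes rich, and unwind. [cite: EllenbergOberlinTao2010KakeyaMaximal,
Proposition 2.4 (§2; with Proposition 2.5)] -/
theorem card_pow_mul_pow_le (hn : 1 ≤ n) (f : (Fin (n + 1) → K) → ℕ) (B : Finset (Fin n → K))
    {lam : ℕ} (hB : ∀ b' ∈ B, ∃ a : Fin (n + 1) → K, lam ≤ lineSum f a b')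
    (hlam : (4 * (n + 1)) ^ (n + 1) * ∑ v : Fin (n + 1) → K, f v ^ (n + 1) ≤ lam ^ (n + 1))
    (hlamq : lam ≤ Fintype.card K) :
    B.card ^ (n + 1) * lam ^ ((n + 1) * n) ≤
      eotConst n * Fintype.card K ^ ((n - 1) * (n + 1)) *
        (∑ v : Fin (n + 1) → K, f v ^ (n + 1)) ^ (n + 1) := by
  classical
  set q := Fintype.card K with hq
  set F := ∑ v : Fin (n + 1) → K, f v ^ (n + 1) with hF
  set J := B.card with hJ
  set A := (4 * (n + 1)) ^ (n + 1) with hA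
  have hq1 : 1 < q := Fintype.one_lt_card
  have hApos : 0 < A := by positivity
  -- the degenerate case `f ≡ 0`
  rcases Nat.eq_zero_or_pos F with hF0 | hFpos
  · have hf0 : ∀ v, f v = 0 := fun v => by
      have h := (Finset.sum_eq_zero_iff.1 hF0) v (mem_univ v)
      exact (pow_eq_zero_iff (Nat.succ_ne_zero n)).1 h
    rcases B.eq_empty_or_nonempty with hB0 | ⟨b', hb'⟩
    · rw [hJ, hB0, card_empty, zero_pow (Nat.succ_ne_zero n), zero_mul]
      exact Nat.zero_le _
    · obtain ⟨a, ha⟩ := hB b' hb'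
      have hls : lineSum f a b' = 0 := by
        rw [lineSum_eq]
        exact sum_eq_zero fun t _ => hf0 _
      have hlam0 : lam = 0 := by omega
      rw [hlam0, zero_pow (by positivity), mul_zero]
      exact Nat.zero_le _
  -- from now on `F ≥ 1`, hence `λ ≥ 1` and `M ≥ 1`
  have hlam1 : 1 ≤ lam := by
    by_contra h
    have h0 : lam = 0 := by omega
    rw [h0, zero_pow (Nat.succ_ne_zero n)] at hlam
    have : 0 < A * F := Nat.mul_pos hApos hFpos
    omega
  set M := lam ^ (n + 1) / (A * F) with hM
  have hAF : 0 < A * F := Nat.mul_pos hApos hFpos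
  have hM1 : 1 ≤ M := (Nat.le_div_iff_mul_le hAF).2 (by rw [one_mul]; exact hlam)
  have hMAF : M * (A * F) ≤ lam ^ (n + 1) := Nat.div_mul_le_self _ _
  have hM2 : lam ^ (n + 1) ≤ 2 * M * (A * F) := by
    have h1 : lam ^ (n + 1) < lam ^ (n + 1) / (A * F) * (A * F) + A * F := Nat.lt_div_mul_add hAF
    rw [← hM] at h1
    nlinarith
  -- Proposition 2.5: superimpose `M` sheared copies
  obtain ⟨u, hu⟩ := exists_shearSlopes_card_ge B M
  set g := shearSup u f with hg
  set Ω := shearSlopes u B with hΩ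
  have hgF : ∑ v : Fin (n + 1) → K, g v ^ (n + 1) ≤ M * F :=
    sum_shearSup_pow_le u f (Nat.succ_ne_zero n)
  have hΩrich : ∀ c ∈ Ω, ∃ a : Fin (n + 1) → K, lam ≤ lineSum g a c := by
    intro c hc
    obtain ⟨b', hb', m, rfl⟩ := mem_shearSlopes.1 hc
    obtain ⟨a, ha⟩ := hB b' hb'
    exact ⟨shear (u m) a, ha.trans (lineSum_le_lineSum_shearSup u f m a b')⟩
  -- the critical threshold `μ`: least with `(n+1)! M F < μ^{n+1}`
  have hex : ∃ μ : ℕ, (n + 1).factorial * (M * F) < μ ^ (n + 1) :=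
    ⟨(n + 1).factorial * (M * F) + 1,
      lt_of_lt_of_le (Nat.lt_succ_self _) (Nat.le_self_pow (Nat.succ_ne_zero n) _)⟩
  set μ := Nat.find hex with hμdef
  have hμ : (n + 1).factorial * (M * F) < μ ^ (n + 1) := Nat.find_spec hex
  have hμ1 : 1 ≤ μ := by
    by_contra h
    have h0 : μ = 0 := by omega
    rw [h0, zero_pow (Nat.succ_ne_zero n)] at hμ
    exact Nat.not_lt_zero _ hμ
  have hμmin : (μ - 1) ^ (n + 1) ≤ (n + 1).factorial * (M * F) :=
    not_lt.1 (Nat.find_min hex (show μ - 1 < Nat.find hex by omega))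
  have hfact : (n + 1).factorial < A :=
    lt_of_le_of_lt (Nat.le_mul_of_pos_left _ (by positivity)) (two_pow_mul_factorial_lt le_add_self)
  have hμlam : μ ≤ lam := by
    have h2 : (n + 1).factorial * (M * F) < A * (M * F) :=
      Nat.mul_lt_mul_of_pos_right hfact (Nat.mul_pos hM1 hFpos)
    have h3 : (μ - 1) ^ (n + 1) < lam ^ (n + 1) :=
      calc (μ - 1) ^ (n + 1) ≤ (n + 1).factorial * (M * F) := hμmin
        _ < A * (M * F) := h2
        _ = M * (A * F) := by ring
        _ ≤ lam ^ (n + 1) := hMAF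
    have h4 : μ - 1 < lam := lt_of_pow_lt_pow_left₀ _ (Nat.zero_le _) h3
    omega
  -- the polynomial method, applied to `g`
  have hcrit : Ω.card * q ≤ (μ - 1) * q ^ n :=
    card_mul_card_le_of_le_lineSum g (lt_of_le_of_lt (Nat.mul_le_mul_left _ hgF) hμ) Ω
      fun c hc => (hΩrich c hc).imp fun a ha => hμlam.trans ha
  have hΩN : (Ω.card * q) ^ (n + 1) ≤ (n + 1).factorial * (M * F) * (q ^ n) ^ (n + 1) :=
    calc (Ω.card * q) ^ (n + 1) ≤ ((μ - 1) * q ^ n) ^ (n + 1) := Nat.pow_le_pow_left hcrit _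
      _ = (μ - 1) ^ (n + 1) * (q ^ n) ^ (n + 1) := mul_pow _ _ _
      _ ≤ (n + 1).factorial * (M * F) * (q ^ n) ^ (n + 1) := Nat.mul_le_mul_right _ hμmin
  rcases le_or_gt (q ^ n) (M * J) with hcase | hcase
  · -- `MJ ≥ qⁿ`: impossible ("this contradicts the hypothesis λ ≤ |F|")
    exfalso
    rw [min_eq_right hcase] at hu
    have h1 : (q ^ n) ^ (n + 1) * q ^ (n + 1) ≤
        2 ^ (n + 1) * ((n + 1).factorial * (M * F) * (q ^ n) ^ (n + 1)) :=
      calc (q ^ n) ^ (n + 1) * q ^ (n + 1) = (q ^ n * q) ^ (n + 1) := by rw [mul_pow]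
        _ ≤ (2 * (Ω.card * q)) ^ (n + 1) :=
            Nat.pow_le_pow_left (by nlinarith [hu, hq1]) _
        _ = 2 ^ (n + 1) * (Ω.card * q) ^ (n + 1) := mul_pow _ _ _
        _ ≤ 2 ^ (n + 1) * ((n + 1).factorial * (M * F) * (q ^ n) ^ (n + 1)) :=
            Nat.mul_le_mul_left _ hΩN
    have hpos : 0 < (q ^ n) ^ (n + 1) := by positivity
    have h2 : q ^ (n + 1) ≤ 2 ^ (n + 1) * (n + 1).factorial * (M * F) := by
      refine Nat.le_of_mul_le_mul_right ?_ hpos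
      calc q ^ (n + 1) * (q ^ n) ^ (n + 1) = (q ^ n) ^ (n + 1) * q ^ (n + 1) := mul_comm _ _
        _ ≤ 2 ^ (n + 1) * ((n + 1).factorial * (M * F) * (q ^ n) ^ (n + 1)) := h1
        _ = 2 ^ (n + 1) * (n + 1).factorial * (M * F) * (q ^ n) ^ (n + 1) := by ring
    have h3 : q ^ (n + 1) * A ≤ 2 ^ (n + 1) * (n + 1).factorial * q ^ (n + 1) :=
      calc q ^ (n + 1) * A ≤ 2 ^ (n + 1) * (n + 1).factorial * (M * F) * A :=
            Nat.mul_le_mul_right _ h2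
        _ = 2 ^ (n + 1) * (n + 1).factorial * (M * (A * F)) := by ring
        _ ≤ 2 ^ (n + 1) * (n + 1).factorial * lam ^ (n + 1) := Nat.mul_le_mul_left _ hMAF
        _ ≤ 2 ^ (n + 1) * (n + 1).factorial * q ^ (n + 1) :=
            Nat.mul_le_mul_left _ (Nat.pow_le_pow_left hlamq _)
    have h4 : 2 ^ (n + 1) * (n + 1).factorial < A := two_pow_mul_factorial_lt le_add_self
    have hqpos : 0 < q ^ (n + 1) := by positivity
    have h5 : 2 ^ (n + 1) * (n + 1).factorial * q ^ (n + 1) < A * q ^ (n + 1) :=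
      Nat.mul_lt_mul_of_pos_right h4 hqpos
    rw [mul_comm (q ^ (n + 1)) A] at h3
    exact absurd (lt_of_le_of_lt h3 h5) (lt_irrefl _)
  · -- `MJ < qⁿ`: `(MJ)ᴺ qᴺ ≤ 2ᴺ N! M F q^{nN}`
    rw [min_eq_left hcase.le] at hu
    have h1 : (M * J * q) ^ (n + 1) ≤
        2 ^ (n + 1) * ((n + 1).factorial * (M * F) * (q ^ n) ^ (n + 1)) :=
      calc (M * J * q) ^ (n + 1) ≤ (2 * (Ω.card * q)) ^ (n + 1) :=
            Nat.pow_le_pow_left (by nlinarith [hu, hq1]) _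
        _ = 2 ^ (n + 1) * (Ω.card * q) ^ (n + 1) := mul_pow _ _ _
        _ ≤ 2 ^ (n + 1) * ((n + 1).factorial * (M * F) * (q ^ n) ^ (n + 1)) :=
            Nat.mul_le_mul_left _ hΩN
    have h2 : M ^ n * J ^ (n + 1) * q ^ (n + 1) ≤
        2 ^ (n + 1) * (n + 1).factorial * F * (q ^ n) ^ (n + 1) := by
      refine Nat.le_of_mul_le_mul_left ?_ hM1
      calc M * (M ^ n * J ^ (n + 1) * q ^ (n + 1)) = (M * J * q) ^ (n + 1) := by ring
        _ ≤ 2 ^ (n + 1) * ((n + 1).factorial * (M * F) * (q ^ n) ^ (n + 1)) := h1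
        _ = M * (2 ^ (n + 1) * (n + 1).factorial * F * (q ^ n) ^ (n + 1)) := by ring
    have h3 : lam ^ ((n + 1) * n) ≤ (2 * M * (A * F)) ^ n := by
      rw [pow_mul]
      exact Nat.pow_le_pow_left hM2 n
    have h4 : J ^ (n + 1) * lam ^ ((n + 1) * n) * q ^ (n + 1) ≤
        (2 * (A * F)) ^ n * (2 ^ (n + 1) * (n + 1).factorial * F * (q ^ n) ^ (n + 1)) :=
      calc J ^ (n + 1) * lam ^ ((n + 1) * n) * q ^ (n + 1)
          ≤ J ^ (n + 1) * (2 * M * (A * F)) ^ n * q ^ (n + 1) := by gcongr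
        _ = (2 * (A * F)) ^ n * (M ^ n * J ^ (n + 1) * q ^ (n + 1)) := by ring
        _ ≤ (2 * (A * F)) ^ n * (2 ^ (n + 1) * (n + 1).factorial * F * (q ^ n) ^ (n + 1)) :=
            Nat.mul_le_mul_left _ h2
    -- bookkeeping of the constant and of the powers of `q` (`n = k + 1`)
    have hqpos : 0 < q ^ (n + 1) := by positivity
    refine Nat.le_of_mul_le_mul_right (h4.trans_eq ?_) hqpos
    obtain ⟨k, rfl⟩ : ∃ k, n = k + 1 := ⟨n - 1, by omega⟩
    have hAk : (4 * (k + 1 + 1)) ^ ((k + 1 + 1) * (k + 1)) = A ^ (k + 1) := by rw [hA, ← pow_mul]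
    rw [eotConst_eq, hAk, Nat.add_sub_cancel]
    ring

/-! ### Corollary 1.10 for lines: Kakeya sets with multiplicity -/

/-- The number of points of `E` on the line `a + t(1, b')` is the line sum of the indicator of `E`.
[folklore] -/
theorem lineSum_indicator (E : Finset (Fin (n + 1) → K)) (a : Fin (n + 1) → K) (b' : Fin n → K) :
    lineSum (fun v => if v ∈ E then 1 else 0) a b' =
      (univ.filter fun t : K => a + t • Fin.cons 1 b' ∈ E).card := by
  rw [lineSum_eq, card_filter]

omit [Field K] in
/-- `‖1_E‖ᴺ_N = |E|`. [folklore] -/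
theorem sum_indicator_pow (E : Finset (Fin (n + 1) → K)) {N : ℕ} (hN : N ≠ 0) :
    ∑ v : Fin (n + 1) → K, (if v ∈ E then 1 else 0) ^ N = E.card := by
  have h : ∀ v : Fin (n + 1) → K, ((if v ∈ E then 1 else 0) : ℕ) ^ N = if v ∈ E then 1 else 0 :=
    fun v => by split_ifs <;> simp [hN]
  simp_rw [h]
  rw [← card_filter, filter_mem_eq_inter, univ_inter]

/-- A line has at most `q` points in `E`. [folklore] -/
theorem card_filter_line_le (E : Finset (Fin (n + 1) → K)) (a : Fin (n + 1) → K) (b' : Fin n → K) :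
    (univ.filter fun t : K => a + t • Fin.cons 1 b' ∈ E).card ≤ Fintype.card K :=
  (card_le_card (filter_subset _ _)).trans_eq (card_univ)

/-- **EOT Corollary 1.10 (Kakeya set conjecture with multiplicity) for lines in `𝔽_qⁿ⁺¹`, with an
explicit constant:** let `n ≥ 1`, `E ⊆ 𝔽_qⁿ⁺¹`, `λ ≥ 0`, and let `B ⊆ 𝔽_qⁿ` be a set of slopes such
that for every `b' ∈ B` some line in direction `(1, b')` meets `E` in at least `λ` points.  Then
`|B| · λⁿ⁺¹ ≤ (4(n+1))ⁿ⁺¹ · qⁿ · |E|` — the printed `|E| ≥ C^{−n} J λⁿ / |F|^{n−1}` (ambient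
dimension `n + 1`, `J = |B|` distinct directions, `W` = the hyperplane at infinity, `d = 1`).
[cite: EllenbergOberlinTao2010KakeyaMaximal, Corollary 1.10 (case V = Pⁿ, W = hyperplane at
infinity, d = 1)] -/
theorem card_mul_pow_le_of_rich_lines (hn : 1 ≤ n) (E : Finset (Fin (n + 1) → K))
    (B : Finset (Fin n → K)) {lam : ℕ}
    (hB : ∀ b' ∈ B, ∃ a : Fin (n + 1) → K,
      lam ≤ (univ.filter fun t : K => a + t • Fin.cons 1 b' ∈ E).card) :
    B.card * lam ^ (n + 1) ≤ (4 * (n + 1)) ^ (n + 1) * Fintype.card K ^ n * E.card := by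
  classical
  set q := Fintype.card K with hq
  set A := (4 * (n + 1)) ^ (n + 1) with hA
  have hJ : B.card ≤ q ^ n := by
    have := card_le_univ B
    rwa [Fintype.card_fun, Fintype.card_fin] at this
  rcases B.eq_empty_or_nonempty with hB0 | ⟨b₀, hb₀⟩
  · rw [hB0, card_empty, zero_mul]
    exact Nat.zero_le _
  have hlamq : lam ≤ q := by
    obtain ⟨a, ha⟩ := hB b₀ hb₀
    exact ha.trans (card_filter_line_le E a b₀)
  rcases le_or_gt (A * E.card) (lam ^ (n + 1)) with hcase | hcase
  · -- the main case: Proposition 2.4 for the indicator of `E`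
    set f : (Fin (n + 1) → K) → ℕ := fun v => if v ∈ E then 1 else 0 with hf
    have hF : ∑ v : Fin (n + 1) → K, f v ^ (n + 1) = E.card :=
      sum_indicator_pow E (Nat.succ_ne_zero n)
    have hB' : ∀ b' ∈ B, ∃ a : Fin (n + 1) → K, lam ≤ lineSum f a b' := fun b' hb' =>
      (hB b' hb').imp fun a ha => by rwa [hf, lineSum_indicator]
    have hP := card_pow_mul_pow_le hn f B hB' (by rw [hF]; exact hcase) hlamq
    rw [hF] at hP
    -- `(J λⁿ)ᴺ ≤ (A q^{n−1} |E|)ᴺ`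
    have h1 : (B.card * lam ^ n) ^ (n + 1) ≤ (A * q ^ (n - 1) * E.card) ^ (n + 1) :=
      calc (B.card * lam ^ n) ^ (n + 1) = B.card ^ (n + 1) * lam ^ ((n + 1) * n) := by
            rw [mul_pow, ← pow_mul, mul_comm n]
        _ ≤ eotConst n * q ^ ((n - 1) * (n + 1)) * E.card ^ (n + 1) := hP
        _ ≤ A ^ (n + 1) * q ^ ((n - 1) * (n + 1)) * E.card ^ (n + 1) :=
            Nat.mul_le_mul_right _ (Nat.mul_le_mul_right _ (eotConst_le_pow n))
        _ = (A * q ^ (n - 1) * E.card) ^ (n + 1) := by rw [mul_pow, mul_pow, ← pow_mul q]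
    have h2 : B.card * lam ^ n ≤ A * q ^ (n - 1) * E.card :=
      (Nat.pow_le_pow_iff_left (Nat.succ_ne_zero n)).1 h1
    calc B.card * lam ^ (n + 1) = B.card * lam ^ n * lam := by rw [pow_succ, mul_assoc]
      _ ≤ A * q ^ (n - 1) * E.card * q := Nat.mul_le_mul h2 hlamq
      _ = A * (q ^ (n - 1) * q) * E.card := by ring
      _ = A * q ^ n * E.card := by rw [← pow_succ, Nat.sub_add_cancel hn]
  · -- few points on each line: trivial bound `J ≤ qⁿ`
    calc B.card * lam ^ (n + 1) ≤ q ^ n * (A * E.card) := Nat.mul_le_mul hJ hcase.le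
      _ = A * q ^ n * E.card := by ring

/-- **The Kakeya case (`λ = q`, all slopes; EOT: "Theorem 1.1 follows immediately … by specializing
to `f = 1_E`"):** an almost Kakeya set `E ⊆ 𝔽_qⁿ⁺¹` (a line in every direction `(1, b')`) has
`qⁿ⁺¹ ≤ (4(n+1))ⁿ⁺¹ |E|`.  (Dvir's theorem, here with the constant of the maximal inequality; the
sharp constants are in `FiniteFieldKakeya.lean` … `KakeyaSharpDensityBound.lean`.)
[cite: EllenbergOberlinTao2010KakeyaMaximal, Theorem 1.1 (deduced from Corollary 1.10)] -/
theorem pow_le_mul_card_of_isAlmostKakeya (hn : 1 ≤ n) {E : Finset (Fin (n + 1) → K)}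
    (hE : IsAlmostKakeya (↑E : Set (Fin (n + 1) → K))) :
    Fintype.card K ^ (n + 1) ≤ (4 * (n + 1)) ^ (n + 1) * E.card := by
  classical
  set q := Fintype.card K with hq
  have h := card_mul_pow_le_of_rich_lines hn E (univ : Finset (Fin n → K)) (lam := q)
    fun b' _ => (hE b').imp fun a ha => by
      rw [Finset.filter_true_of_mem fun t _ => Finset.mem_coe.1 (ha t), card_univ]
  rw [card_univ, Fintype.card_fun, Fintype.card_fin] at h
  have hpos : 0 < q ^ n := by positivity
  refine Nat.le_of_mul_le_mul_right ?_ hpos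
  calc q ^ (n + 1) * q ^ n = q ^ n * q ^ (n + 1) := mul_comm _ _
    _ ≤ (4 * (n + 1)) ^ (n + 1) * q ^ n * E.card := h
    _ = (4 * (n + 1)) ^ (n + 1) * E.card * q ^ n := by ring

/-- **Corollary 1.10 in density form, over `ℝ`:** if at least `δ qⁿ` slopes `b'` have a line in
direction `(1, b')` meeting `E` in at least `γ q` points (`δ, γ ≥ 0`), then
`δ γⁿ⁺¹ qⁿ⁺¹ ≤ (4(n+1))ⁿ⁺¹ |E|` — linear in `δ` (the strength of the maximal conjecture), where
Dvir's Theorem 1.4 (`FiniteFieldKakeya.choose_floor_le_card_of_isDeltaGammaKakeya`) has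
`min(δ, γ)ⁿ⁺¹`. [cite: EllenbergOberlinTao2010KakeyaMaximal, Corollary 1.10 (case V = Pⁿ,
W = hyperplane at infinity, d = 1)] -/
theorem delta_gamma_le_card (hn : 1 ≤ n) (E : Finset (Fin (n + 1) → K)) (B : Finset (Fin n → K))
    {δ γ : ℝ} (hγ : 0 ≤ γ) (hδ : δ * (Fintype.card K : ℝ) ^ n ≤ B.card)
    (hB : ∀ b' ∈ B, ∃ a : Fin (n + 1) → K,
      γ * Fintype.card K ≤ (univ.filter fun t : K => a + t • Fin.cons 1 b' ∈ E).card) :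
    δ * γ ^ (n + 1) * (Fintype.card K : ℝ) ^ (n + 1) ≤ (4 * (n + 1)) ^ (n + 1) * E.card := by
  classical
  set q := Fintype.card K with hq
  set lam := ⌈γ * q⌉₊ with hlam
  have hB' : ∀ b' ∈ B, ∃ a : Fin (n + 1) → K,
      lam ≤ (univ.filter fun t : K => a + t • Fin.cons 1 b' ∈ E).card := fun b' hb' =>
    (hB b' hb').imp fun a ha => Nat.ceil_le.2 ha
  have h := card_mul_pow_le_of_rich_lines hn E B hB'
  have h' : (B.card : ℝ) * (lam : ℝ) ^ (n + 1) ≤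
      (4 * (n + 1)) ^ (n + 1) * (q : ℝ) ^ n * E.card := by
    exact_mod_cast h
  have hγq : γ * q ≤ lam := Nat.le_ceil _
  have hγq0 : 0 ≤ γ * q := mul_nonneg hγ (Nat.cast_nonneg _)
  have hqpos : (0 : ℝ) < (q : ℝ) ^ n := by
    have : 0 < q := Fintype.card_pos
    positivity
  -- `δ γᴺ qᴺ · qⁿ ≤ |B| λᴺ ≤ A qⁿ |E|`
  have h1 : δ * γ ^ (n + 1) * (q : ℝ) ^ (n + 1) * (q : ℝ) ^ n ≤
      (4 * (n + 1)) ^ (n + 1) * E.card * (q : ℝ) ^ n := by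
    calc δ * γ ^ (n + 1) * (q : ℝ) ^ (n + 1) * (q : ℝ) ^ n
        = (δ * (q : ℝ) ^ n) * (γ * q) ^ (n + 1) := by ring
      _ ≤ B.card * (lam : ℝ) ^ (n + 1) := by
          have hlampow : (γ * q) ^ (n + 1) ≤ (lam : ℝ) ^ (n + 1) := pow_le_pow_left₀ hγq0 hγq _
          rcases le_or_gt 0 δ with hδ0 | hδ0
          · exact mul_le_mul hδ hlampow (pow_nonneg hγq0 _) (Nat.cast_nonneg _)
          · have hneg : δ * (q : ℝ) ^ n * (γ * q) ^ (n + 1) ≤ 0 :=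
              mul_nonpos_of_nonpos_of_nonneg
                (mul_nonpos_of_nonpos_of_nonneg hδ0.le (pow_nonneg (Nat.cast_nonneg _) _))
                (pow_nonneg hγq0 _)
            exact hneg.trans (by positivity)
      _ ≤ (4 * (n + 1)) ^ (n + 1) * (q : ℝ) ^ n * E.card := h'
      _ = (4 * (n + 1)) ^ (n + 1) * E.card * (q : ℝ) ^ n := by ring
  exact le_of_mul_le_mul_right h1 hqpos

end Distributional

/-! ### The Kakeya maximal function and its distribution (towards Theorem 1.3) -/

section MaximalFunction

variable {n : ℕ} [Fintype K]

/-- **The Kakeya maximal function** on slopes: `f*(b') = max_a ∑_{x ∈ a + 𝔽(1,b')} f(x)`, the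
supremum over all lines with direction `(1, b')` (the left-hand side of (1.1) at the direction
`ω = (1 : b')`). [cite: EllenbergOberlinTao2010KakeyaMaximal, Theorem 1.3, eq. (1.1)] -/
def maxLineSum (f : (Fin (n + 1) → K) → ℕ) (b' : Fin n → K) : ℕ :=
  (univ : Finset (Fin (n + 1) → K)).sup fun a => lineSum f a b'

/-- Every line sum is at most the maximal function. [folklore] -/
theorem lineSum_le_maxLineSum (f : (Fin (n + 1) → K) → ℕ) (a : Fin (n + 1) → K)
    (b' : Fin n → K) : lineSum f a b' ≤ maxLineSum f b' :=
  Finset.le_sup (f := fun a => lineSum f a b') (mem_univ a)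

/-- The maximal function is attained by some line. [folklore] -/
theorem exists_lineSum_eq_maxLineSum (f : (Fin (n + 1) → K) → ℕ) (b' : Fin n → K) :
    ∃ a : Fin (n + 1) → K, lineSum f a b' = maxLineSum f b' := by
  obtain ⟨a, -, ha⟩ := Finset.exists_mem_eq_sup (univ : Finset (Fin (n + 1) → K)) univ_nonempty
    fun a => lineSum f a b'
  exact ⟨a, ha.symm⟩

/-- `λ ≤ f*(b')` iff some line of slope `b'` has `f`-sum `≥ λ`. [folklore] -/
theorem le_maxLineSum_iff (f : (Fin (n + 1) → K) → ℕ) (b' : Fin n → K) (lam : ℕ) :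
    lam ≤ maxLineSum f b' ↔ ∃ a : Fin (n + 1) → K, lam ≤ lineSum f a b' := by
  constructor
  · intro h
    obtain ⟨a, ha⟩ := exists_lineSum_eq_maxLineSum f b'
    exact ⟨a, by rw [ha]; exact h⟩
  · rintro ⟨a, ha⟩
    exact ha.trans (lineSum_le_maxLineSum f a b')

/-- Line sums are additive in `f`. [folklore] -/
theorem lineSum_add (f g : (Fin (n + 1) → K) → ℕ) (a : Fin (n + 1) → K) (b' : Fin n → K) :
    lineSum (f + g) a b' = lineSum f a b' + lineSum g a b' := by
  rw [lineSum_eq, lineSum_eq, lineSum_eq, ← sum_add_distrib]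
  rfl

/-- Line sums are monotone in `f`. [folklore] -/
theorem lineSum_mono {f g : (Fin (n + 1) → K) → ℕ} (h : ∀ v, f v ≤ g v) (a : Fin (n + 1) → K)
    (b' : Fin n → K) : lineSum f a b' ≤ lineSum g a b' := by
  rw [lineSum_eq, lineSum_eq]
  exact sum_le_sum fun t _ => h _

/-- The maximal function is subadditive: `(f + g)* ≤ f* + g*`. [folklore] -/
theorem maxLineSum_add_le (f g : (Fin (n + 1) → K) → ℕ) (b' : Fin n → K) :
    maxLineSum (f + g) b' ≤ maxLineSum f b' + maxLineSum g b' := by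
  obtain ⟨a, ha⟩ := exists_lineSum_eq_maxLineSum (f + g) b'
  rw [← ha, lineSum_add]
  exact Nat.add_le_add (lineSum_le_maxLineSum f a b') (lineSum_le_maxLineSum g a b')

/-- The maximal function is monotone in `f`. [folklore] -/
theorem maxLineSum_mono {f g : (Fin (n + 1) → K) → ℕ} (h : ∀ v, f v ≤ g v) (b' : Fin n → K) :
    maxLineSum f b' ≤ maxLineSum g b' := by
  obtain ⟨a, ha⟩ := exists_lineSum_eq_maxLineSum f b'
  rw [← ha]
  exact (lineSum_mono h a b').trans (lineSum_le_maxLineSum g a b')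

/-- The maximal function of a finite sum is at most the sum of the maximal functions. [folklore] -/
theorem maxLineSum_sum_le {ι : Type*} (s : Finset ι) (f : ι → (Fin (n + 1) → K) → ℕ)
    (b' : Fin n → K) : maxLineSum (∑ i ∈ s, f i) b' ≤ ∑ i ∈ s, maxLineSum (f i) b' := by
  classical
  induction s using Finset.induction_on with
  | empty =>
    rw [sum_empty, sum_empty]
    obtain ⟨a, ha⟩ := exists_lineSum_eq_maxLineSum (n := n) (K := K) 0 b'
    rw [← ha, lineSum_eq]
    simp
  | insert i s hi ih =>
    rw [sum_insert hi, sum_insert hi]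
    exact (maxLineSum_add_le _ _ b').trans (Nat.add_le_add_left ih _)

/-- A pointwise small function has small line sums: if `c f(v) < α` for all `v` then
`c ∑_{v ∈ ℓ} f(v) ≤ q (α − 1)`. [folklore] -/
theorem mul_lineSum_le {f : (Fin (n + 1) → K) → ℕ} {c α : ℕ} (h : ∀ v, c * f v < α)
    (a : Fin (n + 1) → K) (b' : Fin n → K) : c * lineSum f a b' ≤ Fintype.card K * (α - 1) := by
  rw [lineSum_eq, mul_sum]
  have := sum_le_sum fun t (_ : t ∈ (univ : Finset K)) =>
    (Nat.le_sub_one_of_lt (h (a + t • Fin.cons 1 b')))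
  rwa [sum_const, card_univ, smul_eq_mul] at this

variable [DecidableEq K]

/-- **The distributional form of Proposition 2.4** (`A = 1`): for `g : 𝔽_qⁿ⁺¹ → ℕ` and a level
`λ ≤ q` with `(4N)ᴺ ‖g‖ᴺ ≤ λᴺ`, `#{b' : g*(b') ≥ λ} · λⁿ ≤ (4N)ᴺ q^{n−1} ‖g‖ᴺ_N`.
[cite: EllenbergOberlinTao2010KakeyaMaximal, Proposition 2.3 / 2.4 (§2)] -/
theorem card_filter_mul_pow_le (hn : 1 ≤ n) (g : (Fin (n + 1) → K) → ℕ) {lam : ℕ}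
    (hlam : (4 * (n + 1)) ^ (n + 1) * ∑ v : Fin (n + 1) → K, g v ^ (n + 1) ≤ lam ^ (n + 1))
    (hlamq : lam ≤ Fintype.card K) :
    (univ.filter fun b' : Fin n → K => lam ≤ maxLineSum g b').card * lam ^ n ≤
      (4 * (n + 1)) ^ (n + 1) * Fintype.card K ^ (n - 1) *
        ∑ v : Fin (n + 1) → K, g v ^ (n + 1) := by
  set q := Fintype.card K with hq
  set A := (4 * (n + 1)) ^ (n + 1) with hA
  set G := ∑ v : Fin (n + 1) → K, g v ^ (n + 1) with hG
  set B := univ.filter fun b' : Fin n → K => lam ≤ maxLineSum g b' with hB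
  have hB' : ∀ b' ∈ B, ∃ a : Fin (n + 1) → K, lam ≤ lineSum g a b' := fun b' hb' =>
    (le_maxLineSum_iff g b' lam).1 (mem_filter.1 hb').2
  have hP := card_pow_mul_pow_le hn g B hB' hlam hlamq
  have h1 : (B.card * lam ^ n) ^ (n + 1) ≤ (A * q ^ (n - 1) * G) ^ (n + 1) :=
    calc (B.card * lam ^ n) ^ (n + 1) = B.card ^ (n + 1) * lam ^ ((n + 1) * n) := by
          rw [mul_pow, ← pow_mul, mul_comm n]
      _ ≤ eotConst n * q ^ ((n - 1) * (n + 1)) * G ^ (n + 1) := hP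
      _ ≤ A ^ (n + 1) * q ^ ((n - 1) * (n + 1)) * G ^ (n + 1) :=
          Nat.mul_le_mul_right _ (Nat.mul_le_mul_right _ (eotConst_le_pow n))
      _ = (A * q ^ (n - 1) * G) ^ (n + 1) := by rw [mul_pow, mul_pow, ← pow_mul q]
  exact (Nat.pow_le_pow_iff_left (Nat.succ_ne_zero n)).1 h1

/-- **Proposition 2.3 (the distributional estimate with the scale `A`):** if `g` takes values in
`{0} ∪ [a, ∞)` (`a ≥ 1`), `λ ≤ a q` and `4ᴺ (4N)ᴺ ‖g‖ᴺ_N ≤ λᴺ`, then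
`#{b' : g*(b') ≥ λ} · a λⁿ ≤ 4ⁿ (4N)ᴺ q^{n−1} ‖g‖ᴺ_N` — the printed
`|{f* ≥ λ}| ≪ |F|^{N−2} ‖f‖ᴺ / (A λ^{N−1})`, by "dividing `f` and `λ` by `A`" (here: `g ↦ ⌊g/a⌋`).
[cite: EllenbergOberlinTao2010KakeyaMaximal, Proposition 2.3 (§2)] -/
theorem card_filter_mul_mul_pow_le (hn : 1 ≤ n) (g : (Fin (n + 1) → K) → ℕ) {a lam : ℕ}
    (ha : 1 ≤ a) (hga : ∀ v, g v = 0 ∨ a ≤ g v) (hlamq : lam ≤ a * Fintype.card K)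
    (hlam : 4 ^ (n + 1) * (4 * (n + 1)) ^ (n + 1) * ∑ v : Fin (n + 1) → K, g v ^ (n + 1) ≤
      lam ^ (n + 1)) :
    (univ.filter fun b' : Fin n → K => lam ≤ maxLineSum g b').card * a * lam ^ n ≤
      4 ^ n * (4 * (n + 1)) ^ (n + 1) * Fintype.card K ^ (n - 1) *
        ∑ v : Fin (n + 1) → K, g v ^ (n + 1) := by
  set q := Fintype.card K with hq
  set A := (4 * (n + 1)) ^ (n + 1) with hA
  set G := ∑ v : Fin (n + 1) → K, g v ^ (n + 1) with hG
  set T := (univ.filter fun b' : Fin n → K => lam ≤ maxLineSum g b').card with hT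
  -- degenerate case `λ = 0`
  rcases Nat.eq_zero_or_pos lam with hlam0 | hlampos
  · rw [hlam0, zero_pow (by omega), mul_zero]
    exact Nat.zero_le _
  -- `g' = ⌊g / a⌋`
  set g' : (Fin (n + 1) → K) → ℕ := fun v => g v / a with hg'
  have hg'le : ∀ v, a * g' v ≤ g v := fun v => Nat.mul_div_le (g v) a
  have hgle : ∀ v, g v ≤ 2 * a * g' v := by
    intro v
    rcases hga v with h0 | h1
    · rw [h0]
      exact Nat.zero_le _
    · have hk : 1 ≤ g v / a := (Nat.le_div_iff_mul_le ha).2 (by rwa [one_mul])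
      have hlt : g v < g v / a * a + a := Nat.lt_div_mul_add ha
      change g v ≤ 2 * a * (g v / a)
      nlinarith
  set G' := ∑ v : Fin (n + 1) → K, g' v ^ (n + 1) with hG'
  have hGG' : a ^ (n + 1) * G' ≤ G := by
    rw [hG', mul_sum]
    exact sum_le_sum fun v _ => by
      rw [← mul_pow]
      exact Nat.pow_le_pow_left (hg'le v) _
  -- the new level `λ' = ⌊λ / 2a⌋ ≥ λ / 4a`
  set lam' := lam / (2 * a) with hlam'
  have h2a : 0 < 2 * a := by omega
  have hGa : a ^ (n + 1) ≤ G ∨ G = 0 := by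
    rcases Nat.eq_zero_or_pos G with h0 | hpos
    · exact Or.inr h0
    · left
      -- some `g v ≠ 0`, hence `≥ a`
      obtain ⟨v, -, hv⟩ : ∃ v ∈ (univ : Finset (Fin (n + 1) → K)), g v ^ (n + 1) ≠ 0 := by
        by_contra h
        push Not at h
        exact hpos.ne' (sum_eq_zero h)
      have hv' : a ≤ g v := by
        rcases hga v with h0 | h1
        · rw [h0, zero_pow (Nat.succ_ne_zero n)] at hv
          exact absurd rfl hv
        · exact h1
      exact (Nat.pow_le_pow_left hv' _).trans
        (single_le_sum (f := fun v => g v ^ (n + 1)) (fun _ _ => Nat.zero_le _) (mem_univ v))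
  rcases hGa with hGa | hG0
  swap
  · rw [hG0, mul_zero]
    have hT0 : T = 0 := by
      rw [hT, card_eq_zero, filter_eq_empty_iff]
      intro b' _ hle
      obtain ⟨a₀, ha₀⟩ := (le_maxLineSum_iff g b' lam).1 hle
      have hg0 : ∀ v, g v = 0 := fun v =>
        (pow_eq_zero_iff (Nat.succ_ne_zero n)).1 ((sum_eq_zero_iff.1 hG0) v (mem_univ v))
      rw [lineSum_eq, sum_eq_zero (fun t _ => hg0 _)] at ha₀
      omega
    rw [hT0, zero_mul, zero_mul]
  -- `λ ≥ 16 a`, so `4a λ' ≥ λ`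
  have hlam16 : 16 * a ≤ lam := by
    -- `(16a)^N ≤ 4^N A a^N ≤ 4^N A G ≤ λ^N`
    have h1 : (16 * a) ^ (n + 1) ≤ lam ^ (n + 1) :=
      calc (16 * a) ^ (n + 1) = 4 ^ (n + 1) * 4 ^ (n + 1) * a ^ (n + 1) := by
            rw [← mul_pow, ← mul_pow]; norm_num
        _ ≤ 4 ^ (n + 1) * A * a ^ (n + 1) := by
            gcongr
            rw [hA]
            exact Nat.pow_le_pow_left (by omega) _
        _ ≤ 4 ^ (n + 1) * A * G := Nat.mul_le_mul_left _ hGa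
        _ ≤ lam ^ (n + 1) := hlam
    exact le_of_pow_le_pow_left₀ (Nat.succ_ne_zero n) (Nat.zero_le _) h1
  have hlam'ge : lam ≤ 4 * a * lam' := by
    have h1 : lam < lam / (2 * a) * (2 * a) + 2 * a := Nat.lt_div_mul_add h2a
    rw [← hlam'] at h1
    nlinarith
  have hlam'q : lam' ≤ q := by
    rw [hlam']
    exact Nat.div_le_of_le_mul (by nlinarith)
  have hlam'A : A * G' ≤ lam' ^ (n + 1) := by
    -- `(4a)^N A G' ≤ 4^N A G ≤ λ^N ≤ (4a λ')^N`
    have h1 : (4 * a) ^ (n + 1) * (A * G') ≤ (4 * a) ^ (n + 1) * lam' ^ (n + 1) :=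
      calc (4 * a) ^ (n + 1) * (A * G') = 4 ^ (n + 1) * A * (a ^ (n + 1) * G') := by
            rw [mul_pow]; ring
        _ ≤ 4 ^ (n + 1) * A * G := Nat.mul_le_mul_left _ hGG'
        _ ≤ lam ^ (n + 1) := hlam
        _ ≤ (4 * a * lam') ^ (n + 1) := Nat.pow_le_pow_left hlam'ge _
        _ = (4 * a) ^ (n + 1) * lam' ^ (n + 1) := mul_pow _ _ _
    exact Nat.le_of_mul_le_mul_left h1 (by positivity)
  -- Proposition 2.4 for `g'` at level `λ'`
  have hD := card_filter_mul_pow_le hn g' hlam'A hlam'q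
  -- `{λ ≤ g*} ⊆ {λ' ≤ g'*}`
  have hsub : (univ.filter fun b' : Fin n → K => lam ≤ maxLineSum g b') ⊆
      univ.filter fun b' : Fin n → K => lam' ≤ maxLineSum g' b' := by
    intro b' hb'
    rw [mem_filter] at hb' ⊢
    refine ⟨mem_univ _, ?_⟩
    obtain ⟨a₀, ha₀⟩ := (le_maxLineSum_iff g b' lam).1 hb'.2
    refine (le_maxLineSum_iff g' b' lam').2 ⟨a₀, ?_⟩
    have h1 : lineSum g a₀ b' ≤ 2 * a * lineSum g' a₀ b' := by
      rw [lineSum_eq, lineSum_eq, mul_sum]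
      exact sum_le_sum fun t _ => hgle _
    rw [hlam']
    exact Nat.div_le_of_le_mul (by nlinarith)
  have hT' : T ≤ (univ.filter fun b' : Fin n → K => lam' ≤ maxLineSum g' b').card :=
    card_le_card hsub
  -- assemble: `a^N T λⁿ ≤ a^N T (4aλ')ⁿ ≤ (4a)ⁿ A q^{n-1} a^N G' ≤ (4a)ⁿ A q^{n-1} G`
  have h4 : T * lam' ^ n ≤ A * q ^ (n - 1) * G' := (Nat.mul_le_mul_right _ hT').trans hD
  have h3 : a ^ (n + 1) * (T * a * lam ^ n) ≤ a ^ (n + 1) * (4 ^ n * A * q ^ (n - 1) * G) :=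
    calc a ^ (n + 1) * (T * a * lam ^ n) ≤ a ^ (n + 1) * (T * a * (4 * a * lam') ^ n) := by
          gcongr
      _ = a * (4 * a) ^ n * (T * lam' ^ n) * a ^ (n + 1) := by rw [mul_pow]; ring
      _ ≤ a * (4 * a) ^ n * (A * q ^ (n - 1) * G') * a ^ (n + 1) :=
          Nat.mul_le_mul_right _ (Nat.mul_le_mul_left _ h4)
      _ = (4 * a) ^ n * a * A * q ^ (n - 1) * (a ^ (n + 1) * G') := by ring
      _ ≤ (4 * a) ^ n * a * A * q ^ (n - 1) * G := Nat.mul_le_mul_left _ hGG'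
      _ = a ^ (n + 1) * (4 ^ n * A * q ^ (n - 1) * G) := by rw [mul_pow]; ring
  exact Nat.le_of_mul_le_mul_left h3 (by positivity)

end MaximalFunction

/-! ### Tools for the real-interpolation argument (proof of Theorem 2.1 from Proposition 2.3) -/

section InterpolationTools

/-- **Dyadic layer-cake decomposition:** `xᴺ ≤ 2ᴺ ∑_{k < L, 2ᵏ ≤ x} 2^{kN}` for `x < 2ᴸ`, `N ≥ 1`
(the discrete form of `‖f*‖ᴺ = N ∫ |{f* ≥ α}| α^{N−1} dα`, eq. (2.2)). [folklore] -/
theorem pow_le_two_pow_mul_sum_filter (x : ℕ) {N L : ℕ} (hN : N ≠ 0) (hx : x < 2 ^ L) :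
    x ^ N ≤ 2 ^ N * ∑ k ∈ (range L).filter (fun k => 2 ^ k ≤ x), 2 ^ (k * N) := by
  rcases Nat.eq_zero_or_pos x with rfl | hxpos
  · rw [zero_pow hN]
    exact Nat.zero_le _
  set κ := Nat.log 2 x with hκ
  have h1 : 2 ^ κ ≤ x := Nat.pow_log_le_self 2 hxpos.ne'
  have h2 : x < 2 ^ (κ + 1) := Nat.lt_pow_succ_log_self (by norm_num) x
  have hκL : κ < L := (Nat.pow_lt_pow_iff_right (by norm_num)).1 (lt_of_le_of_lt h1 hx)
  have hmem : κ ∈ (range L).filter (fun k => 2 ^ k ≤ x) := mem_filter.2 ⟨mem_range.2 hκL, h1⟩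
  calc x ^ N ≤ (2 ^ (κ + 1)) ^ N := Nat.pow_le_pow_left h2.le _
    _ = 2 ^ N * 2 ^ (κ * N) := by rw [← pow_mul, ← pow_add]; ring_nf
    _ ≤ 2 ^ N * ∑ k ∈ (range L).filter (fun k => 2 ^ k ≤ x), 2 ^ (k * N) :=
        Nat.mul_le_mul_left _ (single_le_sum (f := fun k => 2 ^ (k * N))
          (fun _ _ => Nat.zero_le _) hmem)

/-- **Each value meets a given dyadic band at boundedly many scales:**
`#{k : c 2ᵏ ≤ m < c 2ᵏ 2^ρ} ≤ ρ` (the bounded overlap behind "the function of `α` to be integrated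
against `dα/α` is the characteristic function of an interval `[A, 100ⁿ A]`", §2). [folklore] -/
theorem card_filter_band_le (m c ρ : ℕ) (s : Finset ℕ) :
    (s.filter fun k => c * 2 ^ k ≤ m ∧ m < c * 2 ^ k * 2 ^ ρ).card ≤ ρ := by
  set S := s.filter fun k => c * 2 ^ k ≤ m ∧ m < c * 2 ^ k * 2 ^ ρ with hS
  rcases S.eq_empty_or_nonempty with h0 | hne
  · rw [h0, card_empty]
    exact Nat.zero_le _
  obtain ⟨k₀, hk₀, hmin⟩ := S.exists_min_image id hne
  have hk₀' := (mem_filter.1 hk₀).2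
  -- every `k ∈ S` lies in `[k₀, k₀ + ρ)`
  have hsub : S ⊆ Finset.Ico k₀ (k₀ + ρ) := by
    intro k hk
    have hk' := (mem_filter.1 hk).2
    rw [Finset.mem_Ico]
    refine ⟨hmin k hk, ?_⟩
    by_contra hge
    push Not at hge
    -- `c 2^k ≥ c 2^{k₀} 2^ρ > m`
    have h1 : c * 2 ^ k₀ * 2 ^ ρ ≤ c * 2 ^ k := by
      rw [mul_assoc, ← pow_add]
      exact Nat.mul_le_mul_left _ (Nat.pow_le_pow_right (by norm_num) hge)
    exact absurd (lt_of_lt_of_le hk₀'.2 (h1.trans hk'.1)) (lt_irrefl _)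
  calc S.card ≤ (Finset.Ico k₀ (k₀ + ρ)).card := card_le_card hsub
    _ = ρ := by rw [Nat.card_Ico]; omega

/-- Rounding up: `⌈x / d⌉ = (x + d − 1) / d`. [folklore] -/
def ceilDiv (x d : ℕ) : ℕ := (x + d - 1) / d

/-- `x ≤ d ⌈x/d⌉`. [folklore] -/
theorem le_mul_ceilDiv (x : ℕ) {d : ℕ} (hd : 0 < d) : x ≤ d * ceilDiv x d := by
  have h := Nat.lt_div_mul_add (a := x + d - 1) hd
  rw [ceilDiv]
  have : (x + d - 1) / d * d = d * ((x + d - 1) / d) := mul_comm _ _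
  omega

/-- `⌈x/d⌉ ≤ c` as soon as `x ≤ d c`. [folklore] -/
theorem ceilDiv_le_of_le_mul {x d c : ℕ} (hd : 0 < d) (h : x ≤ d * c) : ceilDiv x d ≤ c := by
  rw [ceilDiv]
  calc (x + d - 1) / d ≤ (d * c + (d - 1)) / d := Nat.div_le_div_right (by omega)
    _ = c := by rw [Nat.mul_add_div hd, Nat.div_eq_of_lt (Nat.sub_lt hd Nat.one_pos), add_zero]

/-- `⌈x/d⌉ ≥ 1` for `x ≥ 1`. [folklore] -/
theorem one_le_ceilDiv {x d : ℕ} (hd : 0 < d) (hx : 1 ≤ x) : 1 ≤ ceilDiv x d := by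
  by_contra h
  have h0 : ceilDiv x d = 0 := by omega
  have := le_mul_ceilDiv x hd
  rw [h0, mul_zero] at this
  omega

/-- The dyadic thresholds add up: `∑_{j=1}^{J} 2^{k−1−j} + 2^{k−1−J} = 2^{k−1}` (`J + 2 ≤ k`) — the
identity behind "`f*(w) ≤ f_α*(w) + ∑_j f*_{j,α}(w) + α/2`" and the thresholds `α/2^{j+1}`.
[folklore] -/
theorem sum_Icc_two_pow_add {k : ℕ} : ∀ {J : ℕ}, J + 2 ≤ k →
    ∑ j ∈ Finset.Icc 1 J, 2 ^ (k - 1 - j) + 2 ^ (k - 1 - J) = 2 ^ (k - 1)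
  | 0, _ => by simp
  | J + 1, hJ => by
    rw [Finset.sum_Icc_succ_top (by omega), add_assoc, ← two_mul, ← pow_succ',
      show k - 1 - (J + 1) + 1 = k - 1 - J by omega]
    exact sum_Icc_two_pow_add (by omega)

/-- `∑_{j ∈ s} 2^{−j} ≤ 2` for any finite `s ⊆ ℕ`. [folklore] -/
theorem sum_half_pow_le_two (s : Finset ℕ) : ∑ j ∈ s, ((1 : ℝ) / 2) ^ j ≤ 2 := by
  obtain ⟨L, hL⟩ : ∃ L, ∀ j ∈ s, j < L :=
    ⟨s.sup id + 1, fun j hj => Nat.lt_succ_of_le (Finset.le_sup (f := id) hj)⟩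
  calc ∑ j ∈ s, ((1 : ℝ) / 2) ^ j ≤ ∑ j ∈ range L, ((1 : ℝ) / 2) ^ j :=
        sum_le_sum_of_subset_of_nonneg (fun j hj => mem_range.2 (hL j hj))
          (fun _ _ _ => by positivity)
    _ ≤ 2 := sum_geometric_two_le L

/-- A dyadic geometric sum below a bound: `∑_{k ∈ s, 2^{kN} < X} 2^{kN} < 2ᴺ X` (`N ≥ 1`).
[folklore] -/
theorem sum_filter_two_pow_lt {N : ℕ} (hN : 1 ≤ N) (X : ℕ) (hX : 0 < X) (s : Finset ℕ) :
    ∑ k ∈ s.filter (fun k => 2 ^ (k * N) < X), 2 ^ (k * N) < 2 ^ N * X := by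
  classical
  -- `m` = least exponent with `X ≤ 2^{mN}`
  have hex : ∃ m : ℕ, X ≤ 2 ^ (m * N) :=
    ⟨X, (Nat.lt_two_pow_self).le.trans
      (Nat.pow_le_pow_right (by norm_num) (Nat.le_mul_of_pos_right X hN))⟩
  set m := Nat.find hex with hm
  have hmX : X ≤ 2 ^ (m * N) := Nat.find_spec hex
  have hlt : ∀ k ∈ s.filter (fun k => 2 ^ (k * N) < X), k < m := by
    intro k hk
    have hk' := (mem_filter.1 hk).2
    by_contra hge
    push Not at hge
    have : 2 ^ (m * N) ≤ 2 ^ (k * N) :=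
      Nat.pow_le_pow_right (by norm_num) (Nat.mul_le_mul_right _ hge)
    omega
  have h2N : 2 ≤ 2 ^ N := by
    calc 2 = 2 ^ 1 := (pow_one 2).symm
      _ ≤ 2 ^ N := Nat.pow_le_pow_right (by norm_num) hN
  have hsum : ∑ k ∈ s.filter (fun k => 2 ^ (k * N) < X), (2 ^ N) ^ k < (2 ^ N) ^ m :=
    Nat.geomSum_lt h2N hlt
  simp_rw [← pow_mul, mul_comm N] at hsum
  -- `2^{mN} ≤ 2^N X`
  have hmle : 2 ^ (m * N) ≤ 2 ^ N * X := by
    rcases Nat.eq_zero_or_pos m with h0 | hmpos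
    · rw [h0, zero_mul, pow_zero]
      calc 1 ≤ X := hX
        _ ≤ 2 ^ N * X := Nat.le_mul_of_pos_left X (by positivity)
    · have hprev : ¬ X ≤ 2 ^ ((m - 1) * N) := Nat.find_min hex (by omega)
      push Not at hprev
      have hNm : N ≤ m * N := Nat.le_mul_of_pos_left N hmpos
      calc 2 ^ (m * N) = 2 ^ N * 2 ^ ((m - 1) * N) := by
            rw [← pow_add]; congr 1; rw [Nat.sub_mul]; omega
        _ ≤ 2 ^ N * X := Nat.mul_le_mul_left _ hprev.le
  exact lt_of_lt_of_le hsum hmle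

end InterpolationTools

/-! ### Theorem 1.3: the strong-type `ℓᴺ → ℓᴺ` maximal inequality -/

section StrongType

variable {n : ℕ} [Fintype K] [DecidableEq K]

/-- Truncation of `f` to the values satisfying `P`: `f · 1_{P(f)}`. [folklore] -/
def trunc (P : ℕ → Prop) [DecidablePred P] (f : (Fin (n + 1) → K) → ℕ) :
    (Fin (n + 1) → K) → ℕ :=
  fun v => if P (f v) then f v else 0

omit [Field K] [Fintype K] [DecidableEq K] in
/-- Unfolding lemma for `trunc`. [folklore] -/
theorem trunc_apply (P : ℕ → Prop) [DecidablePred P] (f : (Fin (n + 1) → K) → ℕ)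
    (v : Fin (n + 1) → K) : trunc P f v = if P (f v) then f v else 0 :=
  rfl

omit [Field K] [Fintype K] [DecidableEq K] in
/-- A truncation is dominated by `f`. [folklore] -/
theorem trunc_le (P : ℕ → Prop) [DecidablePred P] (f : (Fin (n + 1) → K) → ℕ)
    (v : Fin (n + 1) → K) : trunc P f v ≤ f v := by
  rw [trunc_apply]
  split_ifs
  · exact le_rfl
  · exact Nat.zero_le _

omit [Field K] [Fintype K] [DecidableEq K] in
/-- The values of a truncation are `0` or values of `f` satisfying `P`. [folklore] -/
theorem trunc_eq_zero_or (P : ℕ → Prop) [DecidablePred P] (f : (Fin (n + 1) → K) → ℕ)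
    (v : Fin (n + 1) → K) : trunc P f v = 0 ∨ (trunc P f v = f v ∧ P (f v)) := by
  rw [trunc_apply]
  split_ifs with h
  · exact Or.inr ⟨rfl, h⟩
  · exact Or.inl rfl

omit [Field K] [DecidableEq K] in
/-- `‖trunc P f‖ᴺ_N ≤ ‖f‖ᴺ_N`. [folklore] -/
theorem sum_trunc_pow_le (P : ℕ → Prop) [DecidablePred P] (f : (Fin (n + 1) → K) → ℕ) (N : ℕ) :
    ∑ v : Fin (n + 1) → K, trunc P f v ^ N ≤ ∑ v : Fin (n + 1) → K, f v ^ N :=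
  sum_le_sum fun v _ => Nat.pow_le_pow_left (trunc_le P f v) _

/-- The small part at level `2ᵏ`: `f · 1{2q f < 2ᵏ}` (the printed `f_{0,α}`).
[cite: EllenbergOberlinTao2010KakeyaMaximal, Theorem 2.1 (proof: the function f_{0,α})] -/
def lowPart (f : (Fin (n + 1) → K) → ℕ) (k : ℕ) : (Fin (n + 1) → K) → ℕ :=
  trunc (fun m => 2 * Fintype.card K * m < 2 ^ k) f

/-- The `j`-th value band at level `2ᵏ`: `f · 1{2^{N(j−1)} 2ᵏ ≤ 2q f < 2^{Nj} 2ᵏ}` (`N = n + 1`;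
the printed `f_{j,α}` with ratio `2ᴺ` in place of `100ⁿ`).
[cite: EllenbergOberlinTao2010KakeyaMaximal, Theorem 2.1 (proof: the functions f_{j,α})] -/
def bandPart (f : (Fin (n + 1) → K) → ℕ) (k j : ℕ) : (Fin (n + 1) → K) → ℕ :=
  trunc (fun m => 2 ^ ((n + 1) * (j - 1)) * 2 ^ k ≤ 2 * Fintype.card K * m ∧
    2 * Fintype.card K * m < 2 ^ ((n + 1) * (j - 1)) * 2 ^ k * 2 ^ (n + 1)) f

/-- The top part at level `2ᵏ` above the band `J`: `f · 1{2^{NJ} 2ᵏ ≤ 2q f}` (the printed `f_α`).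
[cite: EllenbergOberlinTao2010KakeyaMaximal, Theorem 2.1 (proof: the function f_α)] -/
def topPart (f : (Fin (n + 1) → K) → ℕ) (k J : ℕ) : (Fin (n + 1) → K) → ℕ :=
  trunc (fun m => 2 ^ ((n + 1) * J) * 2 ^ k ≤ 2 * Fintype.card K * m) f

omit [Field K] [DecidableEq K] in
/-- **The decomposition `f = f_α + f_{0,α} + ∑_j f_{j,α}`** (as a pointwise inequality): every
value of `f` is below `2ᵏ/2q`, in one of the bands `1 ≤ j ≤ J`, or above the band `J`.
[cite: EllenbergOberlinTao2010KakeyaMaximal, Theorem 2.1 (proof: "Then f decomposes as …")] -/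
theorem le_lowPart_add_sum_bandPart_add_topPart (f : (Fin (n + 1) → K) → ℕ) (k J : ℕ)
    (v : Fin (n + 1) → K) :
    f v ≤ lowPart f k v + ∑ j ∈ Finset.Icc 1 J, bandPart f k j v + topPart f k J v := by
  set c := 2 * Fintype.card K with hc
  set m := c * f v with hm
  by_cases hlow : m < 2 ^ k
  · have : lowPart f k v = f v := by
      rw [lowPart, trunc_apply, if_pos (by rwa [← hc])]
    omega
  by_cases htop : 2 ^ ((n + 1) * J) * 2 ^ k ≤ m
  · have : topPart f k J v = f v := by
      rw [topPart, trunc_apply, if_pos (by rwa [← hc])]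
    omega
  push Not at hlow htop
  -- the least `j` with `m < 2^{Nj} 2^k`
  have hex : ∃ j, m < 2 ^ ((n + 1) * j) * 2 ^ k := ⟨J, htop⟩
  classical
  set j₀ := Nat.find hex with hj₀
  have hj₀spec : m < 2 ^ ((n + 1) * j₀) * 2 ^ k := Nat.find_spec hex
  have hj₀pos : 1 ≤ j₀ := by
    by_contra h
    have h0 : j₀ = 0 := by omega
    rw [h0, mul_zero, pow_zero, one_mul] at hj₀spec
    omega
  have hj₀J : j₀ ≤ J := Nat.find_min' hex htop
  have hprev : 2 ^ ((n + 1) * (j₀ - 1)) * 2 ^ k ≤ m :=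
    not_lt.1 (Nat.find_min hex (show j₀ - 1 < j₀ by omega))
  have hexp : (n + 1) * (j₀ - 1) + (n + 1) = (n + 1) * j₀ := by
    obtain ⟨i, hi⟩ := Nat.exists_eq_add_of_le hj₀pos
    rw [hi, Nat.add_sub_cancel_left]
    ring
  have hband : bandPart f k j₀ v = f v := by
    rw [bandPart, trunc_apply, if_pos]
    refine ⟨by rwa [← hc, ← hm], ?_⟩
    rw [← hc, ← hm, mul_right_comm, ← pow_add, hexp]
    exact hj₀spec
  have hmem : j₀ ∈ Finset.Icc 1 J := Finset.mem_Icc.2 ⟨hj₀pos, hj₀J⟩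
  have hle : bandPart f k j₀ v ≤ ∑ j ∈ Finset.Icc 1 J, bandPart f k j v :=
    single_le_sum (f := fun j => bandPart f k j v) (fun _ _ => Nat.zero_le _) hmem
  omega

omit [DecidableEq K] in
/-- The small part has small maximal function: `2 (f_{0,α})*(b') ≤ α − 1`
("`f*_{0,α}(w) ≪ α/√C₀`"). [cite: EllenbergOberlinTao2010KakeyaMaximal, Theorem 2.1 (proof)] -/
theorem two_mul_maxLineSum_lowPart_le (f : (Fin (n + 1) → K) → ℕ) (k : ℕ) (b' : Fin n → K) :
    2 * maxLineSum (lowPart f k) b' ≤ 2 ^ k - 1 := by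
  set q := Fintype.card K with hq
  have hqpos : 0 < q := Fintype.card_pos
  have hk : 1 ≤ 2 ^ k := Nat.one_le_two_pow
  obtain ⟨a, ha⟩ := exists_lineSum_eq_maxLineSum (lowPart f k) b'
  rw [← ha]
  have hsmall : ∀ v, 2 * q * lowPart f k v < 2 ^ k := by
    intro v
    rcases trunc_eq_zero_or (fun m => 2 * Fintype.card K * m < 2 ^ k) f v with h0 | ⟨h1, hP⟩
    · rw [lowPart, h0, mul_zero]
      exact hk
    · rw [lowPart, h1]
      exact hP
  have h := mul_lineSum_le hsmall a b'
  -- `2q L ≤ q (2^k − 1)` gives `2 L ≤ 2^k − 1`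
  rw [mul_assoc, mul_left_comm] at h
  exact Nat.le_of_mul_le_mul_left h hqpos

/-- The bookkeeping constant `D = 4ᴺ (4N)ᴺ ‖f‖ᴺ_N` of the level decomposition. [folklore] -/
def levelConst (n : ℕ) (F : ℕ) : ℕ := 4 ^ (n + 1) * (4 * (n + 1)) ^ (n + 1) * F

/-- The admissible bands at level `2ᵏ`: `j` is admissible iff `2^{(j+1)N} D ≤ 2^{kN}` (the
condition `K ‖f‖ ≤ α/2^{j+1}` of the printed proof); `bandIndex` is the largest admissible `j ≤ k`
(the printed `j_α − 1`). [cite: EllenbergOberlinTao2010KakeyaMaximal, Theorem 2.1 (proof: the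
integer j_α)] -/
def bandIndex (n F k : ℕ) : ℕ :=
  Nat.findGreatest (fun j => 2 ^ ((j + 1) * (n + 1)) * levelConst n F ≤ 2 ^ (k * (n + 1))) k

/-- Admissibility is downward closed in `j`. [folklore] -/
theorem band_admissible_mono {n F k j j' : ℕ} (hj : j' ≤ j)
    (h : 2 ^ ((j + 1) * (n + 1)) * levelConst n F ≤ 2 ^ (k * (n + 1))) :
    2 ^ ((j' + 1) * (n + 1)) * levelConst n F ≤ 2 ^ (k * (n + 1)) :=
  (Nat.mul_le_mul_right _ (Nat.pow_le_pow_right (by norm_num) (by nlinarith))).trans h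

/-- At a high level (`j = 0` admissible) the band index is admissible.
[cite: EllenbergOberlinTao2010KakeyaMaximal, Theorem 2.1 (proof)] -/
theorem bandIndex_spec {n F k : ℕ} (h0 : 2 ^ (n + 1) * levelConst n F ≤ 2 ^ (k * (n + 1))) :
    2 ^ ((bandIndex n F k + 1) * (n + 1)) * levelConst n F ≤ 2 ^ (k * (n + 1)) := by
  have := Nat.findGreatest_spec (P := fun j => 2 ^ ((j + 1) * (n + 1)) * levelConst n F ≤
    2 ^ (k * (n + 1))) (Nat.zero_le k) (by simpa using h0)
  exact this

/-- Every admissible `j ≤ k` is at most the band index. [folklore] -/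
theorem le_bandIndex {n F k j : ℕ} (hjk : j ≤ k)
    (h : 2 ^ ((j + 1) * (n + 1)) * levelConst n F ≤ 2 ^ (k * (n + 1))) : j ≤ bandIndex n F k :=
  Nat.le_findGreatest hjk h

/-- The band index is at most `k − 3` (when `F ≥ 1`): `2^{(J+3)N} ≤ 2^{(J+1)N} D ≤ 2^{kN}`.
[folklore] -/
theorem bandIndex_add_three_le {n F k : ℕ} (hF : 1 ≤ F)
    (h0 : 2 ^ (n + 1) * levelConst n F ≤ 2 ^ (k * (n + 1))) : bandIndex n F k + 3 ≤ k := by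
  have h := bandIndex_spec h0
  set J := bandIndex n F k with hJ
  have hD : 2 ^ (2 * (n + 1)) ≤ levelConst n F := by
    rw [levelConst, pow_mul, show (2 : ℕ) ^ 2 = 4 from by norm_num, mul_assoc]
    exact Nat.le_mul_of_pos_right _ (Nat.mul_pos (by positivity) hF)
  have h1 : 2 ^ ((J + 3) * (n + 1)) ≤ 2 ^ (k * (n + 1)) :=
    calc 2 ^ ((J + 3) * (n + 1)) = 2 ^ ((J + 1) * (n + 1)) * 2 ^ (2 * (n + 1)) := by
          rw [← pow_add]; ring_nf
      _ ≤ 2 ^ ((J + 1) * (n + 1)) * levelConst n F := Nat.mul_le_mul_left _ hD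
      _ ≤ 2 ^ (k * (n + 1)) := h
  have h2 := (Nat.pow_le_pow_iff_right (by norm_num : 1 < 2)).1 h1
  exact Nat.le_of_mul_le_mul_right h2 (Nat.succ_pos n)

/-- **The band index is strictly increasing in the level** (`j_{2α} ≥ j_α + 1`), hence injective on
the high levels. [folklore] -/
theorem bandIndex_add_le {n F k k' : ℕ} (hkk' : k ≤ k')
    (h0 : 2 ^ (n + 1) * levelConst n F ≤ 2 ^ (k * (n + 1))) :
    bandIndex n F k + (k' - k) ≤ bandIndex n F k' := by
  have h := bandIndex_spec h0
  set J := bandIndex n F k with hJ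
  have hJk : J ≤ k := Nat.findGreatest_le k
  refine le_bandIndex (by omega) ?_
  calc 2 ^ ((J + (k' - k) + 1) * (n + 1)) * levelConst n F
      = 2 ^ ((k' - k) * (n + 1)) * (2 ^ ((J + 1) * (n + 1)) * levelConst n F) := by
        rw [← mul_assoc, ← pow_add]; ring_nf
    _ ≤ 2 ^ ((k' - k) * (n + 1)) * 2 ^ (k * (n + 1)) := Nat.mul_le_mul_left _ h
    _ = 2 ^ (k' * (n + 1)) := by
        rw [← pow_add, ← Nat.add_mul, Nat.sub_add_cancel hkk']

/-- **The covering step:** at a level `α = 2ᵏ` with `J + 2 ≤ k`,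
`{f* ≥ α} ⊆ ⋃_{j=1}^{J} {f*_{j,α} ≥ α/2^{j+1}} ∪ {f*_α ≥ α/2^{J+1}}`, because
`f* ≤ f*_{0,α} + ∑_j f*_{j,α} + f*_α`, `f*_{0,α} < α/2` and
`∑_{j=1}^{J} α/2^{j+1} + α/2^{J+1} = α/2` (the printed "and hence
`|{f* ≥ α}| ≤ |{f*_α ≥ K}| + ∑_j |{f*_{j,α} ≥ α/2^{j+1}}|`").
[cite: EllenbergOberlinTao2010KakeyaMaximal, Theorem 2.1 (proof)] -/
theorem card_level_le (f : (Fin (n + 1) → K) → ℕ) {k J : ℕ} (hJk : J + 2 ≤ k) :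
    (univ.filter fun b' : Fin n → K => 2 ^ k ≤ maxLineSum f b').card ≤
      ∑ j ∈ Finset.Icc 1 J,
          (univ.filter fun b' : Fin n → K =>
            2 ^ (k - 1 - j) ≤ maxLineSum (bandPart f k j) b').card +
        (univ.filter fun b' : Fin n → K =>
          2 ^ (k - 1 - J) ≤ maxLineSum (topPart f k J) b').card := by
  classical
  set SB : ℕ → Finset (Fin n → K) := fun j =>
    univ.filter fun b' : Fin n → K => 2 ^ (k - 1 - j) ≤ maxLineSum (bandPart f k j) b' with hSB
  set ST := univ.filter fun b' : Fin n → K => 2 ^ (k - 1 - J) ≤ maxLineSum (topPart f k J) b'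
    with hST
  have hsub : (univ.filter fun b' : Fin n → K => 2 ^ k ≤ maxLineSum f b') ⊆
      (Finset.Icc 1 J).biUnion SB ∪ ST := by
    intro b' hb'
    rw [mem_filter] at hb'
    by_contra hnot
    rw [mem_union, mem_biUnion, not_or, not_exists] at hnot
    have hband : ∀ j ∈ Finset.Icc 1 J, maxLineSum (bandPart f k j) b' ≤ 2 ^ (k - 1 - j) - 1 := by
      intro j hj
      have h := hnot.1 j
      rw [not_and, hSB, mem_filter] at h
      have := h hj
      push Not at this
      exact Nat.le_sub_one_of_lt (this (mem_univ _))
    have htop : maxLineSum (topPart f k J) b' ≤ 2 ^ (k - 1 - J) - 1 := by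
      have h := hnot.2
      rw [hST, mem_filter, not_and] at h
      exact Nat.le_sub_one_of_lt (not_le.1 (h (mem_univ _)))
    -- `f* ≤ f_0* + ∑ f_j* + f_top*`
    have hdec : maxLineSum f b' ≤ maxLineSum (lowPart f k) b' +
        ∑ j ∈ Finset.Icc 1 J, maxLineSum (bandPart f k j) b' + maxLineSum (topPart f k J) b' := by
      have h1 : maxLineSum f b' ≤
          maxLineSum (lowPart f k + ∑ j ∈ Finset.Icc 1 J, bandPart f k j + topPart f k J) b' :=
        maxLineSum_mono (fun v => by
          simp only [Pi.add_apply, Finset.sum_apply]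
          exact le_lowPart_add_sum_bandPart_add_topPart f k J v) b'
      refine h1.trans ((maxLineSum_add_le _ _ b').trans ?_)
      refine Nat.add_le_add ((maxLineSum_add_le _ _ b').trans (Nat.add_le_add_left ?_ _)) le_rfl
      exact maxLineSum_sum_le _ _ b'
    have hlow := two_mul_maxLineSum_lowPart_le f k b'
    have hsum := sum_Icc_two_pow_add hJk
    have hbands : ∑ j ∈ Finset.Icc 1 J, maxLineSum (bandPart f k j) b' ≤
        ∑ j ∈ Finset.Icc 1 J, 2 ^ (k - 1 - j) :=
      sum_le_sum fun j hj => (hband j hj).trans (Nat.sub_le _ _)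
    have hJ1 : 1 ≤ 2 ^ (k - 1 - J) := Nat.one_le_two_pow
    have hk : 2 ^ k = 2 * 2 ^ (k - 1) := by
      rw [← pow_succ', Nat.sub_add_cancel (by omega)]
    omega
  calc (univ.filter fun b' : Fin n → K => 2 ^ k ≤ maxLineSum f b').card
      ≤ ((Finset.Icc 1 J).biUnion SB ∪ ST).card := card_le_card hsub
    _ ≤ ((Finset.Icc 1 J).biUnion SB).card + ST.card := card_union_le _ _
    _ ≤ ∑ j ∈ Finset.Icc 1 J, (SB j).card + ST.card :=
        Nat.add_le_add_right card_biUnion_le _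

/-- **The bound for one band** (Proposition 2.3 applied to `f_{j,α}` with `A = 2^{N(j−1)}α/2q`,
`λ = α/2^{j+1}`): if the band `j ≥ 1` is admissible at the level `α = 2ᵏ` then
`2ʲ · αᴺ · #{f*_{j,α} ≥ α/2^{j+1}} ≤ 2^{2n+2} · 4ⁿ(4N)ᴺ · qⁿ · ‖f_{j,α}‖ᴺ_N`.
[cite: EllenbergOberlinTao2010KakeyaMaximal, Theorem 2.1 (proof: the bound for
|{f*_{j,α} ≥ α/2^{j+1}}|)] -/
theorem band_level_bound (hn : 1 ≤ n) (f : (Fin (n + 1) → K) → ℕ) {k j : ℕ} (hj : 1 ≤ j)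
    (hadm : 2 ^ ((j + 1) * (n + 1)) * levelConst n (∑ v : Fin (n + 1) → K, f v ^ (n + 1)) ≤
      2 ^ (k * (n + 1))) :
    2 ^ j * (2 ^ (k * (n + 1)) *
      (univ.filter fun b' : Fin n → K => 2 ^ (k - 1 - j) ≤ maxLineSum (bandPart f k j) b').card) ≤
      2 ^ (2 * n + 2) * (4 ^ n * (4 * (n + 1)) ^ (n + 1)) * Fintype.card K ^ n *
        ∑ v : Fin (n + 1) → K, bandPart f k j v ^ (n + 1) := by
  classical
  set q := Fintype.card K with hq
  set F := ∑ v : Fin (n + 1) → K, f v ^ (n + 1) with hF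
  set g := bandPart f k j with hg
  set G := ∑ v : Fin (n + 1) → K, g v ^ (n + 1) with hG
  set X := (univ.filter fun b' : Fin n → K => 2 ^ (k - 1 - j) ≤ maxLineSum g b').card with hX
  have hqpos : 0 < q := Fintype.card_pos
  -- the degenerate case `f ≡ 0`
  rcases Nat.eq_zero_or_pos F with hF0 | hFpos
  · have hf0 : ∀ v, f v = 0 := fun v =>
      (pow_eq_zero_iff (Nat.succ_ne_zero n)).1 ((sum_eq_zero_iff.1 hF0) v (mem_univ v))
    have hX0 : X = 0 := by
      rw [hX, card_eq_zero, filter_eq_empty_iff]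
      intro b' _ hle
      obtain ⟨a₀, ha₀⟩ := (le_maxLineSum_iff g b' _).1 hle
      rw [lineSum_eq, sum_eq_zero (fun t _ => by
        rw [hg]; exact le_antisymm ((trunc_le _ f _).trans (hf0 _).le) (Nat.zero_le _))] at ha₀
      have : 1 ≤ 2 ^ (k - 1 - j) := Nat.one_le_two_pow
      omega
    rw [hX0, mul_zero, mul_zero]
    exact Nat.zero_le _
  -- `j + 3 ≤ k`; write `j = i + 1`, `k = e + i + 2`
  have hjk : j + 3 ≤ k := by
    have hD : 2 ^ (2 * (n + 1)) ≤ levelConst n F := by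
      rw [levelConst, pow_mul, show (2 : ℕ) ^ 2 = 4 from by norm_num, mul_assoc]
      exact Nat.le_mul_of_pos_right _ (Nat.mul_pos (by positivity) hFpos)
    have h1 : 2 ^ ((j + 3) * (n + 1)) ≤ 2 ^ (k * (n + 1)) :=
      calc 2 ^ ((j + 3) * (n + 1)) = 2 ^ ((j + 1) * (n + 1)) * 2 ^ (2 * (n + 1)) := by
            rw [← pow_add]; ring_nf
        _ ≤ 2 ^ ((j + 1) * (n + 1)) * levelConst n F := Nat.mul_le_mul_left _ hD
        _ ≤ 2 ^ (k * (n + 1)) := hadm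
    have h2 := (Nat.pow_le_pow_iff_right (by norm_num : 1 < 2)).1 h1
    exact Nat.le_of_mul_le_mul_right h2 (Nat.succ_pos n)
  obtain ⟨i, rfl⟩ : ∃ i, j = i + 1 := ⟨j - 1, by omega⟩
  obtain ⟨e, rfl⟩ : ∃ e, k = e + i + 2 := ⟨k - i - 2, by omega⟩
  have he : e + i + 2 - 1 - (i + 1) = e := by omega
  rw [he] at hX
  -- the parameters of Proposition 2.3: `a = ⌈2^{Ni} 2^k / 2q⌉`, `λ = 2^e`
  set x := 2 ^ ((n + 1) * i) * 2 ^ (e + i + 2) with hx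
  have hx0 : 0 < x := by rw [hx]; positivity
  set a := ceilDiv x (2 * q) with ha
  have h2q : 0 < 2 * q := by omega
  have ha1 : 1 ≤ a := one_le_ceilDiv h2q hx0
  have hxa : x ≤ 2 * q * a := le_mul_ceilDiv x h2q
  have hga : ∀ v, g v = 0 ∨ a ≤ g v := by
    intro v
    rcases trunc_eq_zero_or (fun m => 2 ^ ((n + 1) * i) * 2 ^ (e + i + 2) ≤ 2 * Fintype.card K * m ∧
        2 * Fintype.card K * m < 2 ^ ((n + 1) * i) * 2 ^ (e + i + 2) * 2 ^ (n + 1)) f v with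
      h0 | ⟨h1, hP⟩
    · exact Or.inl (by rw [hg, bandPart, Nat.add_sub_cancel]; exact h0)
    · right
      rw [hg, bandPart, Nat.add_sub_cancel, h1]
      exact ceilDiv_le_of_le_mul h2q (by rw [← hq] at hP; exact hP.1)
  have hlamq : 2 ^ e ≤ a * q := by
    have h1 : 2 * 2 ^ e ≤ x := by
      rw [hx, ← pow_succ', ← pow_add]
      exact Nat.pow_le_pow_right (by norm_num) (by omega)
    nlinarith
  have hGF : G ≤ F := sum_trunc_pow_le _ f _
  have hlam : 4 ^ (n + 1) * (4 * (n + 1)) ^ (n + 1) * G ≤ (2 ^ e) ^ (n + 1) := by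
    -- `2^{(i+2)N} · 4^N A G ≤ 2^{(i+2)N} 4^N A F ≤ 2^{kN} = 2^{(i+2)N} (2^e)^N`
    have h1 : 2 ^ ((i + 1 + 1) * (n + 1)) * (4 ^ (n + 1) * (4 * (n + 1)) ^ (n + 1) * G) ≤
        2 ^ ((i + 1 + 1) * (n + 1)) * (2 ^ e) ^ (n + 1) :=
      calc 2 ^ ((i + 1 + 1) * (n + 1)) * (4 ^ (n + 1) * (4 * (n + 1)) ^ (n + 1) * G)
          ≤ 2 ^ ((i + 1 + 1) * (n + 1)) * levelConst n F := by
            rw [levelConst]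
            exact Nat.mul_le_mul_left _ (Nat.mul_le_mul_left _ hGF)
        _ ≤ 2 ^ ((e + i + 2) * (n + 1)) := hadm
        _ = 2 ^ ((i + 1 + 1) * (n + 1)) * (2 ^ e) ^ (n + 1) := by
            rw [← pow_mul, ← pow_add]; ring_nf
    exact Nat.le_of_mul_le_mul_left h1 (by positivity)
  -- Proposition 2.3
  have hD2 := card_filter_mul_mul_pow_le hn g ha1 hga hlamq hlam
  rw [← hX] at hD2
  -- unwind: `2^{Ni} · [2^{i+1} 2^{kN} X] ≤ 2^{Ni} · [2^{2n+2} C qⁿ G]`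
  have hpos : 0 < 2 ^ ((n + 1) * i) := by positivity
  refine Nat.le_of_mul_le_mul_left ?_ hpos
  calc 2 ^ ((n + 1) * i) * (2 ^ (i + 1) * (2 ^ ((e + i + 2) * (n + 1)) * X))
      = 2 ^ (i + 1) * 2 ^ ((i + 2) * n) * (X * (2 ^ e) ^ n) * x := by
        rw [hx]; ring
    _ ≤ 2 ^ (i + 1) * 2 ^ ((i + 2) * n) * (X * (2 ^ e) ^ n) * (2 * q * a) :=
        Nat.mul_le_mul_left _ hxa
    _ = 2 * q * 2 ^ (i + 1) * 2 ^ ((i + 2) * n) * (X * a * (2 ^ e) ^ n) := by ring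
    _ ≤ 2 * q * 2 ^ (i + 1) * 2 ^ ((i + 2) * n) *
          (4 ^ n * (4 * (n + 1)) ^ (n + 1) * Fintype.card K ^ (n - 1) * G) :=
        Nat.mul_le_mul_left _ hD2
    _ = 2 ^ ((n + 1) * i) * (2 ^ (2 * n + 2) * (4 ^ n * (4 * (n + 1)) ^ (n + 1)) * q ^ n * G) := by
        obtain ⟨m, rfl⟩ : ∃ m, n = m + 1 := ⟨n - 1, by omega⟩
        rw [hq, Nat.add_sub_cancel]
        ring

/-- **The bound for the top part** (Proposition 2.3 applied to `f_α` with `λ = K`): at a high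
level `α = 2ᵏ` with band index `J`,
`2ᴶ · αᴺ · #{f*_α ≥ α/2^{J+1}} ≤ 2^{n+1} · 4ⁿ(4N)ᴺ · qⁿ · ‖f‖ᴺ_N` (the printed
`|{f*_α ≥ K}| ≪ 100^{−n j_α} |F|^{n−1}`). [cite: EllenbergOberlinTao2010KakeyaMaximal, Theorem 2.1
(proof: the bound for |{f*_α ≥ K}|)] -/
theorem top_level_bound (hn : 1 ≤ n) (f : (Fin (n + 1) → K) → ℕ) {k : ℕ}
    (hF : 1 ≤ ∑ v : Fin (n + 1) → K, f v ^ (n + 1))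
    (h0 : 2 ^ (n + 1) * levelConst n (∑ v : Fin (n + 1) → K, f v ^ (n + 1)) ≤ 2 ^ (k * (n + 1))) :
    2 ^ (bandIndex n (∑ v : Fin (n + 1) → K, f v ^ (n + 1)) k) * (2 ^ (k * (n + 1)) *
      (univ.filter fun b' : Fin n → K =>
        2 ^ (k - 1 - bandIndex n (∑ v : Fin (n + 1) → K, f v ^ (n + 1)) k) ≤
          maxLineSum (topPart f k (bandIndex n (∑ v : Fin (n + 1) → K, f v ^ (n + 1)) k))
            b').card) ≤
      2 ^ (n + 1) * (4 ^ n * (4 * (n + 1)) ^ (n + 1)) * Fintype.card K ^ n *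
        ∑ v : Fin (n + 1) → K, f v ^ (n + 1) := by
  classical
  set q := Fintype.card K with hq
  set F := ∑ v : Fin (n + 1) → K, f v ^ (n + 1) with hF'
  set J := bandIndex n F k with hJ
  set g := topPart f k J with hg
  set G := ∑ v : Fin (n + 1) → K, g v ^ (n + 1) with hG
  have hqpos : 0 < q := Fintype.card_pos
  have hJk : J + 3 ≤ k := bandIndex_add_three_le hF h0
  have hadm := bandIndex_spec h0
  rw [← hJ] at hadm
  obtain ⟨e, hek⟩ : ∃ e, k = e + J + 1 := ⟨k - J - 1, by omega⟩
  have he : k - 1 - J = e := by omega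
  rw [he]
  set X := (univ.filter fun b' : Fin n → K => 2 ^ e ≤ maxLineSum g b').card with hX
  set x := 2 ^ ((n + 1) * J) * 2 ^ k with hx
  have hx0 : 0 < x := by rw [hx]; positivity
  set a := ceilDiv x (2 * q) with ha
  have h2q : 0 < 2 * q := by omega
  have ha1 : 1 ≤ a := one_le_ceilDiv h2q hx0
  have hxa : x ≤ 2 * q * a := le_mul_ceilDiv x h2q
  have hga : ∀ v, g v = 0 ∨ a ≤ g v := by
    intro v
    rcases trunc_eq_zero_or (fun m => 2 ^ ((n + 1) * J) * 2 ^ k ≤ 2 * Fintype.card K * m) f v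
      with h0' | ⟨h1, hP⟩
    · exact Or.inl h0'
    · right
      rw [hg, topPart, h1]
      exact ceilDiv_le_of_le_mul h2q (by rw [← hq] at hP; exact hP)
  have hlamq : 2 ^ e ≤ a * q := by
    have h1 : 2 * 2 ^ e ≤ x := by
      rw [hx, ← pow_succ', ← pow_add]
      exact Nat.pow_le_pow_right (by norm_num) (by omega)
    nlinarith
  have hGF : G ≤ F := sum_trunc_pow_le _ f _
  have hlam : 4 ^ (n + 1) * (4 * (n + 1)) ^ (n + 1) * G ≤ (2 ^ e) ^ (n + 1) := by
    have h1 : 2 ^ ((J + 1) * (n + 1)) * (4 ^ (n + 1) * (4 * (n + 1)) ^ (n + 1) * G) ≤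
        2 ^ ((J + 1) * (n + 1)) * (2 ^ e) ^ (n + 1) :=
      calc 2 ^ ((J + 1) * (n + 1)) * (4 ^ (n + 1) * (4 * (n + 1)) ^ (n + 1) * G)
          ≤ 2 ^ ((J + 1) * (n + 1)) * levelConst n F := by
            rw [levelConst]
            exact Nat.mul_le_mul_left _ (Nat.mul_le_mul_left _ hGF)
        _ ≤ 2 ^ (k * (n + 1)) := hadm
        _ = 2 ^ ((J + 1) * (n + 1)) * (2 ^ e) ^ (n + 1) := by
            rw [hek, ← pow_mul, ← pow_add]; ring_nf
    exact Nat.le_of_mul_le_mul_left h1 (by positivity)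
  have hD2 := card_filter_mul_mul_pow_le hn g ha1 hga hlamq hlam
  rw [← hX] at hD2
  have hpos : 0 < 2 ^ ((n + 1) * J) := by positivity
  refine Nat.le_of_mul_le_mul_left ?_ hpos
  calc 2 ^ ((n + 1) * J) * (2 ^ J * (2 ^ (k * (n + 1)) * X))
      = 2 ^ J * 2 ^ ((J + 1) * n) * (X * (2 ^ e) ^ n) * x := by
        rw [hx, hek]; ring
    _ ≤ 2 ^ J * 2 ^ ((J + 1) * n) * (X * (2 ^ e) ^ n) * (2 * q * a) :=
        Nat.mul_le_mul_left _ hxa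
    _ = 2 * q * 2 ^ J * 2 ^ ((J + 1) * n) * (X * a * (2 ^ e) ^ n) := by ring
    _ ≤ 2 * q * 2 ^ J * 2 ^ ((J + 1) * n) *
          (4 ^ n * (4 * (n + 1)) ^ (n + 1) * Fintype.card K ^ (n - 1) * G) :=
        Nat.mul_le_mul_left _ hD2
    _ ≤ 2 * q * 2 ^ J * 2 ^ ((J + 1) * n) *
          (4 ^ n * (4 * (n + 1)) ^ (n + 1) * Fintype.card K ^ (n - 1) * F) :=
        Nat.mul_le_mul_left _ (Nat.mul_le_mul_left _ hGF)
    _ = 2 ^ ((n + 1) * J) * (2 ^ (n + 1) * (4 ^ n * (4 * (n + 1)) ^ (n + 1)) * q ^ n * F) := by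
        obtain ⟨m, rfl⟩ : ∃ m, n = m + 1 := ⟨n - 1, by omega⟩
        rw [hq, Nat.add_sub_cancel]
        ring

/-- A line sum is at most the total mass `∑_v f(v)` (the points `a + t(1, b')` are distinct).
[folklore] -/
theorem lineSum_le_sum (f : (Fin (n + 1) → K) → ℕ) (a : Fin (n + 1) → K) (b' : Fin n → K) :
    lineSum f a b' ≤ ∑ v : Fin (n + 1) → K, f v := by
  classical
  rw [lineSum_eq]
  have hinj : Function.Injective fun t : K => a + t • (Fin.cons 1 b' : Fin (n + 1) → K) := by
    intro t t' h
    have := congr_fun h 0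
    simpa using this
  calc ∑ t : K, f (a + t • Fin.cons 1 b')
      = ∑ v ∈ (univ : Finset K).image (fun t : K => a + t • (Fin.cons 1 b' : Fin (n + 1) → K)),
          f v := (sum_image fun t _ t' _ h => hinj h).symm
    _ ≤ ∑ v : Fin (n + 1) → K, f v :=
        sum_le_sum_of_subset_of_nonneg (subset_univ _) fun _ _ _ => Nat.zero_le _

/-- The maximal function is at most `‖f‖ᴺ_N` (a crude bound fixing the range of dyadic levels).
[folklore] -/
theorem maxLineSum_le_sum_pow (f : (Fin (n + 1) → K) → ℕ) (b' : Fin n → K) {N : ℕ} (hN : N ≠ 0) :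
    maxLineSum f b' ≤ ∑ v : Fin (n + 1) → K, f v ^ N := by
  obtain ⟨a, ha⟩ := exists_lineSum_eq_maxLineSum f b'
  rw [← ha]
  exact (lineSum_le_sum f a b').trans (sum_le_sum fun v _ => Nat.le_self_pow hN _)

omit [DecidableEq K] in
/-- **The layer-cake step:** `∑_{b'} f*(b')ᴺ ≤ 2ᴺ ∑_{k < L} 2^{kN} #{b' : f*(b') ≥ 2ᵏ}` whenever
`f* < 2ᴸ` (discrete form of eq. (2.2)). [cite: EllenbergOberlinTao2010KakeyaMaximal, Theorem 2.1
(proof, eq. (2.2))] -/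
theorem sum_pow_maxLineSum_le_sum_levels (f : (Fin (n + 1) → K) → ℕ) {N L : ℕ} (hN : N ≠ 0)
    (hL : ∀ b' : Fin n → K, maxLineSum f b' < 2 ^ L) :
    ∑ b' : Fin n → K, maxLineSum f b' ^ N ≤
      2 ^ N * ∑ k ∈ range L,
        2 ^ (k * N) * (univ.filter fun b' : Fin n → K => 2 ^ k ≤ maxLineSum f b').card := by
  classical
  calc ∑ b' : Fin n → K, maxLineSum f b' ^ N
      ≤ ∑ b' : Fin n → K, 2 ^ N * ∑ k ∈ (range L).filter (fun k => 2 ^ k ≤ maxLineSum f b'),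
          2 ^ (k * N) := sum_le_sum fun b' _ => pow_le_two_pow_mul_sum_filter _ hN (hL b')
    _ = 2 ^ N * ∑ k ∈ range L, ∑ b' : Fin n → K,
          (if 2 ^ k ≤ maxLineSum f b' then 2 ^ (k * N) else 0) := by
        rw [← mul_sum, Finset.sum_comm]
        congr 1
        exact sum_congr rfl fun b' _ => sum_filter _ _
    _ = 2 ^ N * ∑ k ∈ range L,
          2 ^ (k * N) * (univ.filter fun b' : Fin n → K => 2 ^ k ≤ maxLineSum f b').card := by
        congr 1
        refine sum_congr rfl fun k _ => ?_
        rw [card_eq_sum_ones, mul_sum, mul_one, sum_filter]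

omit [DecidableEq K] in
/-- **The low levels** (`αᴺ < 2ᴺ D`, the printed "region `α ≤ C₀`", handled by the crude bound
`|{f* ≥ α}| ≤ |F|^{n−1}`): their total contribution is `< 2ᴺ · 2ᴺ D · qⁿ`.
[cite: EllenbergOberlinTao2010KakeyaMaximal, Theorem 2.1 (proof: "The crude bound … allows one to
dispose of the region α ≤ C₀")] -/
theorem sum_low_levels_le (f : (Fin (n + 1) → K) → ℕ) {D : ℕ} (hD : 0 < D) (L : ℕ) :
    ∑ k ∈ (range L).filter (fun k => ¬ 2 ^ (n + 1) * D ≤ 2 ^ (k * (n + 1))),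
        2 ^ (k * (n + 1)) * (univ.filter fun b' : Fin n → K => 2 ^ k ≤ maxLineSum f b').card ≤
      2 ^ (n + 1) * (2 ^ (n + 1) * D) * Fintype.card K ^ n := by
  classical
  have hT : ∀ k, (univ.filter fun b' : Fin n → K => 2 ^ k ≤ maxLineSum f b').card ≤
      Fintype.card K ^ n := fun k => by
    have := card_le_univ (univ.filter fun b' : Fin n → K => 2 ^ k ≤ maxLineSum f b')
    rwa [Fintype.card_fun, Fintype.card_fin] at this
  have hfilt : (range L).filter (fun k => ¬ 2 ^ (n + 1) * D ≤ 2 ^ (k * (n + 1))) =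
      (range L).filter (fun k => 2 ^ (k * (n + 1)) < 2 ^ (n + 1) * D) :=
    filter_congr fun k _ => not_le
  rw [hfilt]
  calc ∑ k ∈ (range L).filter (fun k => 2 ^ (k * (n + 1)) < 2 ^ (n + 1) * D),
        2 ^ (k * (n + 1)) * (univ.filter fun b' : Fin n → K => 2 ^ k ≤ maxLineSum f b').card
      ≤ ∑ k ∈ (range L).filter (fun k => 2 ^ (k * (n + 1)) < 2 ^ (n + 1) * D),
        2 ^ (k * (n + 1)) * Fintype.card K ^ n := sum_le_sum fun k _ => Nat.mul_le_mul_left _ (hT k)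
    _ = (∑ k ∈ (range L).filter (fun k => 2 ^ (k * (n + 1)) < 2 ^ (n + 1) * D),
        2 ^ (k * (n + 1))) * Fintype.card K ^ n := (sum_mul _ _ _).symm
    _ ≤ 2 ^ (n + 1) * (2 ^ (n + 1) * D) * Fintype.card K ^ n :=
        Nat.mul_le_mul_right _ (sum_filter_two_pow_lt le_add_self _ (by positivity) _).le

omit [Field K] [DecidableEq K] in
/-- **Bounded overlap of the bands:** for each `j ≥ 1`, `∑_k ‖f_{j,2ᵏ}‖ᴺ_N ≤ N ‖f‖ᴺ_N` (each value
lies in the `j`-th band for at most `N` consecutive levels `k`).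
[cite: EllenbergOberlinTao2010KakeyaMaximal, Theorem 2.1 (proof: "interchange the α integration
and v summation")] -/
theorem sum_levels_bandPart_le (f : (Fin (n + 1) → K) → ℕ) (j L : ℕ) :
    ∑ k ∈ range L, ∑ v : Fin (n + 1) → K, bandPart f k j v ^ (n + 1) ≤
      (n + 1) * ∑ v : Fin (n + 1) → K, f v ^ (n + 1) := by
  classical
  rw [Finset.sum_comm, mul_sum]
  refine sum_le_sum fun v _ => ?_
  have hterm : ∀ k, bandPart f k j v ^ (n + 1) =
      if 2 ^ ((n + 1) * (j - 1)) * 2 ^ k ≤ 2 * Fintype.card K * f v ∧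
          2 * Fintype.card K * f v < 2 ^ ((n + 1) * (j - 1)) * 2 ^ k * 2 ^ (n + 1)
        then f v ^ (n + 1) else 0 := by
    intro k
    rw [bandPart, trunc_apply]
    split_ifs <;> simp
  simp_rw [hterm]
  rw [← sum_filter, sum_const, smul_eq_mul]
  exact Nat.mul_le_mul_right _ (card_filter_band_le (2 * Fintype.card K * f v) _ (n + 1) (range L))

/-- **The top parts sum to `O(1)`:** over the high levels, `∑_k 2^{−J(k)} ≤ 2`, because the band
index is injective there. [folklore] -/
theorem sum_high_half_pow_bandIndex_le (n F L : ℕ) :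
    ∑ k ∈ (range L).filter (fun k => 2 ^ (n + 1) * levelConst n F ≤ 2 ^ (k * (n + 1))),
      ((1 : ℝ) / 2) ^ bandIndex n F k ≤ 2 := by
  classical
  set H := (range L).filter (fun k => 2 ^ (n + 1) * levelConst n F ≤ 2 ^ (k * (n + 1))) with hH
  have hinj : ∀ k ∈ H, ∀ k' ∈ H, bandIndex n F k = bandIndex n F k' → k = k' := by
    intro k hk k' hk' h
    have hk0 := (mem_filter.1 hk).2
    have hk'0 := (mem_filter.1 hk').2
    rcases le_total k k' with hle | hle
    · have := bandIndex_add_le hle hk0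
      omega
    · have := bandIndex_add_le hle hk'0
      omega
  rw [← sum_image (g := bandIndex n F) (f := fun j => ((1 : ℝ) / 2) ^ j) hinj]
  exact sum_half_pow_le_two _

/-- **One high level, all pieces together** (in `ℝ`): for `αᴺ = 2^{kN} ≥ 2ᴺ D`,
`αᴺ |{f* ≥ α}| ≤ ∑_{j=1}^{J} 2^{2n+2} C qⁿ ‖f_{j,α}‖ᴺ_N / 2ʲ + 2^{n+1} C qⁿ ‖f‖ᴺ_N / 2ᴶ`
(`C = 4ⁿ (4N)ᴺ`, `J` the band index). [cite: EllenbergOberlinTao2010KakeyaMaximal, Theorem 2.1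
(proof: "Putting this all together")] -/
theorem high_level_bound (hn : 1 ≤ n) (f : (Fin (n + 1) → K) → ℕ) {k : ℕ}
    (hF : 1 ≤ ∑ v : Fin (n + 1) → K, f v ^ (n + 1))
    (h0 : 2 ^ (n + 1) * levelConst n (∑ v : Fin (n + 1) → K, f v ^ (n + 1)) ≤ 2 ^ (k * (n + 1))) :
    ((2 : ℝ) ^ (k * (n + 1)) *
        ((univ.filter fun b' : Fin n → K => 2 ^ k ≤ maxLineSum f b').card : ℕ)) ≤
      ∑ j ∈ Finset.Icc 1 (bandIndex n (∑ v : Fin (n + 1) → K, f v ^ (n + 1)) k),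
          ((2 ^ (2 * n + 2) * (4 ^ n * (4 * (n + 1)) ^ (n + 1)) * Fintype.card K ^ n *
            ∑ v : Fin (n + 1) → K, bandPart f k j v ^ (n + 1) : ℕ) : ℝ) / 2 ^ j +
        ((2 ^ (n + 1) * (4 ^ n * (4 * (n + 1)) ^ (n + 1)) * Fintype.card K ^ n *
            ∑ v : Fin (n + 1) → K, f v ^ (n + 1) : ℕ) : ℝ) /
          2 ^ bandIndex n (∑ v : Fin (n + 1) → K, f v ^ (n + 1)) k := by
  classical
  set F := ∑ v : Fin (n + 1) → K, f v ^ (n + 1) with hF'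
  set J := bandIndex n F k with hJ
  have hJk : J + 3 ≤ k := bandIndex_add_three_le hF h0
  have hadmJ := bandIndex_spec h0
  rw [← hJ] at hadmJ
  -- the covering step, multiplied by `2^{kN}` and cast to `ℝ`
  have hcov := card_level_le f (k := k) (J := J) (by omega)
  have hcovR : ((2 : ℝ) ^ (k * (n + 1)) *
      ((univ.filter fun b' : Fin n → K => 2 ^ k ≤ maxLineSum f b').card : ℕ)) ≤
      ∑ j ∈ Finset.Icc 1 J, (2 : ℝ) ^ (k * (n + 1)) *
          ((univ.filter fun b' : Fin n → K =>
            2 ^ (k - 1 - j) ≤ maxLineSum (bandPart f k j) b').card : ℕ) +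
        (2 : ℝ) ^ (k * (n + 1)) *
          ((univ.filter fun b' : Fin n → K =>
            2 ^ (k - 1 - J) ≤ maxLineSum (topPart f k J) b').card : ℕ) := by
    rw [← mul_sum, ← mul_add]
    refine mul_le_mul_of_nonneg_left ?_ (by positivity)
    exact_mod_cast hcov
  refine hcovR.trans (add_le_add (sum_le_sum fun j hj => ?_) ?_)
  · -- band `j`
    have hj1 : 1 ≤ j := (Finset.mem_Icc.1 hj).1
    have hjJ : j ≤ J := (Finset.mem_Icc.1 hj).2
    have hb := band_level_bound hn f hj1 (band_admissible_mono hjJ hadmJ) (k := k)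
    rw [le_div_iff₀ (by positivity), mul_comm]
    exact_mod_cast hb
  · -- the top part
    have ht := top_level_bound hn f hF h0
    rw [← hF', ← hJ] at ht
    rw [le_div_iff₀ (by positivity), mul_comm]
    exact_mod_cast ht

/-- **The high levels together:**
`∑_{k high} 2^{kN} |{f* ≥ 2ᵏ}| ≤ (2^{2n+3} C N + 2^{n+2} C) qⁿ ‖f‖ᴺ_N` (`C = 4ⁿ (4N)ᴺ`), by the
bounded overlap of the bands and the injectivity of the band index.
[cite: EllenbergOberlinTao2010KakeyaMaximal, Theorem 2.1 (proof, conclusion)] -/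
theorem sum_high_levels_le (hn : 1 ≤ n) (f : (Fin (n + 1) → K) → ℕ)
    (hF : 1 ≤ ∑ v : Fin (n + 1) → K, f v ^ (n + 1)) (L : ℕ) :
    ((∑ k ∈ (range L).filter (fun k => 2 ^ (n + 1) *
        levelConst n (∑ v : Fin (n + 1) → K, f v ^ (n + 1)) ≤ 2 ^ (k * (n + 1))),
        2 ^ (k * (n + 1)) * (univ.filter fun b' : Fin n → K => 2 ^ k ≤ maxLineSum f b').card : ℕ) :
          ℝ) ≤
      ((2 ^ (2 * n + 3) * (4 ^ n * (4 * (n + 1)) ^ (n + 1)) * (n + 1) +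
          2 ^ (n + 2) * (4 ^ n * (4 * (n + 1)) ^ (n + 1)) : ℕ) : ℝ) *
        ((Fintype.card K ^ n * ∑ v : Fin (n + 1) → K, f v ^ (n + 1) : ℕ) : ℝ) := by
  classical
  set H := (range L).filter (fun k => 2 ^ (n + 1) *
    levelConst n (∑ v : Fin (n + 1) → K, f v ^ (n + 1)) ≤ 2 ^ (k * (n + 1))) with hH
  -- real abbreviations
  set C : ℝ := ((4 ^ n * (4 * (n + 1)) ^ (n + 1) : ℕ) : ℝ) with hC
  set Q : ℝ := ((Fintype.card K ^ n : ℕ) : ℝ) with hQ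
  set FF : ℝ := ((∑ v : Fin (n + 1) → K, f v ^ (n + 1) : ℕ) : ℝ) with hFF
  set T : ℕ → ℝ := fun k =>
    (((univ.filter fun b' : Fin n → K => 2 ^ k ≤ maxLineSum f b').card : ℕ) : ℝ) with hT
  set G : ℕ → ℕ → ℝ := fun k j =>
    ((∑ v : Fin (n + 1) → K, bandPart f k j v ^ (n + 1) : ℕ) : ℝ) with hG
  set J : ℕ → ℕ := fun k => bandIndex n (∑ v : Fin (n + 1) → K, f v ^ (n + 1)) k with hJ
  have hC0 : 0 ≤ C := by positivity
  have hQ0 : 0 ≤ Q := by positivity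
  have hFF0 : 0 ≤ FF := by positivity
  -- per level, from `high_level_bound`
  have hlev : ∀ k ∈ H, (2 : ℝ) ^ (k * (n + 1)) * T k ≤
      ∑ j ∈ Finset.Icc 1 L, (2 : ℝ) ^ (2 * n + 2) * C * Q * G k j / 2 ^ j +
        (2 : ℝ) ^ (n + 1) * C * Q * FF * ((1 : ℝ) / 2) ^ J k := by
    intro k hk
    have hk' := mem_filter.1 hk
    have h := high_level_bound hn f hF hk'.2
    have h1 : ∀ j, (((2 ^ (2 * n + 2) * (4 ^ n * (4 * (n + 1)) ^ (n + 1)) * Fintype.card K ^ n *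
        ∑ v : Fin (n + 1) → K, bandPart f k j v ^ (n + 1) : ℕ) : ℝ)) =
        (2 : ℝ) ^ (2 * n + 2) * C * Q * G k j := fun j => by
      rw [hC, hQ, hG]; push_cast; ring
    have h2 : (((2 ^ (n + 1) * (4 ^ n * (4 * (n + 1)) ^ (n + 1)) * Fintype.card K ^ n *
        ∑ v : Fin (n + 1) → K, f v ^ (n + 1) : ℕ) : ℝ)) = (2 : ℝ) ^ (n + 1) * C * Q * FF := by
      rw [hC, hQ, hFF]; push_cast; ring
    simp_rw [h1, h2] at h
    refine h.trans (add_le_add ?_ (le_of_eq ?_))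
    · refine sum_le_sum_of_subset_of_nonneg (fun j hj => ?_) (fun _ _ _ => by positivity)
      rw [Finset.mem_Icc] at hj ⊢
      have : bandIndex n (∑ v : Fin (n + 1) → K, f v ^ (n + 1)) k ≤ k := Nat.findGreatest_le k
      exact ⟨hj.1, by have := mem_range.1 hk'.1; omega⟩
    · rw [div_eq_mul_inv, one_div, inv_pow]
  -- the left-hand side as a real sum
  have hLHS : ((∑ k ∈ H, 2 ^ (k * (n + 1)) *
      (univ.filter fun b' : Fin n → K => 2 ^ k ≤ maxLineSum f b').card : ℕ) : ℝ) =
      ∑ k ∈ H, (2 : ℝ) ^ (k * (n + 1)) * T k := by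
    rw [hT]; push_cast; rfl
  rw [hLHS]
  refine (sum_le_sum hlev).trans ?_
  rw [sum_add_distrib, Finset.sum_comm, ← mul_sum]
  -- the bands: bounded overlap and geometric decay
  have hbands : ∑ j ∈ Finset.Icc 1 L, ∑ k ∈ H, (2 : ℝ) ^ (2 * n + 2) * C * Q * G k j / 2 ^ j ≤
      (2 : ℝ) ^ (2 * n + 2) * C * Q * ((n + 1) * FF) * 2 := by
    have hGsum : ∀ j, ∑ k ∈ H, G k j ≤ (n + 1) * FF := by
      intro j
      have h1 := sum_levels_bandPart_le f j L
      have h2 : ∑ k ∈ H, ∑ v : Fin (n + 1) → K, bandPart f k j v ^ (n + 1) ≤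
          ∑ k ∈ range L, ∑ v : Fin (n + 1) → K, bandPart f k j v ^ (n + 1) :=
        sum_le_sum_of_subset_of_nonneg (filter_subset _ _) fun _ _ _ => Nat.zero_le _
      have h3 := h2.trans h1
      simp only [hG, hFF]
      exact_mod_cast h3
    calc ∑ j ∈ Finset.Icc 1 L, ∑ k ∈ H, (2 : ℝ) ^ (2 * n + 2) * C * Q * G k j / 2 ^ j
        = ∑ j ∈ Finset.Icc 1 L, ((2 : ℝ) ^ (2 * n + 2) * C * Q * ∑ k ∈ H, G k j) *
            ((1 : ℝ) / 2) ^ j := by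
          refine sum_congr rfl fun j _ => ?_
          rw [mul_sum, sum_mul]
          refine sum_congr rfl fun k _ => ?_
          rw [one_div, inv_pow, div_eq_mul_inv]
      _ ≤ ∑ j ∈ Finset.Icc 1 L, ((2 : ℝ) ^ (2 * n + 2) * C * Q * ((n + 1) * FF)) *
            ((1 : ℝ) / 2) ^ j := by
          refine sum_le_sum fun j _ => mul_le_mul_of_nonneg_right ?_ (by positivity)
          exact mul_le_mul_of_nonneg_left (hGsum j) (by positivity)
      _ = ((2 : ℝ) ^ (2 * n + 2) * C * Q * ((n + 1) * FF)) *
            ∑ j ∈ Finset.Icc 1 L, ((1 : ℝ) / 2) ^ j := (mul_sum _ _ _).symm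
      _ ≤ ((2 : ℝ) ^ (2 * n + 2) * C * Q * ((n + 1) * FF)) * 2 :=
          mul_le_mul_of_nonneg_left (sum_half_pow_le_two _) (by positivity)
  have htops : (2 : ℝ) ^ (n + 1) * C * Q * FF * ∑ k ∈ H, ((1 : ℝ) / 2) ^ J k ≤
      (2 : ℝ) ^ (n + 1) * C * Q * FF * 2 :=
    mul_le_mul_of_nonneg_left (sum_high_half_pow_bandIndex_le n _ L) (by positivity)
  refine (add_le_add hbands htops).trans (le_of_eq ?_)
  rw [hC, hQ, hFF]
  push_cast
  ring

/-- The constant `C_n^{max} = 2^{5n+7} (n+1) (4(n+1))^{n+1}` of the maximal inequality.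
[folklore] -/
def maxConst (n : ℕ) : ℕ := 2 ^ (5 * n + 7) * (n + 1) * (4 * (n + 1)) ^ (n + 1)

/-- Unfolding lemma for `maxConst`. [folklore] -/
theorem maxConst_eq (n : ℕ) : maxConst n = 2 ^ (5 * n + 7) * (n + 1) * (4 * (n + 1)) ^ (n + 1) :=
  rfl

omit [Fintype K] [DecidableEq K] in
/-- The bookkeeping of the three contributions (low levels, bands, top parts). [folklore] -/
theorem maxConst_bound (n : ℕ) :
    2 ^ (n + 1) * (2 ^ (2 * n + 3) * (4 ^ n * (4 * (n + 1)) ^ (n + 1)) * (n + 1) +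
        2 ^ (n + 2) * (4 ^ n * (4 * (n + 1)) ^ (n + 1))) +
      2 ^ (n + 1) * (2 ^ (n + 1) * (2 ^ (n + 1) * (4 ^ (n + 1) * (4 * (n + 1)) ^ (n + 1)))) ≤
      maxConst n := by
  set A := (4 * (n + 1)) ^ (n + 1) with hA
  have h4 : (4 : ℕ) = 2 ^ 2 := by norm_num
  rw [maxConst_eq, ← hA, h4, ← pow_mul, ← pow_mul]
  have e1 : 2 ^ (n + 1) * (2 ^ (2 * n + 3) * (2 ^ (2 * n) * A) * (n + 1) +
      2 ^ (n + 2) * (2 ^ (2 * n) * A)) + 2 ^ (n + 1) * (2 ^ (n + 1) * (2 ^ (n + 1) *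
      (2 ^ (2 * (n + 1)) * A))) =
      2 ^ (5 * n + 4) * (n + 1) * A + 2 ^ (4 * n + 3) * A + 2 ^ (5 * n + 5) * A := by ring
  rw [e1]
  have h1 : 2 ^ (4 * n + 3) * A ≤ 2 ^ (5 * n + 4) * (n + 1) * A :=
    Nat.mul_le_mul_right _ ((Nat.pow_le_pow_right (by norm_num) (by omega)).trans
      (Nat.le_mul_of_pos_right _ (Nat.succ_pos n)))
  have h2 : 2 ^ (5 * n + 5) * A ≤ 2 ^ (5 * n + 5) * (n + 1) * A :=
    Nat.mul_le_mul_right _ (Nat.le_mul_of_pos_right _ (Nat.succ_pos n))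
  have h3 : 2 ^ (5 * n + 7) = 2 ^ (5 * n + 4) * 8 := by ring
  have h5 : 2 ^ (5 * n + 5) = 2 ^ (5 * n + 4) * 2 := by ring
  rw [h3, h5]
  rw [h5] at h2
  calc 2 ^ (5 * n + 4) * (n + 1) * A + 2 ^ (4 * n + 3) * A + 2 ^ (5 * n + 4) * 2 * A
      ≤ 2 ^ (5 * n + 4) * (n + 1) * A + 2 ^ (5 * n + 4) * (n + 1) * A +
          2 ^ (5 * n + 4) * 2 * (n + 1) * A := Nat.add_le_add (Nat.add_le_add le_rfl h1) h2
    _ = 2 ^ (5 * n + 4) * 4 * ((n + 1) * A) := by ring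
    _ ≤ 2 ^ (5 * n + 4) * 8 * ((n + 1) * A) :=
        Nat.mul_le_mul_right _ (Nat.mul_le_mul_left _ (by norm_num))
    _ = 2 ^ (5 * n + 4) * 8 * (n + 1) * A := by ring

/-- **EOT Theorem 1.3 — the Kakeya maximal conjecture for `𝔽_qⁿ⁺¹` (strong type `(N, N)`,
`N = n + 1 ≥ 2`), for non-negative integer-valued `f` and the `qⁿ` non-horizontal directions
`(1, b')`, with an explicit constant:**
`∑_{b' ∈ 𝔽_qⁿ} (sup_{ℓ ∥ (1,b')} ∑_{x ∈ ℓ} f(x))ᴺ ≤ 2^{5n+7} N (4N)ᴺ · qⁿ · ∑_v f(v)ᴺ`, i.e.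
`‖f*‖_{ℓᴺ} ≤ C_n q^{(N−1)/N} ‖f‖_{ℓᴺ}` — inequality (1.1).  Proof as printed ("Proof of Theorem 2.1
assuming Proposition 2.3", §2): dyadic layer cake, the crude bound below `αᴺ < 2ᴺ D`, and above it
the decomposition `f = f_{0,α} + ∑_{j ≤ J} f_{j,α} + f_α` with the distributional estimate for each
piece, bounded overlap of the bands and geometric decay in `j`; deviations: dyadic `α`, band ratio
`2ᴺ` instead of `100ⁿ`, all sums finite, constants explicit, not optimized.
[cite: EllenbergOberlinTao2010KakeyaMaximal, Theorem 1.3 / eq. (1.1) (via Theorem 2.1, §2)] -/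
theorem sum_pow_maxLineSum_le (hn : 1 ≤ n) (f : (Fin (n + 1) → K) → ℕ) :
    ∑ b' : Fin n → K, maxLineSum f b' ^ (n + 1) ≤
      maxConst n * Fintype.card K ^ n * ∑ v : Fin (n + 1) → K, f v ^ (n + 1) := by
  classical
  set F := ∑ v : Fin (n + 1) → K, f v ^ (n + 1) with hF
  set q := Fintype.card K with hq
  -- the degenerate case `f ≡ 0`
  rcases Nat.eq_zero_or_pos F with hF0 | hFpos
  · have hmax : ∀ b', maxLineSum f b' = 0 := fun b' => by
      have := maxLineSum_le_sum_pow f b' (Nat.succ_ne_zero n)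
      rw [← hF, hF0] at this
      omega
    rw [sum_eq_zero fun b' _ => by rw [hmax, zero_pow (Nat.succ_ne_zero n)]]
    exact Nat.zero_le _
  -- the range of levels: `f* ≤ F < 2^F`
  have hL : ∀ b' : Fin n → K, maxLineSum f b' < 2 ^ F := fun b' =>
    lt_of_le_of_lt (maxLineSum_le_sum_pow f b' (Nat.succ_ne_zero n)) Nat.lt_two_pow_self
  have hLC := sum_pow_maxLineSum_le_sum_levels f (Nat.succ_ne_zero n) hL
  have hDpos : 0 < levelConst n F := by rw [levelConst]; positivity
  have hsplit := (sum_filter_add_sum_filter_not (range F)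
    (fun k => 2 ^ (n + 1) * levelConst n F ≤ 2 ^ (k * (n + 1)))
    fun k => 2 ^ (k * (n + 1)) *
      (univ.filter fun b' : Fin n → K => 2 ^ k ≤ maxLineSum f b').card).symm
  have hlow := sum_low_levels_le f hDpos F
  have hhigh := sum_high_levels_le hn f hFpos F
  rw [← hF] at hhigh
  have hhighN : ∑ k ∈ (range F).filter
      (fun k => 2 ^ (n + 1) * levelConst n F ≤ 2 ^ (k * (n + 1))),
      2 ^ (k * (n + 1)) * (univ.filter fun b' : Fin n → K => 2 ^ k ≤ maxLineSum f b').card ≤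
      (2 ^ (2 * n + 3) * (4 ^ n * (4 * (n + 1)) ^ (n + 1)) * (n + 1) +
          2 ^ (n + 2) * (4 ^ n * (4 * (n + 1)) ^ (n + 1))) * (q ^ n * F) := by
    exact_mod_cast hhigh
  have hconst := maxConst_bound n
  calc ∑ b' : Fin n → K, maxLineSum f b' ^ (n + 1)
      ≤ 2 ^ (n + 1) * ∑ k ∈ range F, 2 ^ (k * (n + 1)) *
          (univ.filter fun b' : Fin n → K => 2 ^ k ≤ maxLineSum f b').card := hLC
    _ = 2 ^ (n + 1) * (∑ k ∈ (range F).filter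
          (fun k => 2 ^ (n + 1) * levelConst n F ≤ 2 ^ (k * (n + 1))),
          2 ^ (k * (n + 1)) * (univ.filter fun b' : Fin n → K => 2 ^ k ≤ maxLineSum f b').card +
        ∑ k ∈ (range F).filter
          (fun k => ¬ 2 ^ (n + 1) * levelConst n F ≤ 2 ^ (k * (n + 1))),
          2 ^ (k * (n + 1)) *
            (univ.filter fun b' : Fin n → K => 2 ^ k ≤ maxLineSum f b').card) := by
        rw [hsplit]
    _ ≤ 2 ^ (n + 1) * ((2 ^ (2 * n + 3) * (4 ^ n * (4 * (n + 1)) ^ (n + 1)) * (n + 1) +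
          2 ^ (n + 2) * (4 ^ n * (4 * (n + 1)) ^ (n + 1))) * (q ^ n * F) +
          2 ^ (n + 1) * (2 ^ (n + 1) * levelConst n F) * q ^ n) :=
        Nat.mul_le_mul_left _ (Nat.add_le_add hhighN hlow)
    _ = (2 ^ (n + 1) * (2 ^ (2 * n + 3) * (4 ^ n * (4 * (n + 1)) ^ (n + 1)) * (n + 1) +
          2 ^ (n + 2) * (4 ^ n * (4 * (n + 1)) ^ (n + 1))) +
          2 ^ (n + 1) * (2 ^ (n + 1) * (2 ^ (n + 1) * (4 ^ (n + 1) * (4 * (n + 1)) ^ (n + 1))))) *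
          (q ^ n * F) := by
        rw [levelConst]
        ring
    _ ≤ maxConst n * (q ^ n * F) := Nat.mul_le_mul_right _ hconst
    _ = maxConst n * q ^ n * F := (mul_assoc _ _ _).symm

end StrongType

/-! ### Theorem 1.3 for real-valued functions -/

section RealValued

variable {n : ℕ} [Fintype K] [DecidableEq K]

open Filter Topology

/-- The inner sum of (1.1) for a real-valued `f`: `∑_{x ∈ ℓ} |f(x)|` along the line through `a`
with slope `b'`. [cite: EllenbergOberlinTao2010KakeyaMaximal, Theorem 1.3, eq. (1.1)] -/
def lineSumR (f : (Fin (n + 1) → K) → ℝ) (a : Fin (n + 1) → K) (b' : Fin n → K) : ℝ :=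
  ∑ t : K, |f (a + t • Fin.cons 1 b')|

omit [DecidableEq K] in
/-- Unfolding lemma for `lineSumR`. [folklore] -/
theorem lineSumR_eq (f : (Fin (n + 1) → K) → ℝ) (a : Fin (n + 1) → K) (b' : Fin n → K) :
    lineSumR f a b' = ∑ t : K, |f (a + t • Fin.cons 1 b')| :=
  rfl

/-- **The Kakeya maximal function of a real-valued `f`:**
`f*(b') = sup_{ℓ ∥ (1,b')} ∑_{x ∈ ℓ} |f(x)|` (the left-hand side of (1.1) at the direction
`(1 : b')`).
[cite: EllenbergOberlinTao2010KakeyaMaximal, Theorem 1.3, eq. (1.1)] -/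
def maxLineSumR (f : (Fin (n + 1) → K) → ℝ) (b' : Fin n → K) : ℝ :=
  (univ : Finset (Fin (n + 1) → K)).sup' univ_nonempty fun a => lineSumR f a b'

omit [DecidableEq K] in
/-- The real maximal function is attained. [folklore] -/
theorem exists_lineSumR_eq_maxLineSumR (f : (Fin (n + 1) → K) → ℝ) (b' : Fin n → K) :
    ∃ a : Fin (n + 1) → K, lineSumR f a b' = maxLineSumR f b' := by
  obtain ⟨a, -, ha⟩ := Finset.exists_mem_eq_sup' (univ_nonempty (α := Fin (n + 1) → K))
    fun a => lineSumR f a b'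
  exact ⟨a, ha.symm⟩

omit [DecidableEq K] in
/-- Every real line sum is at most the maximal function. [folklore] -/
theorem lineSumR_le_maxLineSumR (f : (Fin (n + 1) → K) → ℝ) (a : Fin (n + 1) → K)
    (b' : Fin n → K) : lineSumR f a b' ≤ maxLineSumR f b' :=
  Finset.le_sup' (f := fun a => lineSumR f a b') (mem_univ a)

omit [DecidableEq K] in
/-- The real maximal function is non-negative. [folklore] -/
theorem maxLineSumR_nonneg (f : (Fin (n + 1) → K) → ℝ) (b' : Fin n → K) :
    0 ≤ maxLineSumR f b' := by
  obtain ⟨a, ha⟩ := exists_lineSumR_eq_maxLineSumR f b'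
  rw [← ha, lineSumR_eq]
  exact sum_nonneg fun t _ => abs_nonneg _

omit [DecidableEq K] in
/-- **Discretization:** if `|f| ≤ ε g + ε` pointwise (`g` integer-valued, e.g. `g = ⌊|f|/ε⌋`), then
`f*(b') ≤ ε g*(b') + q ε`. [folklore] -/
theorem maxLineSumR_le_of_pointwise (f : (Fin (n + 1) → K) → ℝ) (g : (Fin (n + 1) → K) → ℕ)
    {ε : ℝ} (hε : 0 ≤ ε) (hg : ∀ v, |f v| ≤ ε * (g v : ℝ) + ε) (b' : Fin n → K) :
    maxLineSumR f b' ≤ ε * maxLineSum g b' + Fintype.card K * ε := by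
  obtain ⟨a, ha⟩ := exists_lineSumR_eq_maxLineSumR f b'
  rw [← ha]
  have h2 := Finset.sum_le_sum fun t (_ : t ∈ (univ : Finset K)) =>
    hg (a + t • (Fin.cons 1 b' : Fin (n + 1) → K))
  rw [sum_add_distrib, sum_const, card_univ, nsmul_eq_mul, ← mul_sum] at h2
  have h3 : lineSumR f a b' ≤ ε * (lineSum g a b' : ℝ) + Fintype.card K * ε := by
    rw [lineSumR_eq, lineSum_eq, Nat.cast_sum]
    exact h2
  have h4 : (lineSum g a b' : ℝ) ≤ (maxLineSum g b' : ℝ) := by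
    exact_mod_cast lineSum_le_maxLineSum g a b'
  exact h3.trans (add_le_add (mul_le_mul_of_nonneg_left h4 hε) le_rfl)

omit [Field K] [Fintype K] [DecidableEq K] in
/-- `|f| ≤ ε ⌊|f|/ε⌋ + ε`. [folklore] -/
theorem abs_le_mul_floor_add (f : (Fin (n + 1) → K) → ℝ) {ε : ℝ} (hε : 0 < ε)
    (v : Fin (n + 1) → K) : |f v| ≤ ε * ((fun w => ⌊|f w| / ε⌋₊) v : ℝ) + ε := by
  have h0 := (Nat.lt_floor_add_one (|f v| / ε)).le
  rw [div_le_iff₀ hε] at h0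
  simp only
  linarith

omit [Field K] [DecidableEq K] in
/-- The discretization loses nothing in `ℓᴺ`: `∑_v (ε ⌊|f(v)|/ε⌋)ᴺ ≤ ∑_v |f(v)|ᴺ`. [folklore] -/
theorem sum_pow_floor_le (f : (Fin (n + 1) → K) → ℝ) {ε : ℝ} (hε : 0 < ε) (N : ℕ) :
    ε ^ N * ∑ v : Fin (n + 1) → K, ((⌊|f v| / ε⌋₊ ^ N : ℕ) : ℝ) ≤
      ∑ v : Fin (n + 1) → K, |f v| ^ N := by
  rw [mul_sum]
  refine sum_le_sum fun v _ => ?_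
  rw [Nat.cast_pow, ← mul_pow]
  refine pow_le_pow_left₀ (by positivity) ?_ _
  have := Nat.floor_le (div_nonneg (abs_nonneg (f v)) hε.le)
  rwa [le_div_iff₀ hε, mul_comm] at this

/-- **EOT Theorem 1.3 (Kakeya maximal conjecture over `𝔽_q`) for real-valued functions**, in the
chart of the `qⁿ` non-horizontal directions `(1, b')` of `𝔽_qⁿ⁺¹` (`n ≥ 1`), with an explicit
constant: for every `f : 𝔽_qⁿ⁺¹ → ℝ`,
`∑_{b'} (sup_{ℓ ∥ (1,b')} ∑_{x ∈ ℓ} |f(x)|)ⁿ⁺¹ ≤ 2^{5n+7} (n+1) (4(n+1))ⁿ⁺¹ · qⁿ · ∑_x |f(x)|ⁿ⁺¹`,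
i.e. `‖f*‖_{ℓᴺ} ≤ C_n |F|^{(N−1)/N} ‖f‖_{ℓᴺ(Fᴺ)}`, `N = n + 1` — inequality (1.1), from the
integer-valued case `sum_pow_maxLineSum_le` by the discretization `⌊|f|/ε⌋`, `ε → 0`.
[cite: EllenbergOberlinTao2010KakeyaMaximal, Theorem 1.3, eq. (1.1)] -/
theorem kakeya_maximal_inequality (hn : 1 ≤ n) (f : (Fin (n + 1) → K) → ℝ) :
    ∑ b' : Fin n → K, maxLineSumR f b' ^ (n + 1) ≤
      (maxConst n : ℝ) * (Fintype.card K : ℝ) ^ n * ∑ v : Fin (n + 1) → K, |f v| ^ (n + 1) := by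
  classical
  set R := (maxConst n : ℝ) * (Fintype.card K : ℝ) ^ n * ∑ v : Fin (n + 1) → K, |f v| ^ (n + 1)
    with hR
  -- the truncated sums are bounded by `R`
  set φ : ℝ → ℝ := fun ε =>
    ∑ b' : Fin n → K, (max (maxLineSumR f b' - Fintype.card K * ε) 0) ^ (n + 1) with hφ
  have hbound : ∀ ε : ℝ, 0 < ε → φ ε ≤ R := by
    intro ε hε
    set h : (Fin (n + 1) → K) → ℕ := fun v => ⌊|f v| / ε⌋₊ with hh
    have hN := sum_pow_maxLineSum_le hn h
    have hNR : ((∑ b' : Fin n → K, maxLineSum h b' ^ (n + 1) : ℕ) : ℝ) ≤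
        ((maxConst n * Fintype.card K ^ n * ∑ v : Fin (n + 1) → K, h v ^ (n + 1) : ℕ) : ℝ) := by
      exact_mod_cast hN
    have h1 : ∀ b', max (maxLineSumR f b' - Fintype.card K * ε) 0 ≤ ε * (maxLineSum h b' : ℝ) := by
      intro b'
      have hb := maxLineSumR_le_of_pointwise f h hε.le (abs_le_mul_floor_add f hε) b'
      exact max_le (by linarith) (by positivity)
    calc φ ε ≤ ∑ b' : Fin n → K, (ε * (maxLineSum h b' : ℝ)) ^ (n + 1) :=
          sum_le_sum fun b' _ => pow_le_pow_left₀ (le_max_right _ _) (h1 b') _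
      _ = ε ^ (n + 1) * ((∑ b' : Fin n → K, maxLineSum h b' ^ (n + 1) : ℕ) : ℝ) := by
          rw [Nat.cast_sum, mul_sum]
          exact sum_congr rfl fun b' _ => by rw [mul_pow, Nat.cast_pow]
      _ ≤ ε ^ (n + 1) *
            ((maxConst n * Fintype.card K ^ n * ∑ v : Fin (n + 1) → K, h v ^ (n + 1) : ℕ) : ℝ) :=
          mul_le_mul_of_nonneg_left hNR (by positivity)
      _ = (maxConst n : ℝ) * (Fintype.card K : ℝ) ^ n *
            (ε ^ (n + 1) * ∑ v : Fin (n + 1) → K, ((h v ^ (n + 1) : ℕ) : ℝ)) := by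
          push_cast; ring
      _ ≤ R := by
          rw [hR]
          exact mul_le_mul_of_nonneg_left (sum_pow_floor_le f hε (n + 1)) (by positivity)
  -- let `ε → 0`
  have hcont : Continuous φ := by
    rw [hφ]
    fun_prop
  have htend : Tendsto φ (𝓝[>] 0) (𝓝 (φ 0)) :=
    (hcont.tendsto 0).mono_left nhdsWithin_le_nhds
  have hle : φ 0 ≤ R :=
    le_of_tendsto htend (eventually_nhdsWithin_of_forall fun ε hε => hbound ε hε)
  have hφ0 : φ 0 = ∑ b' : Fin n → K, maxLineSumR f b' ^ (n + 1) := by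
    rw [hφ]
    exact sum_congr rfl fun b' _ => by
      rw [mul_zero, sub_zero, max_eq_left (maxLineSumR_nonneg f b')]
  rw [← hφ0]
  exact hle

end RealValued

/-! ### Nikodym sets (EOT §4.3, Theorem 4.5) -/

section Nikodym

variable {n : ℕ}

/-- A **Nikodym set** `E ⊆ 𝔽ⁿ` in the sense of EOT Theorem 4.5: through every point `x ∉ E` there
is a line `γ ∋ x` with `γ ∖ {x} ⊆ E` (a line = `{x + t v}`, `v ≠ 0`).
[cite: EllenbergOberlinTao2010KakeyaMaximal, Theorem 4.5 (§4.3)] -/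
def IsNikodym (E : Set (Fin n → K)) : Prop :=
  ∀ x ∉ E, ∃ v : Fin n → K, v ≠ 0 ∧ ∀ t : K, t ≠ 0 → x + t • v ∈ E

/-- Unfolding lemma for `IsNikodym`. [folklore] -/
theorem isNikodym_iff (E : Set (Fin n → K)) :
    IsNikodym E ↔ ∀ x ∉ E, ∃ v : Fin n → K, v ≠ 0 ∧ ∀ t : K, t ≠ 0 → x + t • v ∈ E :=
  Iff.rfl

/-- The whole space is a Nikodym set. [folklore] -/
theorem isNikodym_univ : IsNikodym (Set.univ : Set (Fin n → K)) :=
  fun _ hx => absurd (Set.mem_univ _) hx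

/-- A superset of a Nikodym set is a Nikodym set. [folklore] -/
theorem IsNikodym.mono {E E' : Set (Fin n → K)} (hE : IsNikodym E) (h : E ⊆ E') : IsNikodym E' :=
  fun x hx => (hE x fun hxE => hx (h hxE)).imp fun _ hv => ⟨hv.1, fun t ht => h (hv.2 t ht)⟩

variable [Fintype K]

/-- **EOT Theorem 4.5 (Nikodym set conjecture for `𝔽ⁿ`), explicit form:** a Nikodym set
`E ⊆ 𝔽_qⁿ` has `|E| ≥ C(q − 2 + n, n)` (`≥ (q−1)ⁿ/n!`, so `|E| ≫ |F|ⁿ` as printed).  EOT deduce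
Theorem 4.5 from Theorem 1.1 by a projective transformation and attribute it to [Li]; the proof
here is the direct polynomial-method argument (as in Dvir's proof of Theorem 1.1,
`FiniteFieldKakeya.lean`): if `|E| < C(q − 2 + n, n)`, a nonzero `g` of degree `≤ q − 2`
vanishes on `E`; for `x ∉ E` its
restriction to the line through `x` vanishes at the `q − 1` points `≠ x`, hence identically, so
`g(x) = 0`; thus `g` vanishes on all of `𝔽_qⁿ` with `deg g < q` — impossible.
[cite: EllenbergOberlinTao2010KakeyaMaximal, Theorem 4.5 (§4.3)] -/
theorem choose_le_card_of_isNikodym {E : Finset (Fin n → K)}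
    (hE : IsNikodym (↑E : Set (Fin n → K))) : (Fintype.card K - 2 + n).choose n ≤ E.card := by
  classical
  set q := Fintype.card K with hq
  have hq2 : 2 ≤ q := by
    have := Fintype.one_lt_card (α := K)
    omega
  by_contra hlt
  push Not at hlt
  obtain ⟨g, hg0, hgdeg, hgE⟩ := exists_mvPolynomial_eval_eq_zero E (q - 2) hlt
  -- `g` vanishes everywhere
  have hall : ∀ x : Fin n → K, eval x g = 0 := by
    intro x
    by_cases hx : x ∈ E
    · exact hgE x hx
    · obtain ⟨v, -, hv⟩ := hE x (by exact_mod_cast hx)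
      -- the restriction to the line `x + t v` vanishes at the `q − 1` points `t ≠ 0`
      have hres := Extremal.aeval_line_eq_zero_of_totalDegree_lt_card x v g (univ.erase (0 : K))
        (by rw [card_erase_of_mem (mem_univ _), card_univ]; omega)
        (fun t ht => hgE _ (Finset.mem_coe.1 (hv t (ne_of_mem_erase ht))))
      have h0 := Extremal.eval_aeval_line x v g 0
      rw [hres, Polynomial.eval_zero, zero_smul, add_zero] at h0
      exact h0.symm
  obtain ⟨x, hx⟩ := exists_eval_ne_zero_of_totalDegree_lt (n := n) hg0 (by omega)
  exact hx (hall x)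

/-- The same bound unpacked: `(q − 1)ⁿ ≤ n! · |E|` for every Nikodym set `E ⊆ 𝔽_qⁿ`
(`C(q − 2 + n, n) ≥ (q−1)ⁿ/n!`). [cite: EllenbergOberlinTao2010KakeyaMaximal, Theorem 4.5 (§4.3)] -/
theorem pow_le_factorial_mul_card_of_isNikodym {E : Finset (Fin n → K)}
    (hE : IsNikodym (↑E : Set (Fin n → K))) :
    (Fintype.card K - 1) ^ n ≤ n.factorial * E.card := by
  have h1 := choose_le_card_of_isNikodym hE
  have hq2 : 2 ≤ Fintype.card K := by
    have := Fintype.one_lt_card (α := K)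
    omega
  -- `(t + 1)ⁿ ≤ n! C(t + n, n)` with `t = q − 2`
  have h2 : (Fintype.card K - 1) ^ n ≤ n.factorial * (Fintype.card K - 2 + n).choose n := by
    rw [← Nat.descFactorial_eq_factorial_mul_choose]
    have h := Nat.pow_sub_le_descFactorial (Fintype.card K - 2 + n) n
    rwa [show Fintype.card K - 2 + n + 1 - n = Fintype.card K - 1 by omega] at h
  exact h2.trans (Nat.mul_le_mul_left _ h1)

/-- Set version. [cite: EllenbergOberlinTao2010KakeyaMaximal, Theorem 4.5 (§4.3)] -/
theorem choose_le_ncard_of_isNikodym {E : Set (Fin n → K)} (hE : IsNikodym E) :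
    (Fintype.card K - 2 + n).choose n ≤ E.ncard := by
  classical
  obtain ⟨E', rfl⟩ := (Set.toFinite E).exists_finset_coe
  rw [Set.ncard_coe_finset]
  exact choose_le_card_of_isNikodym hE

end Nikodym

/-! ### All directions: the maximal function on `ℙ(𝔽_qⁿ⁺¹)` (Theorem 1.3 as printed; Remark 2.2) -/

section AllDirections

variable {n : ℕ}

open scoped LinearAlgebra.Projectivization

/-- Precomposition of coordinates with the transposition `(0 i)`: `coordSwap i x = x ∘ (0 i)`, the
linear change of variables exchanging the `0`-th and the `i`-th coordinate.  The slope chart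
`b' ↦ (1, b')` misses the directions with `v₀ = 0`; conjugating by `coordSwap i` gives the chart
of directions with `vᵢ ≠ 0`, and the `n + 1` charts cover `ℙ(𝔽ⁿ⁺¹)` — the "bounded number of
rotations" of EOT Remark 2.2 ("this transformation will leave out a codimension one set of
directions […] one can easily erase this omission by rotating the estimate a bounded number of
times and using the triangle inequality; we omit the details"). [folklore] -/
def coordSwap (i : Fin (n + 1)) (x : Fin (n + 1) → K) : Fin (n + 1) → K :=
  x ∘ Equiv.swap 0 i

omit [Field K] in
/-- Unfolding lemma for `coordSwap`. [folklore] -/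
theorem coordSwap_apply (i : Fin (n + 1)) (x : Fin (n + 1) → K) (j : Fin (n + 1)) :
    coordSwap i x j = x (Equiv.swap 0 i j) :=
  rfl

omit [Field K] in
/-- `coordSwap i` is an involution. [folklore] -/
theorem coordSwap_coordSwap (i : Fin (n + 1)) (x : Fin (n + 1) → K) :
    coordSwap i (coordSwap i x) = x := by
  ext j
  simp [coordSwap_apply, Equiv.swap_apply_self]

/-- `coordSwap i` is linear: it maps the line `a + t v` to the line `a ∘ (0 i) + t (v ∘ (0 i))`.
[folklore] -/
theorem coordSwap_add_smul (i : Fin (n + 1)) (a v : Fin (n + 1) → K) (t : K) :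
    coordSwap i (a + t • v) = coordSwap i a + t • coordSwap i v :=
  rfl

omit [Field K] in
/-- `coordSwap i` as a permutation of `𝔽ⁿ⁺¹`. [folklore] -/
def coordSwapEquiv (i : Fin (n + 1)) : (Fin (n + 1) → K) ≃ (Fin (n + 1) → K) where
  toFun := coordSwap i
  invFun := coordSwap i
  left_inv := coordSwap_coordSwap i
  right_inv := coordSwap_coordSwap i

omit [Field K] in
/-- Unfolding lemma for `coordSwapEquiv`. [folklore] -/
theorem coordSwapEquiv_apply (i : Fin (n + 1)) (x : Fin (n + 1) → K) :
    coordSwapEquiv i x = coordSwap i x :=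
  rfl

/-- The direction vector of the `i`-th chart at the slope `b'`: `(1, b')` with the coordinates `0`
and `i` exchanged (so its `i`-th coordinate is `1`). [folklore] -/
def chartVec (i : Fin (n + 1)) (b' : Fin n → K) : Fin (n + 1) → K :=
  coordSwap i (Fin.cons 1 b')

/-- Unfolding lemma for `chartVec`. [folklore] -/
theorem chartVec_eq (i : Fin (n + 1)) (b' : Fin n → K) :
    chartVec i b' = coordSwap i (Fin.cons 1 b') :=
  rfl

/-- The `i`-th coordinate of the `i`-th chart vector is `1`. [folklore] -/
theorem chartVec_apply_self (i : Fin (n + 1)) (b' : Fin n → K) : chartVec i b' i = 1 := by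
  rw [chartVec_eq, coordSwap_apply, Equiv.swap_apply_right]
  rfl

/-- Chart vectors are nonzero. [folklore] -/
theorem chartVec_ne_zero (i : Fin (n + 1)) (b' : Fin n → K) : chartVec i b' ≠ 0 := by
  intro h
  have := congr_fun h i
  rw [chartVec_apply_self, Pi.zero_apply] at this
  exact one_ne_zero this

/-- `coordSwap i` maps the `i`-th chart vector back to `(1, b')`. [folklore] -/
theorem coordSwap_chartVec (i : Fin (n + 1)) (b' : Fin n → K) :
    coordSwap i (chartVec i b') = Fin.cons 1 b' := by
  rw [chartVec_eq, coordSwap_coordSwap]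

/-- **The charts cover all directions:** every nonzero `v ∈ 𝔽ⁿ⁺¹` is `c · chartVec i b'` for some
coordinate `i` (any `i` with `vᵢ ≠ 0`), `c = vᵢ ≠ 0` and slope `b'`. [folklore] -/
theorem exists_eq_smul_chartVec {v : Fin (n + 1) → K} (hv : v ≠ 0) :
    ∃ i : Fin (n + 1), ∃ c : K, c ≠ 0 ∧ ∃ b' : Fin n → K, v = c • chartVec i b' := by
  obtain ⟨i, hi⟩ : ∃ i, v i ≠ 0 := by
    by_contra h
    push Not at h
    exact hv (funext h)
  set w : Fin (n + 1) → K := coordSwap i ((v i)⁻¹ • v) with hw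
  have hw0 : w 0 = 1 := by
    rw [hw, coordSwap_apply, Equiv.swap_apply_left, Pi.smul_apply, smul_eq_mul,
      inv_mul_cancel₀ hi]
  refine ⟨i, v i, hi, Fin.tail w, ?_⟩
  have hcons : (Fin.cons 1 (Fin.tail w) : Fin (n + 1) → K) = w := by
    rw [← hw0, Fin.cons_self_tail]
  rw [chartVec_eq, hcons, hw, coordSwap_coordSwap, smul_smul, mul_inv_cancel₀ hi, one_smul]

variable [Fintype K]

/-- The sum of `f` along the line through `a` with direction VECTOR `v`: `∑_{t ∈ 𝔽} f(a + t v)`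
(for `M = ℕ`, or `M = ℝ` applied to `|f|`: the inner sum of (1.1) for an arbitrary direction).
[cite: EllenbergOberlinTao2010KakeyaMaximal, Theorem 1.3, eq. (1.1)] -/
def dirLineSum {M : Type*} [AddCommMonoid M] (f : (Fin (n + 1) → K) → M)
    (a v : Fin (n + 1) → K) : M :=
  ∑ t : K, f (a + t • v)

/-- Unfolding lemma for `dirLineSum`. [folklore] -/
theorem dirLineSum_eq {M : Type*} [AddCommMonoid M] (f : (Fin (n + 1) → K) → M)
    (a v : Fin (n + 1) → K) : dirLineSum f a v = ∑ t : K, f (a + t • v) :=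
  rfl

/-- In the direction `(1, b')`, `dirLineSum` is `lineSum`. [folklore] -/
theorem dirLineSum_cons (f : (Fin (n + 1) → K) → ℕ) (a : Fin (n + 1) → K) (b' : Fin n → K) :
    dirLineSum f a (Fin.cons 1 b') = lineSum f a b' :=
  rfl

/-- **Reparametrization:** `∑_t f(a + t (c v)) = ∑_t f(a + t v)` for `c ≠ 0` — the line sum only
depends on the direction `[v] ∈ ℙ(𝔽ⁿ⁺¹)`. [folklore] -/
theorem dirLineSum_smul {M : Type*} [AddCommMonoid M] (f : (Fin (n + 1) → K) → M)
    (a v : Fin (n + 1) → K) {c : K} (hc : c ≠ 0) :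
    dirLineSum f a (c • v) = dirLineSum f a v := by
  simp only [dirLineSum_eq, smul_smul]
  exact Fintype.sum_equiv (Equiv.mulRight₀ c hc) _ _ fun t => rfl

/-- **Change of chart:** the line sums of `f` in direction `v` are the line sums of
`f ∘ coordSwap i` in direction `coordSwap i v`. [folklore] -/
theorem dirLineSum_coordSwap {M : Type*} [AddCommMonoid M] (f : (Fin (n + 1) → K) → M)
    (i : Fin (n + 1)) (a v : Fin (n + 1) → K) :
    dirLineSum (fun y => f (coordSwap i y)) (coordSwap i a) (coordSwap i v) = dirLineSum f a v := by
  simp only [dirLineSum_eq]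
  exact sum_congr rfl fun t _ => by rw [← coordSwap_add_smul, coordSwap_coordSwap]

/-- **The Kakeya maximal function at a direction vector** `v`: `sup_a ∑_t f(a + t v)` (values in
a linear order `M`; `M = ℕ`, or `M = ℝ` with `|f|`).
[cite: EllenbergOberlinTao2010KakeyaMaximal, Theorem 1.3, eq. (1.1)] -/
def dirMaxLineSum {M : Type*} [AddCommMonoid M] [LinearOrder M] (f : (Fin (n + 1) → K) → M)
    (v : Fin (n + 1) → K) : M :=
  (univ : Finset (Fin (n + 1) → K)).sup' univ_nonempty fun a => dirLineSum f a v

/-- Every line sum is at most the maximal function. [folklore] -/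
theorem dirLineSum_le_dirMaxLineSum {M : Type*} [AddCommMonoid M] [LinearOrder M]
    (f : (Fin (n + 1) → K) → M) (a v : Fin (n + 1) → K) :
    dirLineSum f a v ≤ dirMaxLineSum f v :=
  Finset.le_sup' (f := fun a => dirLineSum f a v) (mem_univ a)

/-- The maximal function is attained by some line. [folklore] -/
theorem exists_dirLineSum_eq_dirMaxLineSum {M : Type*} [AddCommMonoid M] [LinearOrder M]
    (f : (Fin (n + 1) → K) → M) (v : Fin (n + 1) → K) :
    ∃ a : Fin (n + 1) → K, dirLineSum f a v = dirMaxLineSum f v := by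
  obtain ⟨a, -, ha⟩ := Finset.exists_mem_eq_sup' (univ_nonempty (α := Fin (n + 1) → K))
    fun a => dirLineSum f a v
  exact ⟨a, ha.symm⟩

/-- The maximal function only depends on the direction: `f*(c v) = f*(v)` for `c ≠ 0`.
[folklore] -/
theorem dirMaxLineSum_smul {M : Type*} [AddCommMonoid M] [LinearOrder M]
    (f : (Fin (n + 1) → K) → M) (v : Fin (n + 1) → K) {c : K} (hc : c ≠ 0) :
    dirMaxLineSum f (c • v) = dirMaxLineSum f v := by
  unfold dirMaxLineSum
  exact Finset.sup'_congr univ_nonempty rfl fun a _ => dirLineSum_smul f a v hc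

/-- **Change of chart for the maximal function:** `(f ∘ coordSwap i)*(coordSwap i v) = f*(v)`.
[folklore] -/
theorem dirMaxLineSum_coordSwap {M : Type*} [AddCommMonoid M] [LinearOrder M]
    (f : (Fin (n + 1) → K) → M) (i : Fin (n + 1)) (v : Fin (n + 1) → K) :
    dirMaxLineSum (fun y => f (coordSwap i y)) (coordSwap i v) = dirMaxLineSum f v := by
  apply le_antisymm
  · obtain ⟨a, ha⟩ := exists_dirLineSum_eq_dirMaxLineSum (fun y => f (coordSwap i y))
      (coordSwap i v)
    have h := dirLineSum_coordSwap f i (coordSwap i a) v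
    rw [coordSwap_coordSwap] at h
    rw [← ha, h]
    exact dirLineSum_le_dirMaxLineSum f _ v
  · obtain ⟨a, ha⟩ := exists_dirLineSum_eq_dirMaxLineSum f v
    rw [← ha, ← dirLineSum_coordSwap f i a v]
    exact dirLineSum_le_dirMaxLineSum _ _ _

/-- In the `i`-th chart the maximal function at `chartVec i b'` is the slope maximal function of
`f ∘ coordSwap i` at `b'` (generic form). [folklore] -/
theorem dirMaxLineSum_chartVec {M : Type*} [AddCommMonoid M] [LinearOrder M]
    (f : (Fin (n + 1) → K) → M) (i : Fin (n + 1)) (b' : Fin n → K) :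
    dirMaxLineSum f (chartVec i b') =
      dirMaxLineSum (fun y => f (coordSwap i y)) (Fin.cons 1 b') := by
  rw [← dirMaxLineSum_coordSwap f i, coordSwap_chartVec]

/-- For `f : 𝔽ⁿ⁺¹ → ℕ` and the direction `(1, b')`, `dirMaxLineSum` is `maxLineSum`. [folklore] -/
theorem dirMaxLineSum_cons (f : (Fin (n + 1) → K) → ℕ) (b' : Fin n → K) :
    dirMaxLineSum f (Fin.cons 1 b') = maxLineSum f b' := by
  unfold dirMaxLineSum maxLineSum
  rw [Finset.sup'_eq_sup]
  rfl

omit [Field K] in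
/-- `∑_y g(coordSwap i y) = ∑_x g(x)` (a permutation of `𝔽ⁿ⁺¹`). [folklore] -/
theorem sum_comp_coordSwap {M : Type*} [AddCommMonoid M] (g : (Fin (n + 1) → K) → M)
    (i : Fin (n + 1)) : ∑ y : Fin (n + 1) → K, g (coordSwap i y) = ∑ x : Fin (n + 1) → K, g x :=
  Fintype.sum_equiv (coordSwapEquiv i) _ _ fun _ => rfl

/-- **Covering `ℙ(𝔽ⁿ⁺¹)` by the charts:** for `F ≥ 0`,
`∑_{ω ∈ ℙ} F(ω) ≤ ∑_i ∑_{b'} F([chartVec i b'])`. [folklore] -/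
theorem sum_proj_le_sum_charts {M : Type*} [AddCommMonoid M] [Preorder M] [AddLeftMono M]
    [Fintype (ℙ K (Fin (n + 1) → K))] (F : ℙ K (Fin (n + 1) → K) → M) (hF : ∀ ω, 0 ≤ F ω) :
    ∑ ω : ℙ K (Fin (n + 1) → K), F ω ≤
      ∑ i : Fin (n + 1), ∑ b' : Fin n → K,
        F (Projectivization.mk K (chartVec i b') (chartVec_ne_zero i b')) := by
  classical
  set S := (univ : Finset (Fin (n + 1))) ×ˢ (univ : Finset (Fin n → K)) with hS
  set φ : Fin (n + 1) × (Fin n → K) → ℙ K (Fin (n + 1) → K) :=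
    fun p => Projectivization.mk K (chartVec p.1 p.2) (chartVec_ne_zero p.1 p.2) with hφ
  have hcov : (univ : Finset (ℙ K (Fin (n + 1) → K))) ⊆ S.image φ := by
    intro ω _
    induction ω using Projectivization.ind with
    | h v hv =>
      obtain ⟨i, c, hc, b', rfl⟩ := exists_eq_smul_chartVec hv
      refine mem_image.2 ⟨(i, b'), by simp [hS], ?_⟩
      exact ((Projectivization.mk_eq_mk_iff' K _ _ hv (chartVec_ne_zero i b')).2 ⟨c, rfl⟩).symm
  calc ∑ ω : ℙ K (Fin (n + 1) → K), F ω
      ≤ ∑ ω ∈ S.image φ, F ω := sum_le_sum_of_subset_of_nonneg hcov fun ω _ _ => hF ω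
    _ ≤ ∑ p ∈ S, F (φ p) := sum_image_le_of_nonneg fun ω _ => hF ω
    _ = ∑ i : Fin (n + 1), ∑ b' : Fin n → K,
          F (Projectivization.mk K (chartVec i b') (chartVec_ne_zero i b')) := by
        rw [hS, sum_product]

/-- **The Kakeya maximal function on `ℙ(𝔽ⁿ⁺¹)`** (the printed `f* : P^{N−1}(F) → ℝ`, here for
`f : 𝔽ⁿ⁺¹ → M`): `f*(ω) = sup_{ℓ ∥ ω} ∑_{x ∈ ℓ} f(x)`, well defined by `dirMaxLineSum_smul`.
[cite: EllenbergOberlinTao2010KakeyaMaximal, Theorem 1.3, eq. (1.1)] -/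
def projMaxLineSum {M : Type*} [AddCommMonoid M] [LinearOrder M] (f : (Fin (n + 1) → K) → M) :
    ℙ K (Fin (n + 1) → K) → M :=
  Projectivization.lift (fun v => dirMaxLineSum f v.1) (by
    rintro ⟨a, ha⟩ ⟨b, hb⟩ t h
    have ht : t ≠ 0 := by
      rintro rfl
      exact ha (by simpa using h)
    change dirMaxLineSum f a = dirMaxLineSum f b
    rw [show a = t • b from h, dirMaxLineSum_smul f b ht])

/-- `f*([v]) = f*(v)`. [folklore] -/
theorem projMaxLineSum_mk {M : Type*} [AddCommMonoid M] [LinearOrder M]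
    (f : (Fin (n + 1) → K) → M) (v : Fin (n + 1) → K) (hv : v ≠ 0) :
    projMaxLineSum f (Projectivization.mk K v hv) = dirMaxLineSum f v :=
  rfl

/-- For `f : 𝔽ⁿ⁺¹ → ℝ` and the direction `(1, b')`, `dirMaxLineSum |f|` is `maxLineSumR f`.
[folklore] -/
theorem dirMaxLineSum_abs_cons (f : (Fin (n + 1) → K) → ℝ) (b' : Fin n → K) :
    dirMaxLineSum (fun x => |f x|) (Fin.cons 1 b') = maxLineSumR f b' :=
  rfl

/-- The real maximal function of `|f|` is non-negative. [folklore] -/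
theorem projMaxLineSum_abs_nonneg (f : (Fin (n + 1) → K) → ℝ) (ω : ℙ K (Fin (n + 1) → K)) :
    0 ≤ projMaxLineSum (fun x => |f x|) ω := by
  induction ω using Projectivization.ind with
  | h v hv =>
    rw [projMaxLineSum_mk]
    obtain ⟨a, ha⟩ := exists_dirLineSum_eq_dirMaxLineSum (fun x => |f x|) v
    rw [← ha, dirLineSum_eq]
    exact sum_nonneg fun t _ => abs_nonneg _

variable [DecidableEq K]

/-- **Covering the nonzero direction vectors by the charts:** for `F ≥ 0`,
`∑_{v ≠ 0} F(v) ≤ ∑_i ∑_{c ≠ 0} ∑_{b'} F(c · chartVec i b')`. [folklore] -/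
theorem sum_ne_zero_le_sum_charts {M : Type*} [AddCommMonoid M] [Preorder M] [AddLeftMono M]
    (F : (Fin (n + 1) → K) → M) (hF : ∀ v, 0 ≤ F v) :
    ∑ v ∈ univ.filter (fun v : Fin (n + 1) → K => v ≠ 0), F v ≤
      ∑ i : Fin (n + 1), ∑ c ∈ univ.filter (fun c : K => c ≠ 0), ∑ b' : Fin n → K,
        F (c • chartVec i b') := by
  classical
  set S := (univ : Finset (Fin (n + 1))) ×ˢ ((univ.filter fun c : K => c ≠ 0) ×ˢ
    (univ : Finset (Fin n → K))) with hS
  set φ : Fin (n + 1) × (K × (Fin n → K)) → (Fin (n + 1) → K) :=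
    fun p => p.2.1 • chartVec p.1 p.2.2 with hφ
  have hcov : (univ.filter fun v : Fin (n + 1) → K => v ≠ 0) ⊆ S.image φ := by
    intro v hv
    rw [mem_filter] at hv
    obtain ⟨i, c, hc, b', rfl⟩ := exists_eq_smul_chartVec hv.2
    exact mem_image.2 ⟨(i, c, b'), by simp [hS, hc], rfl⟩
  calc ∑ v ∈ univ.filter (fun v : Fin (n + 1) → K => v ≠ 0), F v
      ≤ ∑ v ∈ S.image φ, F v := sum_le_sum_of_subset_of_nonneg hcov fun v _ _ => hF v
    _ ≤ ∑ p ∈ S, F (φ p) := sum_image_le_of_nonneg fun v _ => hF v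
    _ = ∑ i : Fin (n + 1), ∑ c ∈ univ.filter (fun c : K => c ≠ 0), ∑ b' : Fin n → K,
          F (c • chartVec i b') := by
        rw [hS, sum_product]
        exact sum_congr rfl fun i _ => by rw [sum_product]

/-- **THEOREM 1.3 over all direction vectors, `f : 𝔽_qⁿ⁺¹ → ℕ`:**
`∑_{v ≠ 0} f*(v)ᴺ ≤ (n+1)(q−1) · C qⁿ ∑_x f(x)ᴺ` (each direction counted `q − 1` times;
`C = maxConst n`). [cite: EllenbergOberlinTao2010KakeyaMaximal, Theorem 1.3, Remark 2.2] -/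
theorem sum_ne_zero_pow_dirMaxLineSum_le (hn : 1 ≤ n) (f : (Fin (n + 1) → K) → ℕ) :
    ∑ v ∈ univ.filter (fun v : Fin (n + 1) → K => v ≠ 0), dirMaxLineSum f v ^ (n + 1) ≤
      (n + 1) * (Fintype.card K - 1) *
        (maxConst n * Fintype.card K ^ n * ∑ x : Fin (n + 1) → K, f x ^ (n + 1)) := by
  classical
  have h1 := sum_ne_zero_le_sum_charts (fun v => dirMaxLineSum f v ^ (n + 1)) fun v => Nat.zero_le _
  refine h1.trans ?_
  have h2 : ∀ i : Fin (n + 1), ∀ c ∈ univ.filter (fun c : K => c ≠ 0),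
      ∑ b' : Fin n → K, dirMaxLineSum f (c • chartVec i b') ^ (n + 1) ≤
        maxConst n * Fintype.card K ^ n * ∑ x : Fin (n + 1) → K, f x ^ (n + 1) := by
    intro i c hc
    rw [mem_filter] at hc
    have h3 := sum_pow_maxLineSum_le hn (fun y => f (coordSwap i y))
    rw [sum_comp_coordSwap (fun x => f x ^ (n + 1)) i] at h3
    refine le_trans (le_of_eq (sum_congr rfl fun b' _ => ?_)) h3
    rw [dirMaxLineSum_smul f _ hc.2, dirMaxLineSum_chartVec, dirMaxLineSum_cons]
  calc ∑ i : Fin (n + 1), ∑ c ∈ univ.filter (fun c : K => c ≠ 0), ∑ b' : Fin n → K,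
        dirMaxLineSum f (c • chartVec i b') ^ (n + 1)
      ≤ ∑ i : Fin (n + 1), ∑ c ∈ univ.filter (fun c : K => c ≠ 0),
          maxConst n * Fintype.card K ^ n * ∑ x : Fin (n + 1) → K, f x ^ (n + 1) :=
        sum_le_sum fun i _ => sum_le_sum fun c hc => h2 i c hc
    _ = (n + 1) * (Fintype.card K - 1) *
          (maxConst n * Fintype.card K ^ n * ∑ x : Fin (n + 1) → K, f x ^ (n + 1)) := by
        rw [sum_const, sum_const, card_univ, Fintype.card_fin, smul_eq_mul, smul_eq_mul,
          filter_ne' univ (0 : K), card_erase_of_mem (mem_univ _), card_univ]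
        ring

/-- **THEOREM 1.3 on `ℙ(𝔽_qⁿ⁺¹)`, `f : 𝔽_qⁿ⁺¹ → ℕ`:**
`∑_{ω ∈ ℙ(𝔽ⁿ⁺¹)} f*(ω)ᴺ ≤ (n+1) C qⁿ ∑_x f(x)ᴺ` (`C = maxConst n`; the sum over the finite type
`ℙ(𝔽ⁿ⁺¹)` — `Projectivization`, which carries `Finite` but no `Fintype` instance — is written as a
`finsum`; rewrite with `finsum_eq_sum_of_fintype` under any `Fintype` instance).
[cite: EllenbergOberlinTao2010KakeyaMaximal, Theorem 1.3, Remark 2.2] -/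
theorem finsum_pow_projMaxLineSum_le (hn : 1 ≤ n) (f : (Fin (n + 1) → K) → ℕ) :
    ∑ᶠ ω : ℙ K (Fin (n + 1) → K), projMaxLineSum f ω ^ (n + 1) ≤
      (n + 1) * (maxConst n * Fintype.card K ^ n * ∑ x : Fin (n + 1) → K, f x ^ (n + 1)) := by
  classical
  haveI : Fintype (ℙ K (Fin (n + 1) → K)) := Fintype.ofFinite _
  rw [finsum_eq_sum_of_fintype]
  have h1 := sum_proj_le_sum_charts (fun ω => projMaxLineSum f ω ^ (n + 1)) fun ω => Nat.zero_le _
  refine h1.trans ?_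
  have h2 : ∀ i : Fin (n + 1), ∑ b' : Fin n → K,
      projMaxLineSum f (Projectivization.mk K (chartVec i b') (chartVec_ne_zero i b')) ^ (n + 1) ≤
        maxConst n * Fintype.card K ^ n * ∑ x : Fin (n + 1) → K, f x ^ (n + 1) := by
    intro i
    have h3 := sum_pow_maxLineSum_le hn (fun y => f (coordSwap i y))
    rw [sum_comp_coordSwap (fun x => f x ^ (n + 1)) i] at h3
    refine le_trans (le_of_eq (sum_congr rfl fun b' _ => ?_)) h3
    rw [projMaxLineSum_mk, dirMaxLineSum_chartVec, dirMaxLineSum_cons]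
  calc ∑ i : Fin (n + 1), ∑ b' : Fin n → K,
        projMaxLineSum f (Projectivization.mk K (chartVec i b') (chartVec_ne_zero i b')) ^ (n + 1)
      ≤ ∑ i : Fin (n + 1),
          maxConst n * Fintype.card K ^ n * ∑ x : Fin (n + 1) → K, f x ^ (n + 1) :=
        sum_le_sum fun i _ => h2 i
    _ = (n + 1) * (maxConst n * Fintype.card K ^ n * ∑ x : Fin (n + 1) → K, f x ^ (n + 1)) := by
        rw [sum_const, card_univ, Fintype.card_fin, smul_eq_mul]

/-- **THEOREM 1.3 (Kakeya maximal conjecture for `𝔽ⁿ⁺¹`) as printed — all directions,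
`f : 𝔽_qⁿ⁺¹ → ℝ`:** with `f*(ω) = sup_{ℓ ∥ ω} ∑_{x ∈ ℓ} |f(x)|` for `ω ∈ ℙ(𝔽_qⁿ⁺¹) = P^{N−1}(F)`,
`∑_{ω} f*(ω)ᴺ ≤ (n+1) · 2^{5n+7} (n+1) (4(n+1))ᴺ · qⁿ · ∑_x |f(x)|ᴺ`, i.e.
`‖f*‖_{ℓᴺ(P^{N−1}(F))} ≤ C_N |F|^{(N−1)/N} ‖f‖_{ℓᴺ(Fᴺ)}` — inequality (1.1) — from the slope-chart
version `kakeya_maximal_inequality` by covering `P^{N−1}(F)` with the `N` charts `{vᵢ ≠ 0}`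
(Remark 2.2). [cite: EllenbergOberlinTao2010KakeyaMaximal, Theorem 1.3, eq. (1.1), Remark 2.2] -/
theorem kakeya_maximal_inequality_proj (hn : 1 ≤ n) (f : (Fin (n + 1) → K) → ℝ) :
    ∑ᶠ ω : ℙ K (Fin (n + 1) → K), projMaxLineSum (fun x => |f x|) ω ^ (n + 1) ≤
      (n + 1 : ℝ) * ((maxConst n : ℝ) * (Fintype.card K : ℝ) ^ n *
        ∑ x : Fin (n + 1) → K, |f x| ^ (n + 1)) := by
  classical
  haveI : Fintype (ℙ K (Fin (n + 1) → K)) := Fintype.ofFinite _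
  rw [finsum_eq_sum_of_fintype]
  have h1 := sum_proj_le_sum_charts (fun ω => projMaxLineSum (fun x => |f x|) ω ^ (n + 1))
    fun ω => pow_nonneg (projMaxLineSum_abs_nonneg f ω) _
  refine h1.trans ?_
  have h2 : ∀ i : Fin (n + 1), ∑ b' : Fin n → K,
      projMaxLineSum (fun x => |f x|)
        (Projectivization.mk K (chartVec i b') (chartVec_ne_zero i b')) ^ (n + 1) ≤
        (maxConst n : ℝ) * (Fintype.card K : ℝ) ^ n * ∑ x : Fin (n + 1) → K, |f x| ^ (n + 1) := by
    intro i
    have h3 := kakeya_maximal_inequality hn (fun y => f (coordSwap i y))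
    rw [sum_comp_coordSwap (fun x => |f x| ^ (n + 1)) i] at h3
    refine le_trans (le_of_eq (sum_congr rfl fun b' _ => ?_)) h3
    rw [projMaxLineSum_mk, dirMaxLineSum_chartVec, ← dirMaxLineSum_abs_cons]
  calc ∑ i : Fin (n + 1), ∑ b' : Fin n → K, projMaxLineSum (fun x => |f x|)
          (Projectivization.mk K (chartVec i b') (chartVec_ne_zero i b')) ^ (n + 1)
      ≤ ∑ i : Fin (n + 1), (maxConst n : ℝ) * (Fintype.card K : ℝ) ^ n *
          ∑ x : Fin (n + 1) → K, |f x| ^ (n + 1) := sum_le_sum fun i _ => h2 i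
    _ = (n + 1 : ℝ) * ((maxConst n : ℝ) * (Fintype.card K : ℝ) ^ n *
          ∑ x : Fin (n + 1) → K, |f x| ^ (n + 1)) := by
        rw [sum_const, card_univ, Fintype.card_fin, nsmul_eq_mul, Nat.cast_add, Nat.cast_one]

end AllDirections

end FiniteFieldKakeya

end Literature.Combinatorics.Kakeya
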